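import Literature.AlgebraicGeometry.ShimuraVarieties.UnitaryShimuraCanonicalModelPrintedForm
import Literature.AlgebraicGeometry.ShimuraVarieties.UnitaryAuxiliaryTorusDatum
import Literature.AlgebraicGeometry.ShimuraVarieties.UnitaryAuxiliaryCanonicalModelPrinted
import Literature.AlgebraicGeometry.ShimuraVarieties.UnitaryCanonicalDescentPredicates
import Literature.AlgebraicGeometry.ShimuraVarieties.UnitaryAuxiliaryReflexTransport
import Literature.AlgebraicGeometry.ShimuraVarieties.UnitaryAuxiliaryReflexArtinSurjective
import Literature.AlgebraicGeometry.ShimuraVarieties.UnitaryAuxiliaryReflexArtinNorm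
import Literature.AlgebraicGeometry.ShimuraVarieties.UnitaryAuxiliaryTorusClassNumberProofs
import Literature.AlgebraicGeometry.ShimuraVarieties.UnitaryAuxiliaryTorusUnitLevel
import Literature.AlgebraicGeometry.ShimuraVarieties.UnitaryAuxiliaryHeckeQuotientDescent
import Literature.AlgebraicGeometry.ShimuraVarieties.UnitaryAuxiliaryHeckeQuotientDescentGeneral
import Literature.AlgebraicGeometry.ShimuraVarieties.UnitaryShimuraCanonicalModelPrintedForm
import Summits.HodgeConjecture.CorCM.HypDel.HypDelGaloisCaseOfF1
import Summits.HodgeConjecture.CorCM.HypDel.BaseDescentOfDescentToIntersection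
import Summits.HodgeConjecture.CorCM.HypDel.ReflexIntersectionObstruction
import Summits.HodgeConjecture.HodgeConjecture.Theses.HCCMUnconditional
import Literature.AlgebraicGeometry.ShimuraVarieties.UnitaryAuxiliaryTorusClassNumber
import Literature.AlgebraicGeometry.ShimuraVarieties.UnitaryShimuraReciprocityTwistInvariance
import Literature.AlgebraicGeometry.ShimuraVarieties.UnitaryAuxiliaryTorusReflexNorm
import Literature.AlgebraicGeometry.ShimuraVarieties.UnitaryShimuraCanonicalModelNonVacuity
import Literature.AlgebraicGeometry.ShimuraVarieties.UnitaryShimuraComplexFibreGalois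
import Literature.NumberTheory.Automorphic.UnitaryGroupFrameHermitian
import Literature.AlgebraicGeometry.Motives.FiniteCoproductVarieties
import Literature.AlgebraicGeometry.Motives.SeparatedQuotient
import Literature.AlgebraicGeometry.Motives.TorsorCoproductQuotient
import Literature.AlgebraicGeometry.Motives.FiniteQuotientFunctor
import Literature.AlgebraicGeometry.Motives.FiniteQuotientBaseChange
import Literature.NumberTheory.ComplexMultiplication.CMTypeGaloisClassesInduced
import Literature.NumberTheory.ComplexMultiplication.CMTypeCount
import Literature.NumberTheory.ComplexMultiplication.InducedCMType
import Literature.NumberTheory.ComplexMultiplication.CMTypeQuadraticTwist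
import Literature.AlgebraicGeometry.ShimuraVarieties.UnitaryAuxiliaryTorusDatumExt
import Literature.AlgebraicGeometry.ShimuraVarieties.UnitaryAuxiliaryHeckeQuotientDescentExt
import Literature.AlgebraicGeometry.ShimuraVarieties.UnitaryAuxiliaryCanonicalModelPrintedOfExt
import Literature.NumberTheory.NumberFields.QuadraticTwistCompositum
import Summits.HodgeConjecture.HodgeConjecture.Theorems.HDelOfHodgeTypeExt
import Literature.AlgebraicGeometry.ShimuraVarieties.UnitaryCanonicalModelDescentToIntersectionHolds
import HarnessLib

/-!
# Line `HeckeQuotient` (target `HeckeQuotientDescent`) for the binder `HypDel`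
# (`UnitaryCanonicalModel.canonicalModel_exists_printed` ⇔ `canonicalModel_exists_form`): the FINITE HECKE QUOTIENT step
# of Chain B ([Deligne1971TravauxShimura] Prop. 5.11 with (5.11.1) and Cor. 5.7; B1-SPEC §1 rows F2a/F2b, merged)

SKELETON (crux workfile draft, cell `hodgecm-mathlib`, fan B, rung B-I; seat `hodgecm-mathlib-B-plan2`).
HC_CM is proved only modulo the 7 printed citations until rung 0 closes; this file isolates the one step of the
Hodge-type route to `HypDel` that is pure algebraic geometry over the reflex field and needs no Shimura vocabulary.

STATE v13 (2026-08-28, K-TWIST cut of record — read §18 first): head `HDel_proof : …HCCMUnconditional.HDel` from EXACTLY ONE registered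
printed-citation stub, `stub_F1ext` (I-1′ = [Deligne 1979] 2.3.1/2.2.5 for the quadratic-twisted auxiliary Hodge-type datum of 2.3.10, fact
`Aux.canonicalModel_exists_ext_printed`); I-6 (`stub_I6`, [Deligne 1971] Prop. 5.10) is a THEOREM by name since v13 (p616273), P3 (A-p05 p608612),
P2 (A-p06 p608990) and I-1 (F1 ⇐ I-1′, B-typ03 p609239) since v12/v12b; the in-file AUDIT junction to fan A's `HDel_of_ext` (p610565) is v12c.
§§0–16 (v1–v10) and §17 (v11 census line, a second road fed by the same leaf) are unchanged in statement text.  The paragraphs below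
describe the v7 state of §§0–9.

WHY THIS LINE.  Chain B reaches the datum `(G, h_U) = (Res_{L⁺/ℚ} U(H), 𝔹²)` from the HODGE-TYPE datum
`(G̃, h_U × h_Φ)`, `G̃ = G × T₀ ≅ T₀ ×_{𝔾_m} GU_ℚ(V)` ([RapoportSmithlingZhang2017] §2–§3.1, [Liu2021] App. C (C.4)–(C.6)),
whose canonical model over `E♯ = τ(L)·E_Φ` is Deligne's theorem for Hodge type (2.3.1; the named fact F1 =
`Aux.canonicalModel_exists_printed`, typer B-typ03).  Because `G̃ = G × T₀` is a PRODUCT datum and `X̃ = X`, the complex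
Shimura variety of `G̃` at level `K × L₀` is `Δ` disjoint copies of `Sh_K(G)(ℂ) = Sc.Mc_K`, `Δ := T₀(ℚ)\T₀(𝔸_f)/L₀` a finite
abelian group acting by Hecke translations (permuting the copies simply transitively), and Deligne's (5.11.1) recovers the model
of `Sh_K(G)` as the QUOTIENT of the model `N_K` of `Sh_{K×L₀}(G̃)` by `Δ` — a quotient of a projective `E♯`-scheme by a
finite group of `E♯`-automorphisms (Mumford AV §7; tree `Motives.finiteQuotient`), whose base change to `ℂ` is the quotient
of `∐_Δ Sc.Mc_K` by the translation action, i.e. `Sc.Mc_K` itself; the reciprocity law of `N` at the special points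
`([x,a], δ)` — «`σ` moves copy `δ` to SOME copy `δ'` and `[x,a]` to `[x, r_x(s)a]`» — descends to (62) for the quotient because
the quotient forgets `δ`.  In the GALOIS case `E♯ = τ(L)` ([Liu2021] Rem. C.15; tree `reflexField_le_normalClosure`), so
`HeckeQuotientDescent` + F1 (+ the torus reciprocity supplying `δ'`) give A-plan1's `stub_reflexCompositumModel` at
`E = τ(L)` and hence `HypDel` in its Galois edition (director RULING D-I2, interim α-shape: this is the `StubGaloisCase` leg).
Mathlib HAS: schemes, `Over` categories, coproduct cofans, closed immersions/separated/proper; the TREE HAS: `finiteQuotient`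
with `desc`/`desc_unique`/separatedness (Motives/FiniteQuotient.lean :196–:313), `AlgPoints.baseChangeEquiv`, `map_smul`,
descent of smoothness/projectivity along `τ` (`smoothOfRelativeDimension_of_form`, `isProjectiveOver_of_form`,
`canonicalModel_exists_printed_iff_form`); Mathlib LACKS: quotients of schemes by finite groups (tree supplies), and the
lemma that such quotients COMMUTE WITH FLAT BASE CHANGE (`stub_quotient_baseChange`, the one new piece of commutative
algebra: `(A^Δ) ⊗_L ℂ = (A ⊗_L ℂ)^Δ`).

COMPOSITION (kernel-checked): generic `quotientReciprocityDescent_of` (any base `E`, any test relations), then the instances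
`heckeQuotientDescentOver_of` (base `E`, A-plan1 shape) and `heckeQuotientDescent_of : StubQuotientFunctor → StubQuotientBaseChange → StubTorsorQuotient →
HeckeQuotientDescent`; STATE v7: all four registered stubs of the crux line — `stub_quotientFunctor` (p592880),
`stub_quotientBaseChange` (p592797), `stub_torsorQuotient` (p591996), `stub_reflexTransport` (p593565) — are CLOSED by tree
theorems with their statement texts unchanged, and §9 proves the heads outright (`…_holds`, `galoisLegDescentOver_of_F1`:
kernel axioms = the Lean trio); the only sorries left are the two SUPPORT stubs of the optional general-degree transport T⁺
(§8: `stub_artinSurjectiveReflex`, `stub_artinNormFunctorial`).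

References: [Deligne1971TravauxShimura] 5.7, 5.11, (5.11.1) (pp. 158–159); [Deligne1979ShimuraVarieties] 2.2.5, 2.3.1;
[MumfordAV1970] §7 Thm. p. 66; [SGA1] V §1; [GortzWedhorn2020] 14.57; [RapoportSmithlingZhang2017] §3.1; [Liu2021] App. C.
-/

set_option autoImplicit false

noncomputable section

open Function MulAction Topology NumberField IsDedekindDomain CategoryTheory CategoryTheory.Limits Matrix
  AlgebraicGeometry
open scoped Matrix ComplexOrder
open Literature.AlgebraicGeometry Literature.AlgebraicGeometry.Motives
open Literature.NumberTheory.Automorphic Literature.NumberTheory.Automorphic.UnitaryGroup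
open Literature.NumberTheory.Automorphic.Liu2021.AppendixC (C5.OpenCompactSubgroup C5.SmallLevel)
open Literature.Geometry.ComplexHyperbolic Literature.Geometry.ComplexHyperbolic.BallModel
open Literature.NumberTheory.Automorphic.ShimuraDissection
open Literature.AlgebraicGeometry.ShimuraVarieties Literature.AlgebraicGeometry.ShimuraVarieties.UnitaryCanonicalModel
open Literature.NumberTheory.ComplexMultiplication (reflexNormFiniteIdele)
open Literature.NumberTheory.AdelicBaseChange (finiteIdeleRelNorm)

namespace Summit.HodgeConjecture.CorCM.Cruxes.HypDel.HeckeQuotient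

/-! ### §0. The categorical quotient by a finite group, tested against separated schemes

Since v4 the predicate `IsSepQuotient act p` («`p` is `Δ`-invariant and every invariant `k`-morphism to a SEPARATED
`k`-scheme factors uniquely through `p`», [MumfordAV1970] §7 Thm. p. 66 restricted to separated tests = what the tree's
`Motives.finiteQuotient.desc`/`desc_unique` provide) is the TREE declaration
`Literature.AlgebraicGeometry.Motives.IsSepQuotient` (Motives/SeparatedQuotient.lean, B-p05 p591411 — text byte-identical
to this file's former §0 `def`, universe-polymorphic); every use below resolves to it through `open … Motives`.
Since v7 the reciprocity PREDICATES `formPointsEquiv`, `IsCanonicalDescentOver`, `isCanonicalDescentOver_iff`,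
`IsCanonicalDescentUpTo` (§3), `IsCanonicalDescentOverReflex` (§6), `IsCanonicalDescentAtReflex`,
`isCanonicalDescentAtReflex_iff_over` (§7) are the TREE declarations of
`Literature.AlgebraicGeometry.ShimuraVarieties.UnitaryCanonicalModel` (UnitaryCanonicalDescentPredicates.lean, B-typ03
p593458, bodies byte-identical to v6); every use below resolves to them through `open … UnitaryCanonicalModel`. -/

/-! ### §1. The three stubs -/

/-- **stub (functorial finite quotient over `L`)**: a projective system `N : J ⥤ (L-schemes)` of PROJECTIVE `L`-schemes
with a finite group `Δ` acting on every `N_j` by `L`-automorphisms compatibly with the transitions has a quotient system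
`q : N ⟶ M`, `M_j = N_j/Δ` separated, `q_j` invariant and a quotient for separated test objects.  Tree: `M_j :=
Motives.finiteQuotient` (every orbit lies in an affine open because `N_j` is projective,
`forall_exists_stableAffineOpen_of_isProjectiveOver` :162; separated :257; `desc` :276, `mk_desc` :285, `desc_unique` :293
give the transition maps, their functoriality and the universal property).  Size M (conversion `Δ →* Aut` ↦
`RelativeSpec.ActionOver`, naturality bookkeeping).  Why it might fail as typed: only if `IsProjectiveOver` were too weak
to put orbits in affine opens — it is the tree's closed-immersion-into-`ℙⁿ` notion, so it is not.
[cite: MumfordAV1970, §7 Thm. p. 66] [cite: SGA1, Exp. V Prop. 1.8] -/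
def StubQuotientFunctor : Prop :=
  ∀ (L : Type) [Field L] (J : Type) [SmallCategory J] (Δ : Type) [Group Δ] [Fintype Δ] (N : J ⥤ SchemeOver L),
    (∀ j : J, IsProjectiveOver (N.obj j)) →
    ∀ ρ : ∀ j : J, Δ →* Aut (N.obj j),
      (∀ (j j' : J) (f : j ⟶ j') (g : Δ), (ρ j g).hom ≫ N.map f = N.map f ≫ (ρ j' g).hom) →
      ∃ (M : J ⥤ SchemeOver L) (q : N ⟶ M),
        (∀ j : J, IsSeparated (M.obj j).hom) ∧ (∀ j : J, IsProjectiveOver (N.obj j) ∧ IsSepQuotient (fun g => ρ j g) (q.app j))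

/-- **stub (finite-group quotients commute with base change to `ℂ`)**: if `p : Y ⟶ Z` is a quotient of the projective
`L`-scheme `Y` by the finite group `Δ ≤ Aut_L(Y)` (for separated test objects, `Z` separated), then `p ⊗_{L,τ} ℂ` is a
quotient of `Y ⊗ ℂ` by `Δ` and `Z ⊗ ℂ` is separated.  Printed content: affine-locally `(A^Δ) ⊗_L ℂ = (A ⊗_L ℂ)^Δ` because
`ℂ` is flat over `L` and `Δ` is finite (invariants = a kernel; [MumfordAV1970] §7 proof of the Thm. p. 66, [SGA1] V 1.9
«formation du quotient commute au changement de base plat»); then `Z ≅ Y/Δ` (uniqueness of separated quotients, tree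
`finiteQuotient.desc_unique`) and `(Y/Δ)_ℂ ≅ Y_ℂ/Δ`.  Mathlib HAS flat base change of kernels (`Module.Flat`,
`lTensor` exactness); LACKS the scheme-level statement.  Size M–L.  Why it might fail as typed: it would need `Δ` finite and
the base field extension flat — both hold (`Fintype Δ`, fields). [cite: SGA1, Exp. V Prop. 1.9] [cite: MumfordAV1970, §7] -/
def StubQuotientBaseChange : Prop :=
  ∀ (L : Type) [Field L] (τ : L →+* ℂ) (Δ : Type) [Group Δ] [Fintype Δ] (Y Z : SchemeOver L),
    IsProjectiveOver Y → ∀ (act : Δ →* Aut Y) (p : Y ⟶ Z), IsSeparated Z.hom →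
      IsSepQuotient (fun g => act g) p →
        IsSeparated ((Motives.baseChangeHom τ).obj Z).hom ∧
          IsSepQuotient (fun g => (Motives.baseChangeHom τ).mapIso (act g)) ((Motives.baseChangeHom τ).map p)

/-- **stub (torsor quotient: the quotient of `∐_Δ S` by the translation action is `S`)**: if `Y` is the coproduct of
copies of `S` indexed by `Δ` (cofan `ι`), automorphisms `act g` of `Y` permute the copies by LEFT translation
(`ι δ ≫ act g = ι (g δ)`), and `p : Y ⟶ Z` is a quotient by them for separated test objects (`S`, `Z` separated), then
every copy maps ISOMORPHICALLY onto the quotient: `ι δ ≫ p` is an isomorphism (inverse: the factorisation of the fold map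
`∇ : ∐_Δ S ⟶ S` through `p`; `∇ ≫ ι δ ≫ p = p` by testing on the copies and invariance).  Pure category theory over the
cofan API (tree precedent: `Motives/FiniteCoproductVarieties.lean`).  Size S–M.  Why it might fail as typed: if the copies
were not permuted TRANSITIVELY — they are, every `ι δ₁ = ι δ ≫ act (δ₁ δ⁻¹)`. [folklore] [cite: SGA1, Exp. V §1] -/
def StubTorsorQuotient : Prop :=
  ∀ (Δ : Type) [Group Δ] (S Y Z : SchemeOver ℂ) (act : Δ → (Y ≅ Y)) (ι : Δ → (S ⟶ Y)),
    Nonempty (IsColimit (Cofan.mk Y ι)) → (∀ g δ : Δ, ι δ ≫ (act g).hom = ι (g * δ)) →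
    ∀ p : Y ⟶ Z, IsSeparated Z.hom → IsSeparated S.hom → IsSepQuotient act p → ∀ δ : Δ, IsIso (ι δ ≫ p)

/-- Registered stub: `StubQuotientFunctor`. [cite: MumfordAV1970, §7 Thm. p. 66] -/
theorem stub_quotientFunctor : StubQuotientFunctor :=
  -- CLOSED (B-p05, p592880 ACCEPTED 2026-08-28T01:17Z): statement text unchanged; proof = the tree theorem.
  Literature.AlgebraicGeometry.Motives.exists_finiteQuotient_functor

/-- Registered stub: `StubQuotientBaseChange`. [cite: SGA1, Exp. V Prop. 1.9] -/
theorem stub_quotientBaseChange : StubQuotientBaseChange :=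
  -- CLOSED (B-p06, p592797 ACCEPTED 2026-08-28T01:16Z): statement text unchanged; proof = the tree theorem.
  Literature.AlgebraicGeometry.Motives.isSepQuotient_baseChangeHom_of_isProjectiveOver

/-- Registered stub: `StubTorsorQuotient`. [folklore] -/
theorem stub_torsorQuotient : StubTorsorQuotient :=
  -- CLOSED (B-p05, p591996 ACCEPTED 2026-08-28T01:05Z): the registered stub statement is unchanged; its proof is
  -- the tree theorem with exactly these binders.
  Literature.AlgebraicGeometry.Motives.isIso_cofanInj_comp_of_isSepQuotient

/-! ### §2. The generic target: a separated finite-group quotient descends «reciprocity up to `Δ`» -/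

/-- **Quotient reciprocity descent (generic form of [Deligne1971TravauxShimura] (5.11.1))**: base field `E` with
an `E`-algebra structure on `ℂ` (`algebraMap E ℂ`; `= ιE` under `letI := ιE.toAlgebra`); a tower `Mc : J ⥤ (ℂ-schemes)` of separated complex varieties; a tower `N : J ⥤ (E-schemes)` of
PROJECTIVE `E`-schemes with a finite group `Δ` acting by `E`-automorphisms naturally in `j`; cofans
`ι_j : Δ → (Mc_j ⟶ N_j ⊗_E ℂ)` exhibiting `N_j ⊗ ℂ` as `∐_Δ Mc_j`, natural in `j`, the action permuting the
copies by left translation; and ANY family of test relations `R_j σ u u'` («`σ` ought to send the point over `u` to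
the point over `u'`», `σ ∈ Aut(ℂ/E)`, `u, u' ∈ Mc_j(ℂ)`).  IF `N` satisfies every test UP TO `Δ` — `σ` sends the
point of `N_j` over `(u, δ)` to the point over `(u', δ')` for SOME `δ'` (points of `N_j ⊗ ℂ` read as `E`-algebra
points of `N_j` through `formPointsEquiv`, on which `Aut(ℂ/E)` acts) — THEN `Mc` has an `E`-form
`(M, e : M ⊗ ℂ ≅ Mc)` satisfying every test on the nose.  (`M_j := N_j/Δ`.)  This is the mathematical content of
the line; the two statements in the `HypDel` vocabulary below are instances. [cite: Deligne1971TravauxShimura,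
Prop. 5.11, (5.11.1), Cor. 5.7] [cite: MumfordAV1970, §7] -/
def QuotientReciprocityDescent : Prop :=
  ∀ (E : Type) [Field E] [Algebra E ℂ] (J : Type) [SmallCategory J] (Mc : J ⥤ SchemeOver ℂ),
    (∀ j : J, IsSeparated (Mc.obj j).hom) →
    ∀ (Δ : Type) [Group Δ] [Fintype Δ] (N : J ⥤ SchemeOver E), (∀ j : J, IsProjectiveOver (N.obj j)) →
    ∀ ρ : ∀ j : J, Δ →* Aut (N.obj j),
      (∀ (j j' : J) (f : j ⟶ j') (g : Δ), (ρ j g).hom ≫ N.map f = N.map f ≫ (ρ j' g).hom) →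
    ∀ ι : ∀ j : J, Δ → (Mc.obj j ⟶ (Motives.baseChangeHom (algebraMap E ℂ)).obj (N.obj j)),
      (∀ j : J, Nonempty (IsColimit (Cofan.mk ((Motives.baseChangeHom (algebraMap E ℂ)).obj (N.obj j)) (ι j)))) →
      (∀ (j j' : J) (f : j ⟶ j') (δ : Δ), ι j δ ≫ (Motives.baseChangeHom (algebraMap E ℂ)).map (N.map f) = Mc.map f ≫ ι j' δ) →
      (∀ (j : J) (g δ : Δ), ι j δ ≫ (Motives.baseChangeHom (algebraMap E ℂ)).map (ρ j g).hom = ι j (g * δ)) →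
      ∀ R : ∀ j : J, (ℂ ≃ₐ[E] ℂ) → ComplexPoints (Mc.obj j) → ComplexPoints (Mc.obj j) → Prop,
        (∀ (j : J) (σ : ℂ ≃ₐ[E] ℂ) (u u' : ComplexPoints (Mc.obj j)), R j σ u u' → ∀ δ : Δ, ∃ δ' : Δ,
            σ • (formPointsEquiv (N.obj j)).symm (AlgPoints.map (ι j δ) u) =
              (formPointsEquiv (N.obj j)).symm (AlgPoints.map (ι j δ') u')) →
        ∃ (M : J ⥤ SchemeOver E) (e : (M ⋙ Motives.baseChangeHom (algebraMap E ℂ)) ≅ Mc),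
          ∀ (j : J) (σ : ℂ ≃ₐ[E] ℂ) (u u' : ComplexPoints (Mc.obj j)), R j σ u u' →
            σ • (formPointsEquiv (M.obj j)).symm (AlgPoints.map (e.inv.app j) u) =
              (formPointsEquiv (M.obj j)).symm (AlgPoints.map (e.inv.app j) u')

/-! ### §3. The two instances in the vocabulary of `HypDel` -/

/-- **Finite Hecke quotient descent over a base `E`** ([Deligne1971TravauxShimura] (5.11.1) READ for the product
datum `G̃ = G × T₀` over `E ⊇ E♯`; the shape A-plan1's `stub_reflexCompositumModel` consumes at `E := E♯_Φ`): a
tower `N` of PROJECTIVE `E`-schemes on the small levels with a natural action of a finite group `Δ` (Hecke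
translations by `T₀(𝔸_f)`, `Δ = T₀(ℚ)\T₀(𝔸_f)/L₀`), complex fibres `= ∐_Δ Sc.Mc_K` (cofans natural in `K`,
action = left translation of copies) and reciprocity UP TO `Δ` (`IsCanonicalDescentUpTo`) ⟹ an `E`-form of `Sc.Mc`
with reciprocity (62) (`IsCanonicalDescentOver`). [cite: Deligne1971TravauxShimura, Prop. 5.11, (5.11.1), Cor. 5.7]
[cite: Deligne1979ShimuraVarieties, 2.2.5] -/
def HeckeQuotientDescentOver : Prop :=
  ∀ (L : Type) [Field L] [NumberField L] [IsCMField L] (H : Matrix (Fin 3) (Fin 3) L) (τ : L →+* ℂ)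
    (T : GL (Fin 3) ℂ) (hT : formCongr (starRingEnd ℂ) T (H.map τ) = BallModel.J)
    (K₀ : C5.OpenCompactSubgroup ↥(finAdelic (↥(maximalRealSubfield L)) L (IsCMField.complexConj L) 3 H))
    (Sc : ComplexRecordSystem L H τ T hT K₀) (E : Type) [Field E] (ιE : E →+* ℂ)
    (Δ : Type) [Group Δ] [Fintype Δ] (N : C5.SmallLevel K₀ ⥤ SchemeOver E),
    (∀ K, IsProjectiveOver (N.obj K)) →
    ∀ ρ : ∀ K : C5.SmallLevel K₀, Δ →* Aut (N.obj K),
      (∀ (K K' : C5.SmallLevel K₀) (f : K ⟶ K') (g : Δ), (ρ K g).hom ≫ N.map f = N.map f ≫ (ρ K' g).hom) →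
    ∀ ι : ∀ K : C5.SmallLevel K₀, Δ → (Sc.Mc.obj K ⟶ (Motives.baseChangeHom ιE).obj (N.obj K)),
      (∀ K, Nonempty (IsColimit (Cofan.mk ((Motives.baseChangeHom ιE).obj (N.obj K)) (ι K)))) →
      (∀ (K K' : C5.SmallLevel K₀) (f : K ⟶ K') (δ : Δ),
          ι K δ ≫ (Motives.baseChangeHom ιE).map (N.map f) = Sc.Mc.map f ≫ ι K' δ) →
      (∀ (K : C5.SmallLevel K₀) (g δ : Δ), ι K δ ≫ (Motives.baseChangeHom ιE).map (ρ K g).hom = ι K (g * δ)) →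
      IsCanonicalDescentUpTo Sc ιE Δ N ι →
      ∃ (M : C5.SmallLevel K₀ ⥤ SchemeOver E) (e : (M ⋙ Motives.baseChangeHom ιE) ≅ Sc.Mc),
        IsCanonicalDescentOver Sc ιE M e

/-- **Finite Hecke quotient descent at the reflex field** (`E = L`, `ιE = τ`): the same, concluding
`∃ M e, IsCanonicalDescentAt Sc M e` — the conclusion of `canonicalModel_exists_form` at `Sc` (and of
`canonicalModel_exists_printed` by `canonicalModel_exists_printed_iff_form`).  This is the junction for the GALOIS
leg of `HypDel` (ruling D-I2: `StubGaloisCase`), where `E♯ = τ(L)`. [cite: Deligne1971TravauxShimura, (5.11.1)]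
[cite: Liu2021, Rem. C.15] -/
def HeckeQuotientDescent : Prop :=
  ∀ (L : Type) [Field L] [NumberField L] [IsCMField L] (H : Matrix (Fin 3) (Fin 3) L) (τ : L →+* ℂ)
    (T : GL (Fin 3) ℂ) (hT : formCongr (starRingEnd ℂ) T (H.map τ) = BallModel.J)
    (K₀ : C5.OpenCompactSubgroup ↥(finAdelic (↥(maximalRealSubfield L)) L (IsCMField.complexConj L) 3 H))
    (Sc : ComplexRecordSystem L H τ T hT K₀)
    (Δ : Type) [Group Δ] [Fintype Δ] (N : C5.SmallLevel K₀ ⥤ SchemeOver L),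
    (∀ K, IsProjectiveOver (N.obj K)) →
    ∀ ρ : ∀ K : C5.SmallLevel K₀, Δ →* Aut (N.obj K),
      (∀ (K K' : C5.SmallLevel K₀) (f : K ⟶ K') (g : Δ), (ρ K g).hom ≫ N.map f = N.map f ≫ (ρ K' g).hom) →
    ∀ ι : ∀ K : C5.SmallLevel K₀, Δ → (Sc.Mc.obj K ⟶ (Motives.baseChangeHom τ).obj (N.obj K)),
      (∀ K, Nonempty (IsColimit (Cofan.mk ((Motives.baseChangeHom τ).obj (N.obj K)) (ι K)))) →
      (∀ (K K' : C5.SmallLevel K₀) (f : K ⟶ K') (δ : Δ),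
          ι K δ ≫ (Motives.baseChangeHom τ).map (N.map f) = Sc.Mc.map f ≫ ι K' δ) →
      (∀ (K : C5.SmallLevel K₀) (g δ : Δ), ι K δ ≫ (Motives.baseChangeHom τ).map (ρ K g).hom = ι K (g * δ)) →
      IsCanonicalDescentUpTo Sc τ Δ N ι →
      ∃ (M : C5.SmallLevel K₀ ⥤ SchemeOver L) (e : (M ⋙ Motives.baseChangeHom τ) ≅ Sc.Mc),
        IsCanonicalDescentAt Sc M e

/-! ### §4. Glue lemmas (proved) -/

/-- Naturality of `X_E(ℂ) → X(ℂ)` (`formPointsEquiv`, inverse direction) in the `E`-scheme `X`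
(the tree's private `UnitaryShimuraRecordDescent.baseChangeEquiv_symm_map'`, re-proved). [folklore] -/
theorem formPointsEquiv_symm_map {E : Type} [Field E] [Algebra E ℂ] {X Y : SchemeOver E} (f : X ⟶ Y)
    (u : ComplexPoints ((Motives.baseChangeHom (algebraMap E ℂ)).obj X)) :
    (formPointsEquiv Y).symm (AlgPoints.map ((Motives.baseChangeHom (algebraMap E ℂ)).map f) u) =
      AlgPoints.map f ((formPointsEquiv X).symm u) := by
  apply Over.OverMorphism.ext
  dsimp only [formPointsEquiv]
  rw [AlgPoints.baseChangeEquiv_symm_apply_left, AlgPoints.map_apply, Over.comp_left,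
    AlgPoints.map_apply, Over.comp_left, AlgPoints.baseChangeEquiv_symm_apply_left]
  simp only [Category.assoc, Motives.baseChangeHom_map_left_comp_fst]
  exact (Category.assoc _ _ _).symm

/-- Bookkeeping: an endomorphism `a` intertwined with `b` through a natural isomorphism `e` is intertwined through
`e⁻¹` the other way. [folklore] -/
theorem inv_app_comp_eq {J C : Type*} [Category J] [Category C] {F G : J ⥤ C} (e : F ≅ G) (j : J)
    {a : F.obj j ⟶ F.obj j} {b : G.obj j ⟶ G.obj j} (h : a ≫ e.hom.app j = e.hom.app j ≫ b) :
    e.inv.app j ≫ a = b ≫ e.inv.app j := by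
  rw [← cancel_mono (e.hom.app j), Category.assoc, h, e.inv_hom_id_app_assoc, Category.assoc, e.inv_hom_id_app,
    Category.comp_id]

/-- Bookkeeping: a natural family `κ_j : S_j ⟶ G_j` composed with `e⁻¹ : G ≅ F` is natural. [folklore] -/
theorem comp_inv_app_natural {J C : Type*} [Category J] [Category C] {S F G : J ⥤ C} (e : F ≅ G)
    (κ : ∀ j, S.obj j ⟶ G.obj j) (hκ : ∀ {j j' : J} (f : j ⟶ j'), κ j ≫ G.map f = S.map f ≫ κ j')
    {j j' : J} (f : j ⟶ j') : (κ j ≫ e.inv.app j) ≫ F.map f = S.map f ≫ κ j' ≫ e.inv.app j' := by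
  rw [Category.assoc, ← e.inv.naturality f, reassoc_of% (hκ f)]

/-- Bookkeeping: with `e`, `a`, `b` as in `inv_app_comp_eq`, a pair `κ₁ ≫ b = κ₂` gives
`(κ₁ ≫ e⁻¹) ≫ a = κ₂ ≫ e⁻¹`. [folklore] -/
theorem comp_inv_app_comp_eq {J C : Type*} [Category J] [Category C] {F G : J ⥤ C} (e : F ≅ G) (j : J) {X : C}
    {κ₁ κ₂ : X ⟶ G.obj j} {a : F.obj j ⟶ F.obj j} {b : G.obj j ⟶ G.obj j}
    (h : a ≫ e.hom.app j = e.hom.app j ≫ b) (hκ : κ₁ ≫ b = κ₂) :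
    (κ₁ ≫ e.inv.app j) ≫ a = κ₂ ≫ e.inv.app j := by
  rw [Category.assoc, inv_app_comp_eq e j h, ← Category.assoc, hκ]

/-! ### §5. Compositions (kernel-checked) -/

/-- **Generic (5.11.1) assembled**: functorial quotient over `E` + base change of quotients + torsor quotient ⟹
`QuotientReciprocityDescent`.  The form is `M := N/Δ`, `e_j⁻¹ := ι_j 1 ≫ (q_j ⊗ ℂ)` (an isomorphism by the torsor
stub), natural in `j` by the naturality of `ι` and `q`; a test `R_j σ u u'` holds for `(M, e)` because it is the
image under `q_j` of the assumed test-up-to-`Δ` for `N_j`, the copy index being forgotten as `ρ_j(δ) ≫ q_j = q_j`.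
[cite: Deligne1971TravauxShimura, (5.11.1) p. 159] -/
theorem quotientReciprocityDescent_of (hQ : StubQuotientFunctor) (hB : StubQuotientBaseChange)
    (hT : StubTorsorQuotient) : QuotientReciprocityDescent := by
  intro E _ _ J _ Mc hMc Δ _ _ N hN ρ hρ ι hι hιnat hιρ R hrec
  obtain ⟨M, q, hsep, hquot⟩ := hQ E J Δ N hN ρ hρ
  -- the quotient base-changed to `ℂ`
  have hC : ∀ j : J,
      IsSeparated ((Motives.baseChangeHom (algebraMap E ℂ)).obj (M.obj j)).hom ∧
        IsSepQuotient (fun g => (Motives.baseChangeHom (algebraMap E ℂ)).mapIso (ρ j g)) ((Motives.baseChangeHom (algebraMap E ℂ)).map (q.app j)) :=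
    fun j => hB E (algebraMap E ℂ) Δ (N.obj j) (M.obj j) (hquot j).1 (ρ j) (q.app j) (hsep j) (hquot j).2
  -- invariance of `q_j` under `Δ`
  have hinv : ∀ (j : J) (g : Δ), (ρ j g).hom ≫ q.app j = q.app j := fun j g => (hquot j).2.1 g
  -- every copy maps isomorphically onto `M_j ⊗ ℂ`
  have hiso : ∀ (j : J) (δ : Δ), IsIso (ι j δ ≫ (Motives.baseChangeHom (algebraMap E ℂ)).map (q.app j)) := by
    intro j δ
    refine hT Δ (Mc.obj j) ((Motives.baseChangeHom (algebraMap E ℂ)).obj (N.obj j)) ((Motives.baseChangeHom (algebraMap E ℂ)).obj (M.obj j))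
      (fun g => (Motives.baseChangeHom (algebraMap E ℂ)).mapIso (ρ j g)) (ι j) (hι j) (fun g δ' => ?_)
      ((Motives.baseChangeHom (algebraMap E ℂ)).map (q.app j)) (hC j).1 (hMc j) (hC j).2 δ
    simpa only [Functor.mapIso_hom] using hιρ j g δ'
  -- the form `e : M ⊗ ℂ ≅ Mc`, `e_j⁻¹ = ι_j 1 ≫ (q_j ⊗ ℂ)`
  let eK : ∀ j : J, Mc.obj j ≅ (M ⋙ Motives.baseChangeHom (algebraMap E ℂ)).obj j := fun j =>
    @asIso _ _ _ _ (ι j 1 ≫ (Motives.baseChangeHom (algebraMap E ℂ)).map (q.app j)) (hiso j 1)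
  let e' : Mc ≅ M ⋙ Motives.baseChangeHom (algebraMap E ℂ) := NatIso.ofComponents eK (fun {j j'} f => by
    show Mc.map f ≫ (ι j' 1 ≫ (Motives.baseChangeHom (algebraMap E ℂ)).map (q.app j')) =
      (ι j 1 ≫ (Motives.baseChangeHom (algebraMap E ℂ)).map (q.app j)) ≫ (Motives.baseChangeHom (algebraMap E ℂ)).map (M.map f)
    rw [Category.assoc, ← Functor.map_comp, ← q.naturality f, Functor.map_comp, ← Category.assoc (ι j 1),
      hιnat j j' f 1, Category.assoc])
  refine ⟨M, e'.symm, ?_⟩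
  -- reading a point of `M_j` through `e` = image under `q_j` of the point of `N_j` in ANY copy
  have key : ∀ (j : J) (u : ComplexPoints (Mc.obj j)) (δ : Δ),
      (formPointsEquiv (M.obj j)).symm (AlgPoints.map (e'.symm.inv.app j) u) =
        AlgPoints.map (q.app j) ((formPointsEquiv (N.obj j)).symm (AlgPoints.map (ι j δ) u)) := by
    intro j u δ
    have h1 : e'.symm.inv.app j = ι j 1 ≫ (Motives.baseChangeHom (algebraMap E ℂ)).map (q.app j) := rfl
    have h2 : ι j δ = ι j 1 ≫ (Motives.baseChangeHom (algebraMap E ℂ)).map (ρ j δ).hom := by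
      rw [hιρ j δ 1, mul_one]
    calc (formPointsEquiv (M.obj j)).symm (AlgPoints.map (e'.symm.inv.app j) u)
        = (formPointsEquiv (M.obj j)).symm
            (AlgPoints.map ((Motives.baseChangeHom (algebraMap E ℂ)).map (q.app j)) (AlgPoints.map (ι j 1) u)) := by
          rw [h1, AlgPoints.map_comp_apply]
      _ = AlgPoints.map (q.app j) ((formPointsEquiv (N.obj j)).symm (AlgPoints.map (ι j 1) u)) :=
          formPointsEquiv_symm_map (q.app j) _
      _ = AlgPoints.map (q.app j) (AlgPoints.map (ρ j δ).hom
            ((formPointsEquiv (N.obj j)).symm (AlgPoints.map (ι j 1) u))) := by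
          rw [← AlgPoints.map_comp_apply (ρ j δ).hom (q.app j), hinv j δ]
      _ = AlgPoints.map (q.app j) ((formPointsEquiv (N.obj j)).symm
            (AlgPoints.map ((Motives.baseChangeHom (algebraMap E ℂ)).map (ρ j δ).hom) (AlgPoints.map (ι j 1) u))) := by
          rw [formPointsEquiv_symm_map]
      _ = AlgPoints.map (q.app j) ((formPointsEquiv (N.obj j)).symm (AlgPoints.map (ι j δ) u)) := by
          rw [← AlgPoints.map_comp_apply (ι j 1), ← h2]
  -- every test holds for `(M, e)`
  intro j σ u u' hR
  obtain ⟨δ', h⟩ := hrec j σ u u' hR 1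
  rw [key j u 1, key j u' δ', ← AlgPoints.map_smul, h]

set_option maxHeartbeats 800000 in -- large adelic / Shimura-set binders
/-- **(5.11.1) over a base `E`** from the generic statement: the tests are the diagonal special pairs
`(σ; [x, aK] ↦ [x, r_x(s)·aK])`; `Sc.Mc_K` is separated because projective. [cite: Deligne1971TravauxShimura, (5.11.1)] -/
theorem heckeQuotientDescentOver_of_generic (h : QuotientReciprocityDescent) : HeckeQuotientDescentOver := by
  intro L _ _ _ H τ T hT K₀ Sc E _ ιE Δ _ _ N hN ρ hρ ι hι hιnat hιρ hrec
  letI : Algebra E ℂ := ιE.toAlgebra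
  have hMc : ∀ K : C5.SmallLevel K₀, IsSeparated (Sc.Mc.obj K).hom := fun K => by
    haveI : IsProper (Sc.Mc.obj K).hom := Motives.IsProjectiveOver.isProper (Sc.projective K)
    infer_instance
  -- the test relations: diagonal special pairs
  let R : ∀ K : C5.SmallLevel K₀, (ℂ ≃ₐ[E] ℂ) → ComplexPoints (Sc.Mc.obj K) → ComplexPoints (Sc.Mc.obj K) → Prop :=
    fun K σ u u' => ∃ (s : (FiniteAdeleRing (𝓞 L) L)ˣ) (v₃ : Fin 3 → L) (x : Ball)
      (d a : finAdelic (↥(maximalRealSubfield L)) L (IsCMField.complexConj L) 3 H),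
      IsArtinCorrespondent L τ s σ.toRingEquiv ∧ IsLinePoint L τ T v₃ x ∧ IsDiagTwist L H v₃ (recipFactor L s) d ∧
        u = (Sc.pts K).symm (ShimuraSet.mk L H τ T hT K.1.1 x a) ∧
        u' = (Sc.pts K).symm (ShimuraSet.mk L H τ T hT K.1.1 x (d * a))
  have hrecR : ∀ (K : C5.SmallLevel K₀) (σ : ℂ ≃ₐ[E] ℂ) (u u' : ComplexPoints (Sc.Mc.obj K)), R K σ u u' →
      ∀ δ : Δ, ∃ δ' : Δ,
        σ • (formPointsEquiv (N.obj K)).symm (AlgPoints.map (ι K δ) u) =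
          (formPointsEquiv (N.obj K)).symm (AlgPoints.map (ι K δ') u') := by
    rintro K σ u u' ⟨s, v₃, x, d, a, hs, hx, hd, rfl, rfl⟩ δ
    exact hrec K σ s hs v₃ x hx d hd a δ
  obtain ⟨M, e, hM⟩ := h E (C5.SmallLevel K₀) Sc.Mc hMc Δ N hN ρ hρ ι hι hιnat hιρ R hrecR
  refine ⟨M, e, ?_⟩
  intro K σ s hs v₃ x hx d hd a
  exact hM K σ _ _ ⟨s, v₃, x, d, a, hs, hx, hd, rfl, rfl⟩

/-- **(5.11.1) at the reflex field** (`E = L`, `ιE = τ`) from the base-`E` statement, through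
`isCanonicalDescentOver_iff`. [cite: Deligne1971TravauxShimura, (5.11.1)] -/
theorem heckeQuotientDescent_of_over (h : HeckeQuotientDescentOver) : HeckeQuotientDescent := by
  intro L _ _ _ H τ T hT K₀ Sc Δ _ _ N hN ρ hρ ι hι hιnat hιρ hrec
  obtain ⟨M, e, hM⟩ := h L H τ T hT K₀ Sc L τ Δ N hN ρ hρ ι hι hιnat hιρ hrec
  exact ⟨M, e, (isCanonicalDescentOver_iff Sc M e).mp hM⟩

/-- **The line's composition**: the three registered stubs ⟹ `HeckeQuotientDescentOver` (base `E`, consumed by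
A-plan1's stub (A) at `E := E♯_Φ`). [cite: Deligne1971TravauxShimura, (5.11.1)] -/
theorem heckeQuotientDescentOver_of (hQ : StubQuotientFunctor) (hB : StubQuotientBaseChange)
    (hT : StubTorsorQuotient) : HeckeQuotientDescentOver :=
  heckeQuotientDescentOver_of_generic (quotientReciprocityDescent_of hQ hB hT)

/-- **The line's composition at the reflex field**: the three registered stubs ⟹ `HeckeQuotientDescent`
(`∃ M e, IsCanonicalDescentAt Sc M e`, the Galois leg of `HypDel`). [cite: Deligne1971TravauxShimura, (5.11.1)] -/
theorem heckeQuotientDescent_of (hQ : StubQuotientFunctor) (hB : StubQuotientBaseChange)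
    (hT : StubTorsorQuotient) : HeckeQuotientDescent :=
  heckeQuotientDescent_of_over (heckeQuotientDescentOver_of hQ hB hT)

/-! ### §6. Instance on B-typ03's auxiliary carriers (p590143 `UnitaryAuxiliaryTorusDatum`): F1 ⟹ a `Δ`-free
`E♯`-form — junction J2 of the bus memo 2026-08-28T00:45Z -/

/-- **F1 ⟹ `Δ`-free `E♯`-form (junction J2)**, the statement.  Hypotheses: the class group `T₀(ℚ)\T₀(𝔸_f)/L₀`
finite (ref2 glue g5, owner typ03/A-side), the reflex norm of every `E♯`-idèle in `T₀(𝔸_f)` (ref2 glue g4,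
[Shimura1998] (19.7b)), and the CONCLUSION OF F1 AS LANDED (`Aux.canonicalModel_exists_printed`, p591128, J1 shape)
VERBATIM: an `E♯`-form `(N, e)` of B-typ03's `Aux.complexSystem Sc L₀ = ∐_{T₀(ℚ)\T₀(𝔸_f)/L₀} Sc.Mc` with the torus
Hecke translations descended to `E♯` (`ρ`, natural in `K`, intertwined with `Aux.translMor` through `e`) and the
reciprocity `Aux.IsCanonicalDescentAt Φ L₀ Sc N e`.  Conclusion: the finite Hecke quotient `N/Δ` is an `E♯`-form of
`Sc.Mc` with reciprocity (62) in the same conventions (`IsCanonicalDescentOverReflex`).  Projectivity of `N_K` is NOT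
assumed: it is derived (`∐ Sc.Mc_K` projective, tree `isProjectiveOver_of_isColimit_cofan`; descent along `E♯ → ℂ`,
tree `IsProjectiveOver.of_baseChange_holds` = [GortzWedhorn2020] Prop. 14.57, PROVED).  A statement (`def … : Prop`);
PROVED below from the generic `QuotientReciprocityDescent`, hence from the three stubs; the A-side applies it to
`hF1 L H τ T hT hpos han K₀ hneat Sc Φ hΦ L₀`.
[cite: Deligne1971TravauxShimura, (5.11.1)] [cite: Deligne1979ShimuraVarieties, 2.2.5, 2.3.1] -/
def AuxQuotientDescent : Prop :=
  ∀ (L : Type) [Field L] [NumberField L] [IsCMField L] (H : Matrix (Fin 3) (Fin 3) L) (τ : L →+* ℂ)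
    (T : GL (Fin 3) ℂ) (hT : formCongr (starRingEnd ℂ) T (H.map τ) = BallModel.J)
    (K₀ : C5.OpenCompactSubgroup ↥(finAdelic (↥(maximalRealSubfield L)) L (IsCMField.complexConj L) 3 H))
    (Sc : ComplexRecordSystem L H τ T hT K₀) (Φ : CMType L)
    (L₀ : C5.OpenCompactSubgroup ↥(Aux.torusFinAdelic L)) [Finite (Aux.classGroup L L₀)],
    (haveI : NumberField ↥(Aux.reflexField L Φ τ) := Aux.numberField_reflexField L Φ τ
     ∀ s : (FiniteAdeleRing (𝓞 ↥(Aux.reflexField L Φ τ)) ↥(Aux.reflexField L Φ τ))ˣ,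
       reflexNormFiniteIdele L Φ (Aux.reflexField L Φ τ) s ∈ Aux.torusFinAdelic L) →
    (∃ (N : C5.SmallLevel K₀ ⥤ SchemeOver ↥(Aux.reflexField L Φ τ))
        (ρ : ∀ K : C5.SmallLevel K₀, Aux.classGroup L L₀ →* Aut (N.obj K))
        (e : (N ⋙ Motives.baseChange ↥(Aux.reflexField L Φ τ) ℂ) ≅ Aux.complexSystem Sc L₀),
        (∀ (K K' : C5.SmallLevel K₀) (f : K ⟶ K') (c : Aux.classGroup L L₀),
            (ρ K c).hom ≫ N.map f = N.map f ≫ (ρ K' c).hom) ∧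
        (∀ (K : C5.SmallLevel K₀) (c : Aux.classGroup L L₀),
            (Motives.baseChange ↥(Aux.reflexField L Φ τ) ℂ).map (ρ K c).hom ≫ e.hom.app K =
              e.hom.app K ≫ Aux.translMor Sc L₀ K c) ∧
        Aux.IsCanonicalDescentAt Φ L₀ Sc N e) →
    ∃ (M : C5.SmallLevel K₀ ⥤ SchemeOver ↥(Aux.reflexField L Φ τ))
      (e' : (M ⋙ Motives.baseChange ↥(Aux.reflexField L Φ τ) ℂ) ≅ Sc.Mc), IsCanonicalDescentOverReflex Φ Sc M e'

set_option maxHeartbeats 1600000 in -- large adelic / Shimura-set binders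
/-- **F1 ⟹ `Δ`-free `E♯`-form (junction J2)** from the generic `QuotientReciprocityDescent`, with the test
relations `R_K σ u u' :=` «`u = [x,aK]`, `u' = [x, r_x(N s)·aK]` for an Artin pair `(σ, s)` over `E♯`», the cofans
`ι_K p := (p-th coprojection) ≫ e_K⁻¹` and `δ' := [N_{E♯,Φ}(s)]·p`. [cite: Deligne1971TravauxShimura, (5.11.1)] -/
theorem auxQuotientDescent_of_generic (h : QuotientReciprocityDescent) : AuxQuotientDescent := by
  rintro L _ _ _ H τ T hT K₀ Sc Φ L₀ _ hg4 ⟨N, ρ, e, hρ, hρe, hF1⟩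
  haveI : NumberField ↥(Aux.reflexField L Φ τ) := Aux.numberField_reflexField L Φ τ
  letI : Algebra L ↥(Aux.reflexField L Φ τ) := (Aux.toReflexField L Φ τ).toAlgebra
  letI : Fintype (Aux.classGroup L L₀) := Fintype.ofFinite _
  -- projectivity of the `E♯`-models `N_K` (ref2 glue g7): `∐ Sc.Mc_K` is projective, transported along `e_K`, descended
  have hN : ∀ K : C5.SmallLevel K₀, IsProjectiveOver (N.obj K) := fun K => by
    have hcop : IsProjectiveOver ((Aux.complexSystem Sc L₀).obj K) :=
      Motives.isProjectiveOver_of_isColimit_cofan (coproductIsCoproduct fun _ : Aux.classGroup L L₀ => Sc.Mc.obj K)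
        fun _ => Sc.projective K
    have hbc : IsProjectiveOver ((N ⋙ Motives.baseChange ↥(Aux.reflexField L Φ τ) ℂ).obj K) := by
      obtain ⟨n, κ', hκ'⟩ := hcop
      haveI := hκ'
      haveI : IsIso (e.app K).hom.left := (inferInstance : IsIso ((Over.forget _).mapIso (e.app K)).hom)
      exact ⟨n, (e.app K).hom ≫ κ', inferInstanceAs (IsClosedImmersion ((e.app K).hom.left ≫ κ'.left))⟩
    exact Motives.IsProjectiveOver.of_baseChange_holds (N.obj K) ℂ hbc
  have hMc : ∀ K : C5.SmallLevel K₀, IsSeparated (Sc.Mc.obj K).hom := fun K => by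
    haveI : IsProper (Sc.Mc.obj K).hom := Motives.IsProjectiveOver.isProper (Sc.projective K)
    infer_instance
  -- the coprojections, as morphisms into `(Aux.complexSystem Sc L₀).obj K`
  let κ : ∀ K : C5.SmallLevel K₀, Aux.classGroup L L₀ → (Sc.Mc.obj K ⟶ (Aux.complexSystem Sc L₀).obj K) :=
    fun K p => Limits.Sigma.ι (fun _ : Aux.classGroup L L₀ => Sc.Mc.obj K) p
  have hκnat : ∀ (p : Aux.classGroup L L₀) {K K' : C5.SmallLevel K₀} (f : K ⟶ K'),
      κ K p ≫ (Aux.complexSystem Sc L₀).map f = Sc.Mc.map f ≫ κ K' p :=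
    fun p K K' f => Limits.Sigma.ι_map (fun _ : Aux.classGroup L L₀ => Sc.Mc.map f) p
  have hκρ : ∀ (K : C5.SmallLevel K₀) (c p : Aux.classGroup L L₀), κ K p ≫ Aux.translMor Sc L₀ K c = κ K (c * p) :=
    fun K c p => Limits.Sigma.ι_desc _ _
  -- the cofans `ι_K p := κ_K p ≫ e⁻¹_K`
  let ι : ∀ K : C5.SmallLevel K₀, Aux.classGroup L L₀ →
      (Sc.Mc.obj K ⟶ (N ⋙ Motives.baseChange ↥(Aux.reflexField L Φ τ) ℂ).obj K) :=
    fun K p => κ K p ≫ e.inv.app K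
  have hιdef : ∀ (K : C5.SmallLevel K₀) (p : Aux.classGroup L L₀), ι K p = κ K p ≫ e.inv.app K := fun K p => rfl
  have hκdef : ∀ (K : C5.SmallLevel K₀) (p : Aux.classGroup L L₀),
      κ K p = Limits.Sigma.ι (fun _ : Aux.classGroup L L₀ => Sc.Mc.obj K) p := fun K p => rfl
  have hι : ∀ K : C5.SmallLevel K₀,
      Nonempty (IsColimit (Cofan.mk ((N ⋙ Motives.baseChange ↥(Aux.reflexField L Φ τ) ℂ).obj K) (ι K))) :=
    fun K => ⟨IsColimit.ofIsoColimit (coproductIsCoproduct fun _ : Aux.classGroup L L₀ => Sc.Mc.obj K)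
      (Cofan.ext (e.app K).symm (fun p => rfl))⟩
  have hιnat : ∀ (K K' : C5.SmallLevel K₀) (f : K ⟶ K') (p : Aux.classGroup L L₀),
      ι K p ≫ (N ⋙ Motives.baseChange ↥(Aux.reflexField L Φ τ) ℂ).map f = Sc.Mc.map f ≫ ι K' p :=
    fun K K' f p => comp_inv_app_natural (S := Sc.Mc) e (fun K => κ K p) (fun f => hκnat p f) f
  have hιρ : ∀ (K : C5.SmallLevel K₀) (c p : Aux.classGroup L L₀),
      ι K p ≫ (Motives.baseChange ↥(Aux.reflexField L Φ τ) ℂ).map (ρ K c).hom = ι K (c * p) :=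
    fun K c p => comp_inv_app_comp_eq e K (hρe K c) (hκρ K c p)
  -- the test relations: B-typ03's diagonal special pairs over `E♯`
  let R : ∀ K : C5.SmallLevel K₀, (ℂ ≃ₐ[↥(Aux.reflexField L Φ τ)] ℂ) →
      ComplexPoints (Sc.Mc.obj K) → ComplexPoints (Sc.Mc.obj K) → Prop :=
    fun K σ u u' => ∃ (s : (FiniteAdeleRing (𝓞 ↥(Aux.reflexField L Φ τ)) ↥(Aux.reflexField L Φ τ))ˣ)
      (v₃ : Fin 3 → L) (x : Ball) (d a : finAdelic (↥(maximalRealSubfield L)) L (IsCMField.complexConj L) 3 H),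
      UnitaryCanonicalModel.IsArtinCorrespondent ↥(Aux.reflexField L Φ τ) (algebraMap ↥(Aux.reflexField L Φ τ) ℂ) s
          σ.toRingEquiv ∧
        IsLinePoint L τ T v₃ x ∧ IsDiagTwist L H v₃ (recipFactor L (finiteIdeleRelNorm L ↥(Aux.reflexField L Φ τ) s)) d ∧
        u = (Sc.pts K).symm (ShimuraSet.mk L H τ T hT K.1.1 x a) ∧
        u' = (Sc.pts K).symm (ShimuraSet.mk L H τ T hT K.1.1 x (d * a))
  have hrecR : ∀ (K : C5.SmallLevel K₀) (σ : ℂ ≃ₐ[↥(Aux.reflexField L Φ τ)] ℂ) (u u' : ComplexPoints (Sc.Mc.obj K)),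
      R K σ u u' → ∀ p : Aux.classGroup L L₀, ∃ p' : Aux.classGroup L L₀,
        σ • (formPointsEquiv (N.obj K)).symm (AlgPoints.map (ι K p) u) =
          (formPointsEquiv (N.obj K)).symm (AlgPoints.map (ι K p') u') := by
    rintro K σ u u' ⟨s, v₃, x, d, a, hs, hx, hd, rfl, rfl⟩ p
    refine ⟨Aux.classOf L L₀ ⟨_, hg4 s⟩ * p, ?_⟩
    have key := hF1 K σ s hs v₃ x hx d hd ⟨_, hg4 s⟩ rfl a p
    rw [hιdef, hιdef, hκdef, hκdef]
    erw [AlgPoints.map_comp_apply, AlgPoints.map_comp_apply]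
    exact key
  obtain ⟨M, e', hM⟩ := h ↥(Aux.reflexField L Φ τ) (C5.SmallLevel K₀) Sc.Mc hMc (Aux.classGroup L L₀) N hN ρ hρ
    ι hι hιnat hιρ R hrecR
  refine ⟨M, e', ?_⟩
  intro K σ s hs v₃ x hx d hd a
  exact hM K σ _ _ ⟨s, v₃, x, d, a, hs, hx, hd, rfl, rfl⟩

/-- **The line's composition on B-typ03's carriers**: the three registered stubs ⟹ (F1 as landed ⟹ `Δ`-free
`E♯`-form of `Sc.Mc` with reciprocity (62) over `E♯`). [cite: Deligne1971TravauxShimura, (5.11.1)] -/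
theorem auxQuotientDescent_of (hQ : StubQuotientFunctor) (hB : StubQuotientBaseChange) (hT : StubTorsorQuotient) :
    AuxQuotientDescent :=
  auxQuotientDescent_of_generic (quotientReciprocityDescent_of hQ hB hT)


/-! ### §7. Support (ref2 glue g8 = junction lemma T, degree one): `E♯`-idèle reciprocity ⟹ `L`-idèle
reciprocity when `E♯ = τL` (the Galois leg of ruling D-I2) -/

/-- **support stub T (reflex transport, degree one)**: if `E*(Φ) ⊆ τ(L)` (`Aux.HasSmallReflex`, so `τ : L ≅ E♯`),
every finite idèle `s` of `L` that is an Artin correspondent of `σ ∈ Aut(ℂ)` ([Milne2005ShimuraVarieties] (59)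
normalisation, `IsArtinCorrespondent L τ s σ`) is the norm `N_{E♯/τL}` of a finite idèle `s♯` of `E♯` that is an
Artin correspondent of the same `σ` over `E♯ ⊂ ℂ`.  Proof on paper: `s♯ := τ_* s` — transport of structure along
the field isomorphism `τ : L ≅ E♯` of the finite adèle ring, of the norm-residue symbol `θ`
(`isGlobalReciprocitySystem_artinMap`) and of `absGaloisAbProj`; the idèle norm of a degree-one extension is the
inverse transport.  Mathematically routine (S), in Lean M–L: Mathlib HAS `AlgEquiv.ofInjectiveField` /
`RingHom.fieldRange`, the tree HAS finite-adèle base change (`AdelicBaseChange.FiniteAdeleBaseChange`: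
`baseChangeAlgEquiv`, `mapRingHom`), the Artin-correspondent supply `exists_finiteIdele_isArtinCorrespondent`
(UnitaryShimuraCanonicalModelArtin.lean:67) and NORM functoriality of the Artin map
`restrictNormalHom_abRestrict_ideleArtinMap` / `abRestrict_ideleArtinMap_algebraMap`
(NumberFields/IdelicArtinMapNormCompatibility.lean:412/:420, with `ideleArtinMap K a = θ_K (mk a)` by `rfl`,
IdelicArtinMap.lean:174–179); it LACKS «`θ` is natural under isomorphisms of number fields» as a stated lemma —
the prover either proves that transport or goes through norm functoriality in degree one.  NOT the general-degree
statement: for `[E♯ : τL] > 1` the norm is not surjective and the junction needs T⁺ of the line card instead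
(Artin surjectivity over `E♯` + norm functoriality + «`ker art_L` acts trivially on special points»).
[cite: Milne2005ShimuraVarieties, (59) p. 107; Rem. 12.9 p. 115] [cite: CasselsFrohlichANT1967, Ch. VII Prop. 4.3]
[cite: Liu2021, App. C Rem. C.15 (p. 113)] -/
def StubReflexTransport : Prop :=
  ∀ (L : Type) [Field L] [NumberField L] [IsCMField L] (Φ : CMType L) (τ : L →+* ℂ),
    Aux.HasSmallReflex L Φ τ →
    (haveI : NumberField ↥(Aux.reflexField L Φ τ) := Aux.numberField_reflexField L Φ τ
     letI : Algebra L ↥(Aux.reflexField L Φ τ) := (Aux.toReflexField L Φ τ).toAlgebra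
     ∀ (σ : ℂ ≃+* ℂ) (s : (FiniteAdeleRing (𝓞 L) L)ˣ), UnitaryCanonicalModel.IsArtinCorrespondent L τ s σ →
       ∃ s' : (FiniteAdeleRing (𝓞 ↥(Aux.reflexField L Φ τ)) ↥(Aux.reflexField L Φ τ))ˣ,
         finiteIdeleRelNorm L ↥(Aux.reflexField L Φ τ) s' = s ∧
         UnitaryCanonicalModel.IsArtinCorrespondent ↥(Aux.reflexField L Φ τ)
           (algebraMap ↥(Aux.reflexField L Φ τ) ℂ) s' σ)

/-- Registered support stub (g8 / T): `StubReflexTransport`. [cite: Milne2005ShimuraVarieties, (59) p. 107] -/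
theorem stub_reflexTransport : StubReflexTransport :=
  -- CLOSED (B-p07, p593565 ACCEPTED 2026-08-28T01:27Z): statement text unchanged; proof = the tree theorem.
  Aux.exists_finiteIdele_norm_eq_isArtinCorrespondent_of_hasSmallReflex

/-- **T applied**: under `HasSmallReflex`, `E♯`-idèle reciprocity (`IsCanonicalDescentOverReflex`) gives `L`-idèle
reciprocity over `E♯` (`IsCanonicalDescentAtReflex`) for the SAME form. [cite: Milne2005ShimuraVarieties, Rem. 12.9 p. 115] -/
theorem isCanonicalDescentAtReflex_of_overReflex (hR : StubReflexTransport)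
    {L : Type} [Field L] [NumberField L] [IsCMField L] {H : Matrix (Fin 3) (Fin 3) L}
    {τ : L →+* ℂ} {T : GL (Fin 3) ℂ} {hT : formCongr (starRingEnd ℂ) T (H.map τ) = BallModel.J}
    {K₀ : C5.OpenCompactSubgroup ↥(finAdelic (↥(maximalRealSubfield L)) L (IsCMField.complexConj L) 3 H)}
    (Φ : CMType L) (Sc : ComplexRecordSystem L H τ T hT K₀) (hsm : Aux.HasSmallReflex L Φ τ)
    {M : C5.SmallLevel K₀ ⥤ SchemeOver ↥(Aux.reflexField L Φ τ)}
    {e : (M ⋙ Motives.baseChange ↥(Aux.reflexField L Φ τ) ℂ) ≅ Sc.Mc}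
    (h : IsCanonicalDescentOverReflex Φ Sc M e) : IsCanonicalDescentAtReflex Φ Sc M e := by
  intro K σ s hs v₃ x hx d hd a
  haveI : NumberField ↥(Aux.reflexField L Φ τ) := Aux.numberField_reflexField L Φ τ
  letI : Algebra L ↥(Aux.reflexField L Φ τ) := (Aux.toReflexField L Φ τ).toAlgebra
  obtain ⟨s', hN, hs'⟩ := hR L Φ τ hsm σ.toRingEquiv s hs
  have hd' : IsDiagTwist L H v₃ (recipFactor L (finiteIdeleRelNorm L ↥(Aux.reflexField L Φ τ) s')) d := by
    rw [hN]; exact hd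
  exact h K σ s' hs' v₃ x hx d hd' a

/-- **B-side junction for the Galois leg** (ruling D-I2, `StubGaloisCase`), the statement: at every hDel datum with
SMALL reflex field (`E*(Φ) ⊆ τL` — e.g. `L/ℚ` Galois, tree `reflexField_le_normalClosure`), class group finite
(g5), reflex norms in `T₀(𝔸_f)` (g4), F1's conclusion (VERBATIM) ⟹ an `E♯`-form of `Sc.Mc` with Shimura
reciprocity (62) for `Aut(ℂ/E♯)` and `L`-idèles. [cite: Deligne1971TravauxShimura, (5.11.1)]
[cite: Milne2005ShimuraVarieties, Def. 12.8 (62) p. 114] -/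
def GaloisLegDescent : Prop :=
  ∀ (L : Type) [Field L] [NumberField L] [IsCMField L] (H : Matrix (Fin 3) (Fin 3) L) (τ : L →+* ℂ)
    (T : GL (Fin 3) ℂ) (hT : formCongr (starRingEnd ℂ) T (H.map τ) = BallModel.J)
    (K₀ : C5.OpenCompactSubgroup ↥(finAdelic (↥(maximalRealSubfield L)) L (IsCMField.complexConj L) 3 H))
    (Sc : ComplexRecordSystem L H τ T hT K₀) (Φ : CMType L)
    (L₀ : C5.OpenCompactSubgroup ↥(Aux.torusFinAdelic L)) [Finite (Aux.classGroup L L₀)],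
    Aux.HasSmallReflex L Φ τ →
    (haveI : NumberField ↥(Aux.reflexField L Φ τ) := Aux.numberField_reflexField L Φ τ
     ∀ s : (FiniteAdeleRing (𝓞 ↥(Aux.reflexField L Φ τ)) ↥(Aux.reflexField L Φ τ))ˣ,
       reflexNormFiniteIdele L Φ (Aux.reflexField L Φ τ) s ∈ Aux.torusFinAdelic L) →
    (∃ (N : C5.SmallLevel K₀ ⥤ SchemeOver ↥(Aux.reflexField L Φ τ))
        (ρ : ∀ K : C5.SmallLevel K₀, Aux.classGroup L L₀ →* Aut (N.obj K))
        (e : (N ⋙ Motives.baseChange ↥(Aux.reflexField L Φ τ) ℂ) ≅ Aux.complexSystem Sc L₀),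
        (∀ (K K' : C5.SmallLevel K₀) (f : K ⟶ K') (c : Aux.classGroup L L₀),
            (ρ K c).hom ≫ N.map f = N.map f ≫ (ρ K' c).hom) ∧
        (∀ (K : C5.SmallLevel K₀) (c : Aux.classGroup L L₀),
            (Motives.baseChange ↥(Aux.reflexField L Φ τ) ℂ).map (ρ K c).hom ≫ e.hom.app K =
              e.hom.app K ≫ Aux.translMor Sc L₀ K c) ∧
        Aux.IsCanonicalDescentAt Φ L₀ Sc N e) →
    ∃ (M : C5.SmallLevel K₀ ⥤ SchemeOver ↥(Aux.reflexField L Φ τ))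
      (e' : (M ⋙ Motives.baseChange ↥(Aux.reflexField L Φ τ) ℂ) ≅ Sc.Mc), IsCanonicalDescentAtReflex Φ Sc M e'

/-- **The line's composition for the Galois leg**: the four registered stubs (Q, B, T, R) ⟹ `GaloisLegDescent`.
[cite: Deligne1971TravauxShimura, (5.11.1)] [cite: Milne2005ShimuraVarieties, Def. 12.8 (62), Rem. 12.9] -/
theorem galoisLegDescent_of (hQ : StubQuotientFunctor) (hB : StubQuotientBaseChange) (hT : StubTorsorQuotient)
    (hR : StubReflexTransport) : GaloisLegDescent := by
  intro L _ _ _ H τ T hfr K₀ Sc Φ L₀ _ hsm hg4 hF1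
  obtain ⟨M, e', hM⟩ := auxQuotientDescent_of hQ hB hT L H τ T hfr K₀ Sc Φ L₀ hg4 hF1
  exact ⟨M, e', isCanonicalDescentAtReflex_of_overReflex hR Φ Sc hsm hM⟩


/-- **B-side junction for the Galois leg in A-plan1's requested shape** (INBOX 01:11:30Z): the four stubs ⟹ at
every hDel datum with small reflex field, g5, g4 and F1's conclusion, an `E♯`-form `(M, e')` of `Sc.Mc` with
`IsCanonicalDescentOver Sc (algebraMap ↥E♯ ℂ) M e'` = stub (A) `stub_reflexCompositumModel`'s inner block at
`E := ↥E♯`, `ιE := algebraMap ↥E♯ ℂ` (a1-reflex-compositum.lean :100–113). [cite: Deligne1971TravauxShimura, (5.11.1)]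
[cite: Milne2005ShimuraVarieties, Def. 12.8 (62) p. 114] -/
theorem galoisLegDescentOver_of (hQ : StubQuotientFunctor) (hB : StubQuotientBaseChange)
    (hT : StubTorsorQuotient) (hR : StubReflexTransport) :
    ∀ (L : Type) [Field L] [NumberField L] [IsCMField L] (H : Matrix (Fin 3) (Fin 3) L) (τ : L →+* ℂ)
      (T : GL (Fin 3) ℂ) (hT : formCongr (starRingEnd ℂ) T (H.map τ) = BallModel.J)
      (K₀ : C5.OpenCompactSubgroup ↥(finAdelic (↥(maximalRealSubfield L)) L (IsCMField.complexConj L) 3 H))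
      (Sc : ComplexRecordSystem L H τ T hT K₀) (Φ : CMType L)
      (L₀ : C5.OpenCompactSubgroup ↥(Aux.torusFinAdelic L)) [Finite (Aux.classGroup L L₀)],
      Aux.HasSmallReflex L Φ τ →
      (haveI : NumberField ↥(Aux.reflexField L Φ τ) := Aux.numberField_reflexField L Φ τ
       ∀ s : (FiniteAdeleRing (𝓞 ↥(Aux.reflexField L Φ τ)) ↥(Aux.reflexField L Φ τ))ˣ,
         reflexNormFiniteIdele L Φ (Aux.reflexField L Φ τ) s ∈ Aux.torusFinAdelic L) →
      (∃ (N : C5.SmallLevel K₀ ⥤ SchemeOver ↥(Aux.reflexField L Φ τ))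
          (ρ : ∀ K : C5.SmallLevel K₀, Aux.classGroup L L₀ →* Aut (N.obj K))
          (e : (N ⋙ Motives.baseChange ↥(Aux.reflexField L Φ τ) ℂ) ≅ Aux.complexSystem Sc L₀),
          (∀ (K K' : C5.SmallLevel K₀) (f : K ⟶ K') (c : Aux.classGroup L L₀),
              (ρ K c).hom ≫ N.map f = N.map f ≫ (ρ K' c).hom) ∧
          (∀ (K : C5.SmallLevel K₀) (c : Aux.classGroup L L₀),
              (Motives.baseChange ↥(Aux.reflexField L Φ τ) ℂ).map (ρ K c).hom ≫ e.hom.app K =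
                e.hom.app K ≫ Aux.translMor Sc L₀ K c) ∧
          Aux.IsCanonicalDescentAt Φ L₀ Sc N e) →
      ∃ (M : C5.SmallLevel K₀ ⥤ SchemeOver ↥(Aux.reflexField L Φ τ))
        (e' : (M ⋙ Motives.baseChange ↥(Aux.reflexField L Φ τ) ℂ) ≅ Sc.Mc),
        IsCanonicalDescentOver Sc (algebraMap ↥(Aux.reflexField L Φ τ) ℂ) M e' := by
  intro L _ _ _ H τ T hfr K₀ Sc Φ L₀ _ hsm hg4 hF1
  obtain ⟨M, e', hM⟩ := galoisLegDescent_of hQ hB hT hR L H τ T hfr K₀ Sc Φ L₀ hsm hg4 hF1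
  exact ⟨M, e', (isCanonicalDescentAtReflex_iff_over Φ Sc M e').1 hM⟩


/-- **Junction applied to the printed citation F1** (`Aux.canonicalModel_exists_printed`, p591128, a named fact consumed
as a hypothesis), with g4 DISCHARGED by typ03's theorem `Aux.reflexNormFiniteIdele_mem_torusFinAdelic` (p592936):
the stubs and F1 give, at every hDel datum (with F1's three side conditions), every adapted `Φ` with small reflex
field and every `L₀` with finite class group (g5), the `E♯`-form with (62) in A-plan1's shape. This is the term
A-p05 (iii) writes. [cite: Deligne1971TravauxShimura, (5.11.1)] [cite: Milne2005ShimuraVarieties, Def. 12.8 (62) p. 114] -/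
theorem galoisLegDescentOver_of_printed (hQ : StubQuotientFunctor) (hB : StubQuotientBaseChange)
    (hT : StubTorsorQuotient) (hR : StubReflexTransport) (hF1 : Aux.canonicalModel_exists_printed) :
    ∀ (L : Type) [Field L] [NumberField L] [IsCMField L] (H : Matrix (Fin 3) (Fin 3) L) (τ : L →+* ℂ)
      (T : GL (Fin 3) ℂ) (hT : formCongr (starRingEnd ℂ) T (H.map τ) = BallModel.J),
      (∀ τ' : L →+* ℂ, InfinitePlace.mk τ' ≠ InfinitePlace.mk τ → (H.map τ').PosDef) →
      (∀ v : Fin 3 → L, UnitaryGroup.hermForm (cmConjRingHom L) H v v = 0 → v = 0) →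
      ∀ K₀ : C5.OpenCompactSubgroup ↥(finAdelic (↥(maximalRealSubfield L)) L (IsCMField.complexConj L) 3 H),
        (∀ g : finAdelic (↥(maximalRealSubfield L)) L (IsCMField.complexConj L) 3 H,
          ∀ γ ∈ arithmeticLevel (↥(maximalRealSubfield L)) L (IsCMField.complexConj L) 3 H
            (K₀.1.map (MulAut.conj g).toMonoidHom), IsOfFinOrder γ → γ = 1) →
        ∀ (Sc : ComplexRecordSystem L H τ T hT K₀) (Φ : CMType L), Aux.IsAdapted L Φ τ →
          Aux.HasSmallReflex L Φ τ →
          ∀ (L₀ : C5.OpenCompactSubgroup ↥(Aux.torusFinAdelic L)) [Finite (Aux.classGroup L L₀)],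
            ∃ (M : C5.SmallLevel K₀ ⥤ SchemeOver ↥(Aux.reflexField L Φ τ))
              (e' : (M ⋙ Motives.baseChange ↥(Aux.reflexField L Φ τ) ℂ) ≅ Sc.Mc),
              IsCanonicalDescentOver Sc (algebraMap ↥(Aux.reflexField L Φ τ) ℂ) M e' := by
  intro L _ _ _ H τ T hfr hpos han K₀ hneat Sc Φ hΦ hsm L₀ _
  exact galoisLegDescentOver_of hQ hB hT hR L H τ T hfr K₀ Sc Φ L₀ hsm
    (Aux.reflexNormFiniteIdele_mem_torusFinAdelic L Φ τ) (hF1 L H τ T hfr hpos han K₀ hneat Sc Φ hΦ L₀)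

/-! ### §8. T⁺ — reflex transport in GENERAL degree `[E♯ : τL] ≥ 1` (A-plan1 INBOX 01:15:01Z (2))

Without `HasSmallReflex` the norm `N_{E♯/L} : 𝔸_{E♯,f}^× → 𝔸_{L,f}^×` is not surjective, so (62) over `E♯` for
`E♯`-idèles does not transport to a GIVEN `L`-idèle `s` by an exact preimage.  Instead: for `σ ∈ Aut(ℂ/E♯)` pick
ANY `s♯` with `art_{E♯}(s♯) = σ|E♯^{ab}` (`StubArtinSurjectiveReflex`, [Milne2005ShimuraVarieties] (59) p. 107
for the number field `E♯ ⊂ ℂ`, which is totally complex as it contains `τL`), push it down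
(`StubArtinNormFunctorial`: `art_L(N_{E♯/L} s♯) = σ|L^{ab}`, [Milne2005ShimuraVarieties] (59) functoriality /
[Shimura1998] §18.3; tree `restrictNormalHom_abRestrict_ideleArtinMap`), and compare the two `L`-idèles `s`,
`N s♯` — BOTH Artin-correspondent to `σ`, so they differ by an element of `ker art_L|_{𝔸_{L,f}^×}` = closure
of `L^×` (L totally complex) — through the A-side hypothesis `KernelTwistInvariance` («the reciprocity twists of
two idèles with the same Artin image act identically on `Sh_K` at a line point»: for `k ∈ L^×` the twist is the
rational element `diag(1,1,c(k)/k) ∈ T_x(ℚ) ⊆ G(ℚ)` fixing `x`; for the closure, `d ↦ [x, d·a]` is locally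
constant on `T_x(𝔸_f)`; owner A-p06 per A-plan1).  The twist for `N s♯` exists by the tree's
`exists_isDiagTwist_recipFactor` (H hermitian from the frame, `v₃` anisotropic from `IsLinePoint`). -/

/-- **Support stub (a′, T⁺)**: every `σ ∈ Aut(ℂ)` fixing the reflex field `E♯ = E(G̃, X̃_Φ) ⊂ ℂ` pointwise has an
Artin-correspondent finite idèle OF `E♯`: `∃ s♯ ∈ 𝔸_{E♯,f}^×, art_{E♯}(s♯) = σ|E♯^{ab}` in the sense of the tree's
record (`IsArtinCorrespondent ↥E♯ (algebraMap ↥E♯ ℂ) s♯ σ`).  Route: `E♯ ⊇ τL` with `L` CM ⇒ `E♯` totally complex;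
then the tree's two halves `exists_absoluteGaloisGroup_restrict` (no CM needed) and
`exists_finiteIdele_absGaloisAbProj_eq_theta_inv [IsTotallyComplex]` exactly as in
`exists_finiteIdele_isArtinCorrespondent`. Math S / Lean S–M (the `IsTotallyComplex ↥E♯` instance).
[cite: Milne2005ShimuraVarieties, p. 107 L9–15 and (59)] -/
def StubArtinSurjectiveReflex : Prop :=
  ∀ (L : Type) [Field L] [NumberField L] [IsCMField L] (Φ : CMType L) (τ : L →+* ℂ),
    (haveI : NumberField ↥(Aux.reflexField L Φ τ) := Aux.numberField_reflexField L Φ τ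
     ∀ σ : ℂ ≃+* ℂ, (∀ x : ↥(Aux.reflexField L Φ τ), σ (algebraMap ↥(Aux.reflexField L Φ τ) ℂ x) =
        algebraMap ↥(Aux.reflexField L Φ τ) ℂ x) →
       ∃ s : (FiniteAdeleRing (𝓞 ↥(Aux.reflexField L Φ τ)) ↥(Aux.reflexField L Φ τ))ˣ,
         UnitaryCanonicalModel.IsArtinCorrespondent ↥(Aux.reflexField L Φ τ)
           (algebraMap ↥(Aux.reflexField L Φ τ) ℂ) s σ)

/-- Registered support stub (a′, T⁺): `StubArtinSurjectiveReflex`. [cite: Milne2005ShimuraVarieties, (59) p. 107] -/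
theorem stub_artinSurjectiveReflex : StubArtinSurjectiveReflex :=
  -- CLOSED (A-p05, p594845 ACCEPTED 2026-08-28T01:46Z): statement text unchanged; proof = the tree theorem.
  Aux.artinSurjectiveReflex

/-- **Support stub (b′, T⁺)**: norm functoriality of the Artin correspondence down the tower `τL ⊆ E♯`
(`Algebra L ↥E♯` through `Aux.toReflexField`, so `algebraMap ↥E♯ ℂ ∘ toReflexField = τ`): if `s♯ ∈ 𝔸_{E♯,f}^×`
is Artin-correspondent to `σ` over `E♯`, then `N_{E♯/L}(s♯) ∈ 𝔸_{L,f}^×` is Artin-correspondent to the SAME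
`σ` over `(L, τ)` — `art_L ∘ N_{E♯/L} = res ∘ art_{E♯}` ([Milne2005ShimuraVarieties] (59) functoriality;
[Shimura1998] §18.3; tree `restrictNormalHom_abRestrict_ideleArtinMap`, `finitePart_ideleRelNorm`), plus the
embedding bookkeeping `L̄ → E♯‾ → ℂ` (restrict `γ♯ ∈ Gal(E♯‾/E♯)` to `L̄`). Math S / Lean M.
[cite: Milne2005ShimuraVarieties, (59) p. 107] [cite: Shimura1998, §18.3 pp. 121–122] -/
def StubArtinNormFunctorial : Prop :=
  ∀ (L : Type) [Field L] [NumberField L] [IsCMField L] (Φ : CMType L) (τ : L →+* ℂ),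
    (haveI : NumberField ↥(Aux.reflexField L Φ τ) := Aux.numberField_reflexField L Φ τ
     letI : Algebra L ↥(Aux.reflexField L Φ τ) := (Aux.toReflexField L Φ τ).toAlgebra
     ∀ (σ : ℂ ≃+* ℂ) (s : (FiniteAdeleRing (𝓞 ↥(Aux.reflexField L Φ τ)) ↥(Aux.reflexField L Φ τ))ˣ),
       UnitaryCanonicalModel.IsArtinCorrespondent ↥(Aux.reflexField L Φ τ)
           (algebraMap ↥(Aux.reflexField L Φ τ) ℂ) s σ →
         UnitaryCanonicalModel.IsArtinCorrespondent L τ (finiteIdeleRelNorm L ↥(Aux.reflexField L Φ τ) s) σ)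

/-- Registered support stub (b′, T⁺): `StubArtinNormFunctorial`. [cite: Milne2005ShimuraVarieties, (59) p. 107] -/
theorem stub_artinNormFunctorial : StubArtinNormFunctorial :=
  -- CLOSED (B-p16, p595207 ACCEPTED 2026-08-28T01:55Z): statement text unchanged; proof = the tree theorem.
  Aux.isArtinCorrespondent_finiteIdeleRelNorm

/-- **A-side hypothesis (d′, T⁺; owner A-p06 per A-plan1 01:15:01Z) — kernel-twist invariance**: at a line point
`x = x_{v₃}` of the hDel datum, the reciprocity twists `d`, `d'` of two finite idèles `s`, `s'` of `L` that are
Artin-correspondent to the SAME `σ ∈ Aut(ℂ)` act identically on the Shimura set: `[x, d·a]_K = [x, d'·a]_K`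
(`s' s⁻¹ ∈ ker art_L|_{𝔸_{L,f}^×} = closure of L^×`; rational part absorbed by `T_x(ℚ) ⊆ G(ℚ)` fixing `x`, closure
by local constancy of `t ↦ [x, t·a]` on `T_x(𝔸_f)`).  NOT a stub of this line (stated here only as the hypothesis
consumed by `galoisLegDescentOver_general_of`). [cite: Milne2005ShimuraVarieties, (59)–(62) pp. 107–114]
[cite: Deligne1979ShimuraVarieties, 2.2.3–2.2.4] -/
def KernelTwistInvariance : Prop :=
  ∀ (L : Type) [Field L] [NumberField L] [IsCMField L] (H : Matrix (Fin 3) (Fin 3) L) (τ : L →+* ℂ)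
    (T : GL (Fin 3) ℂ) (hT : formCongr (starRingEnd ℂ) T (H.map τ) = BallModel.J)
    (K₀ : C5.OpenCompactSubgroup ↥(finAdelic (↥(maximalRealSubfield L)) L (IsCMField.complexConj L) 3 H))
    (K : C5.SmallLevel K₀) (σ : ℂ ≃+* ℂ) (s s' : (FiniteAdeleRing (𝓞 L) L)ˣ),
    UnitaryCanonicalModel.IsArtinCorrespondent L τ s σ → UnitaryCanonicalModel.IsArtinCorrespondent L τ s' σ →
    ∀ (v₃ : Fin 3 → L) (x : Ball), IsLinePoint L τ T v₃ x →
      ∀ d d' : finAdelic (↥(maximalRealSubfield L)) L (IsCMField.complexConj L) 3 H,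
        IsDiagTwist L H v₃ (recipFactor L s) d → IsDiagTwist L H v₃ (recipFactor L s') d' →
        ∀ a : finAdelic (↥(maximalRealSubfield L)) L (IsCMField.complexConj L) 3 H,
          ShimuraSet.mk L H τ T hT K.1.1 x (d * a) = ShimuraSet.mk L H τ T hT K.1.1 x (d' * a)

/-- **T⁺ transport**: (62) over `E♯` for `E♯`-idèles ⟹ (62) over `E♯` for `L`-idèles, in ANY degree, from
(a′), (b′) and kernel-twist invariance — no `HasSmallReflex`. [cite: Milne2005ShimuraVarieties, Def. 12.8 (62) p. 114] -/
theorem isCanonicalDescentAtReflex_of_overReflex_general (hA : StubArtinSurjectiveReflex)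
    (hN : StubArtinNormFunctorial) (hker : KernelTwistInvariance)
    {L : Type} [Field L] [NumberField L] [IsCMField L] {H : Matrix (Fin 3) (Fin 3) L}
    {τ : L →+* ℂ} {T : GL (Fin 3) ℂ} {hT : formCongr (starRingEnd ℂ) T (H.map τ) = BallModel.J}
    {K₀ : C5.OpenCompactSubgroup ↥(finAdelic (↥(maximalRealSubfield L)) L (IsCMField.complexConj L) 3 H)}
    (Φ : CMType L) (Sc : ComplexRecordSystem L H τ T hT K₀)
    {M : C5.SmallLevel K₀ ⥤ SchemeOver ↥(Aux.reflexField L Φ τ)}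
    {e : (M ⋙ Motives.baseChange ↥(Aux.reflexField L Φ τ) ℂ) ≅ Sc.Mc}
    (h : IsCanonicalDescentOverReflex Φ Sc M e) : IsCanonicalDescentAtReflex Φ Sc M e := by
  intro K σ s hs v₃ x hx d hd a
  haveI : NumberField ↥(Aux.reflexField L Φ τ) := Aux.numberField_reflexField L Φ τ
  letI : Algebra L ↥(Aux.reflexField L Φ τ) := (Aux.toReflexField L Φ τ).toAlgebra
  -- an `E♯`-idèle for `σ` (a′) and its norm, Artin-correspondent to `σ` over `L` (b′)
  obtain ⟨s₁, hs₁⟩ := hA L Φ τ σ.toRingEquiv fun y => σ.commutes y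
  have hs' := hN L Φ τ σ.toRingEquiv s₁ hs₁
  -- the twist of the norm exists: `H` hermitian (frame), `v₃` anisotropic (line point)
  have hH : ∀ i j, cmConjRingHom L (H i j) = H j i := cmConjRingHom_apply_eq_of_formCongr_eq_J L H τ T hT
  have hv : (fun i => τ (v₃ i)) ∈ negCone (H.map τ) := by
    by_contra hnv
    exact not_isLinePoint_of_not_mem_negCone L H τ T hT v₃ hnv x hx
  have hv' : UnitaryGroup.hermForm (cmConjRingHom L) H v₃ v₃ ≠ 0 := hermForm_self_ne_zero_of_mem_negCone hv
  obtain ⟨d', hd'⟩ := exists_isDiagTwist_recipFactor H v₃ hH hv'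
    (finiteIdeleRelNorm L ↥(Aux.reflexField L Φ τ) s₁)
  -- (62) over `E♯` at `(σ, s₁)` with the twist `d'`, then kernel-twist invariance `d ↔ d'`
  have h62 := h K σ s₁ hs₁ v₃ x hx d' hd' a
  have hk := hker L H τ T hT K₀ K σ.toRingEquiv s (finiteIdeleRelNorm L ↥(Aux.reflexField L Φ τ) s₁) hs hs'
    v₃ x hx d d' hd hd' a
  rw [hk]
  exact h62

/-- **T⁺ junction (general degree)**: the three crux-line stubs, (a′), (b′) and kernel-twist invariance ⟹ at every
hDel datum, EVERY `Φ` (no `HasSmallReflex`), g5, g4 and F1's conclusion, an `E♯`-form with (62) for `Aut(ℂ/E♯)` and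
`L`-idèles in A-plan1's shape — closes stub (A) `stub_reflexCompositumModel` at `E := E♯` verbatim in its full
generality (all CM fields `L`). [cite: Deligne1971TravauxShimura, (5.11.1)] [cite: Milne2005ShimuraVarieties, Def. 12.8 (62) p. 114] -/
theorem galoisLegDescentOver_general_of (hQ : StubQuotientFunctor) (hB : StubQuotientBaseChange)
    (hT : StubTorsorQuotient) (hA : StubArtinSurjectiveReflex) (hN : StubArtinNormFunctorial)
    (hker : KernelTwistInvariance) :
    ∀ (L : Type) [Field L] [NumberField L] [IsCMField L] (H : Matrix (Fin 3) (Fin 3) L) (τ : L →+* ℂ)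
      (T : GL (Fin 3) ℂ) (hT : formCongr (starRingEnd ℂ) T (H.map τ) = BallModel.J)
      (K₀ : C5.OpenCompactSubgroup ↥(finAdelic (↥(maximalRealSubfield L)) L (IsCMField.complexConj L) 3 H))
      (Sc : ComplexRecordSystem L H τ T hT K₀) (Φ : CMType L)
      (L₀ : C5.OpenCompactSubgroup ↥(Aux.torusFinAdelic L)) [Finite (Aux.classGroup L L₀)],
      (haveI : NumberField ↥(Aux.reflexField L Φ τ) := Aux.numberField_reflexField L Φ τ
       ∀ s : (FiniteAdeleRing (𝓞 ↥(Aux.reflexField L Φ τ)) ↥(Aux.reflexField L Φ τ))ˣ,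
         reflexNormFiniteIdele L Φ (Aux.reflexField L Φ τ) s ∈ Aux.torusFinAdelic L) →
      (∃ (N : C5.SmallLevel K₀ ⥤ SchemeOver ↥(Aux.reflexField L Φ τ))
          (ρ : ∀ K : C5.SmallLevel K₀, Aux.classGroup L L₀ →* Aut (N.obj K))
          (e : (N ⋙ Motives.baseChange ↥(Aux.reflexField L Φ τ) ℂ) ≅ Aux.complexSystem Sc L₀),
          (∀ (K K' : C5.SmallLevel K₀) (f : K ⟶ K') (c : Aux.classGroup L L₀),
              (ρ K c).hom ≫ N.map f = N.map f ≫ (ρ K' c).hom) ∧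
          (∀ (K : C5.SmallLevel K₀) (c : Aux.classGroup L L₀),
              (Motives.baseChange ↥(Aux.reflexField L Φ τ) ℂ).map (ρ K c).hom ≫ e.hom.app K =
                e.hom.app K ≫ Aux.translMor Sc L₀ K c) ∧
          Aux.IsCanonicalDescentAt Φ L₀ Sc N e) →
      ∃ (M : C5.SmallLevel K₀ ⥤ SchemeOver ↥(Aux.reflexField L Φ τ))
        (e' : (M ⋙ Motives.baseChange ↥(Aux.reflexField L Φ τ) ℂ) ≅ Sc.Mc),
        IsCanonicalDescentOver Sc (algebraMap ↥(Aux.reflexField L Φ τ) ℂ) M e' := by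
  intro L _ _ _ H τ T hfr K₀ Sc Φ L₀ _ hg4 hF1
  obtain ⟨M, e', hM⟩ := auxQuotientDescent_of hQ hB hT L H τ T hfr K₀ Sc Φ L₀ hg4 hF1
  exact ⟨M, e', (isCanonicalDescentAtReflex_iff_over Φ Sc M e').1
    (isCanonicalDescentAtReflex_of_overReflex_general hA hN hker Φ Sc hM)⟩

/-- **T⁺ junction applied to F1** (g4 discharged by `Aux.reflexNormFiniteIdele_mem_torusFinAdelic`): for EVERY adapted
`Φ`, no `HasSmallReflex`. [cite: Deligne1971TravauxShimura, (5.11.1)] [cite: Milne2005ShimuraVarieties, Def. 12.8 (62) p. 114] -/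
theorem galoisLegDescentOver_general_of_printed (hQ : StubQuotientFunctor) (hB : StubQuotientBaseChange)
    (hT : StubTorsorQuotient) (hA : StubArtinSurjectiveReflex) (hN : StubArtinNormFunctorial)
    (hker : KernelTwistInvariance) (hF1 : Aux.canonicalModel_exists_printed) :
    ∀ (L : Type) [Field L] [NumberField L] [IsCMField L] (H : Matrix (Fin 3) (Fin 3) L) (τ : L →+* ℂ)
      (T : GL (Fin 3) ℂ) (hT : formCongr (starRingEnd ℂ) T (H.map τ) = BallModel.J),
      (∀ τ' : L →+* ℂ, InfinitePlace.mk τ' ≠ InfinitePlace.mk τ → (H.map τ').PosDef) →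
      (∀ v : Fin 3 → L, UnitaryGroup.hermForm (cmConjRingHom L) H v v = 0 → v = 0) →
      ∀ K₀ : C5.OpenCompactSubgroup ↥(finAdelic (↥(maximalRealSubfield L)) L (IsCMField.complexConj L) 3 H),
        (∀ g : finAdelic (↥(maximalRealSubfield L)) L (IsCMField.complexConj L) 3 H,
          ∀ γ ∈ arithmeticLevel (↥(maximalRealSubfield L)) L (IsCMField.complexConj L) 3 H
            (K₀.1.map (MulAut.conj g).toMonoidHom), IsOfFinOrder γ → γ = 1) →
        ∀ (Sc : ComplexRecordSystem L H τ T hT K₀) (Φ : CMType L), Aux.IsAdapted L Φ τ →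
          ∀ (L₀ : C5.OpenCompactSubgroup ↥(Aux.torusFinAdelic L)) [Finite (Aux.classGroup L L₀)],
            ∃ (M : C5.SmallLevel K₀ ⥤ SchemeOver ↥(Aux.reflexField L Φ τ))
              (e' : (M ⋙ Motives.baseChange ↥(Aux.reflexField L Φ τ) ℂ) ≅ Sc.Mc),
              IsCanonicalDescentOver Sc (algebraMap ↥(Aux.reflexField L Φ τ) ℂ) M e' := by
  intro L _ _ _ H τ T hfr hpos han K₀ hneat Sc Φ hΦ L₀ _
  exact galoisLegDescentOver_general_of hQ hB hT hA hN hker L H τ T hfr K₀ Sc Φ L₀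
    (Aux.reflexNormFiniteIdele_mem_torusFinAdelic L Φ τ) (hF1 L H τ T hfr hpos han K₀ hneat Sc Φ hΦ L₀)


/-! ### §9. Heads PROVED (v7): all four registered stubs of the crux line are closed by tree theorems
(Q p592880, B p592797, Torsor p591996, R p593565), so the compositions of §2–§7 hold outright — sorry-free, kernel
axioms = the Lean trio.  The Galois leg of `HypDel` on the B side is thereby reduced to the ONE printed citation F1
(`Aux.canonicalModel_exists_printed`, hypothesis) plus the class-group finiteness instance g5. -/

/-- (5.11.1) over an arbitrary base, PROVED. [cite: Deligne1971TravauxShimura, (5.11.1)] -/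
theorem quotientReciprocityDescent_holds : QuotientReciprocityDescent :=
  quotientReciprocityDescent_of stub_quotientFunctor stub_quotientBaseChange stub_torsorQuotient

/-- Finite Hecke quotient descent over a base `E`, PROVED. [cite: Deligne1971TravauxShimura, (5.11.1)] -/
theorem heckeQuotientDescentOver_holds : HeckeQuotientDescentOver :=
  heckeQuotientDescentOver_of stub_quotientFunctor stub_quotientBaseChange stub_torsorQuotient

/-- Finite Hecke quotient descent in hDel's vocabulary (base `(L, τ)`), PROVED. [cite: Deligne1971TravauxShimura, (5.11.1)] -/
theorem heckeQuotientDescent_holds : HeckeQuotientDescent :=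
  heckeQuotientDescent_of stub_quotientFunctor stub_quotientBaseChange stub_torsorQuotient

/-- F1-conclusion ⟹ `Δ`-free `E♯`-form with `E♯`-idèle reciprocity (junction J2), PROVED.
[cite: Deligne1971TravauxShimura, (5.11.1)] -/
theorem auxQuotientDescent_holds : AuxQuotientDescent :=
  auxQuotientDescent_of stub_quotientFunctor stub_quotientBaseChange stub_torsorQuotient

/-- F1-conclusion ⟹ `E♯`-form with (62) for `Aut(ℂ/E♯)` and `L`-idèles under `HasSmallReflex` (junction J3), PROVED.
[cite: Deligne1971TravauxShimura, (5.11.1)] [cite: Milne2005ShimuraVarieties, Def. 12.8 (62) p. 114] -/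
theorem galoisLegDescent_holds : GaloisLegDescent :=
  galoisLegDescent_of stub_quotientFunctor stub_quotientBaseChange stub_torsorQuotient stub_reflexTransport

/-- **THE B-SIDE DELIVERABLE OF THE GALOIS LEG (v7, sorry-free modulo the printed citation F1 as a hypothesis)**:
F1 ⟹ at every hDel datum satisfying F1's printed side conditions, every adapted `Φ` with small reflex field (all
`Φ` when `L/ℚ` is Galois) and every `L₀` with finite class group, an `E♯`-form `(M, e')` of `Sc.Mc` with
`IsCanonicalDescentOver Sc (algebraMap ↥E♯ ℂ) M e'` — A-plan1's stub (A) inner block at `E := E♯` by name.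
[cite: Deligne1971TravauxShimura, (5.11.1)] [cite: Milne2005ShimuraVarieties, Def. 12.8 (62) p. 114] -/
theorem galoisLegDescentOver_of_F1 (hF1 : Aux.canonicalModel_exists_printed) :
    ∀ (L : Type) [Field L] [NumberField L] [IsCMField L] (H : Matrix (Fin 3) (Fin 3) L) (τ : L →+* ℂ)
      (T : GL (Fin 3) ℂ) (hT : formCongr (starRingEnd ℂ) T (H.map τ) = BallModel.J),
      (∀ τ' : L →+* ℂ, InfinitePlace.mk τ' ≠ InfinitePlace.mk τ → (H.map τ').PosDef) →
      (∀ v : Fin 3 → L, UnitaryGroup.hermForm (cmConjRingHom L) H v v = 0 → v = 0) →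
      ∀ K₀ : C5.OpenCompactSubgroup ↥(finAdelic (↥(maximalRealSubfield L)) L (IsCMField.complexConj L) 3 H),
        (∀ g : finAdelic (↥(maximalRealSubfield L)) L (IsCMField.complexConj L) 3 H,
          ∀ γ ∈ arithmeticLevel (↥(maximalRealSubfield L)) L (IsCMField.complexConj L) 3 H
            (K₀.1.map (MulAut.conj g).toMonoidHom), IsOfFinOrder γ → γ = 1) →
        ∀ (Sc : ComplexRecordSystem L H τ T hT K₀) (Φ : CMType L), Aux.IsAdapted L Φ τ →
          Aux.HasSmallReflex L Φ τ →
          ∀ (L₀ : C5.OpenCompactSubgroup ↥(Aux.torusFinAdelic L)) [Finite (Aux.classGroup L L₀)],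
            ∃ (M : C5.SmallLevel K₀ ⥤ SchemeOver ↥(Aux.reflexField L Φ τ))
              (e' : (M ⋙ Motives.baseChange ↥(Aux.reflexField L Φ τ) ℂ) ≅ Sc.Mc),
              IsCanonicalDescentOver Sc (algebraMap ↥(Aux.reflexField L Φ τ) ℂ) M e' :=
  galoisLegDescentOver_of_printed stub_quotientFunctor stub_quotientBaseChange stub_torsorQuotient
    stub_reflexTransport hF1

/-- T⁺ deliverable modulo F1, the two §8 support stubs and kernel-twist invariance (no `HasSmallReflex`).
[cite: Deligne1971TravauxShimura, (5.11.1)] [cite: Milne2005ShimuraVarieties, Def. 12.8 (62) p. 114] -/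
theorem galoisLegDescentOver_general_of_F1 (hA : StubArtinSurjectiveReflex) (hN : StubArtinNormFunctorial)
    (hker : KernelTwistInvariance) (hF1 : Aux.canonicalModel_exists_printed) :
    ∀ (L : Type) [Field L] [NumberField L] [IsCMField L] (H : Matrix (Fin 3) (Fin 3) L) (τ : L →+* ℂ)
      (T : GL (Fin 3) ℂ) (hT : formCongr (starRingEnd ℂ) T (H.map τ) = BallModel.J),
      (∀ τ' : L →+* ℂ, InfinitePlace.mk τ' ≠ InfinitePlace.mk τ → (H.map τ').PosDef) →
      (∀ v : Fin 3 → L, UnitaryGroup.hermForm (cmConjRingHom L) H v v = 0 → v = 0) →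
      ∀ K₀ : C5.OpenCompactSubgroup ↥(finAdelic (↥(maximalRealSubfield L)) L (IsCMField.complexConj L) 3 H),
        (∀ g : finAdelic (↥(maximalRealSubfield L)) L (IsCMField.complexConj L) 3 H,
          ∀ γ ∈ arithmeticLevel (↥(maximalRealSubfield L)) L (IsCMField.complexConj L) 3 H
            (K₀.1.map (MulAut.conj g).toMonoidHom), IsOfFinOrder γ → γ = 1) →
        ∀ (Sc : ComplexRecordSystem L H τ T hT K₀) (Φ : CMType L), Aux.IsAdapted L Φ τ →
          ∀ (L₀ : C5.OpenCompactSubgroup ↥(Aux.torusFinAdelic L)) [Finite (Aux.classGroup L L₀)],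
            ∃ (M : C5.SmallLevel K₀ ⥤ SchemeOver ↥(Aux.reflexField L Φ τ))
              (e' : (M ⋙ Motives.baseChange ↥(Aux.reflexField L Φ τ) ℂ) ≅ Sc.Mc),
              IsCanonicalDescentOver Sc (algebraMap ↥(Aux.reflexField L Φ τ) ℂ) M e' :=
  galoisLegDescentOver_general_of_printed stub_quotientFunctor stub_quotientBaseChange stub_torsorQuotient
    hA hN hker hF1


/-! ### §10. (v8) Kernel-twist invariance is a TREE THEOREM (A-p05 p594589); g5 is a NAMED FACT (typ03 p594393).
The T⁺ head therefore needs only (a′), (b′) and F1; and the two deliverables get `_g5` forms taking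
`(hg5 : Aux.finite_classGroup_printed)` in place of the instance binder `[Finite (Aux.classGroup L L₀)]`. -/

/-- (d′) CLOSED BY NAME: `KernelTwistInvariance` is the tree theorem `UnitaryCanonicalModel.kernelTwistInvariance`
(A-p05, p594589; binders verbatim). [cite: Milne2005ShimuraVarieties, (59)–(62) pp. 107–114] -/
theorem kernelTwistInvariance_holds : KernelTwistInvariance :=
  UnitaryCanonicalModel.kernelTwistInvariance

/-- T⁺ deliverable modulo F1 and the two §8 support stubs ONLY (kernel-twist invariance discharged by the tree).
[cite: Deligne1971TravauxShimura, (5.11.1)] [cite: Milne2005ShimuraVarieties, Def. 12.8 (62) p. 114] -/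
theorem galoisLegDescentOver_general_of_F1' (hA : StubArtinSurjectiveReflex) (hN : StubArtinNormFunctorial)
    (hF1 : Aux.canonicalModel_exists_printed) :
    ∀ (L : Type) [Field L] [NumberField L] [IsCMField L] (H : Matrix (Fin 3) (Fin 3) L) (τ : L →+* ℂ)
      (T : GL (Fin 3) ℂ) (hT : formCongr (starRingEnd ℂ) T (H.map τ) = BallModel.J),
      (∀ τ' : L →+* ℂ, InfinitePlace.mk τ' ≠ InfinitePlace.mk τ → (H.map τ').PosDef) →
      (∀ v : Fin 3 → L, UnitaryGroup.hermForm (cmConjRingHom L) H v v = 0 → v = 0) →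
      ∀ K₀ : C5.OpenCompactSubgroup ↥(finAdelic (↥(maximalRealSubfield L)) L (IsCMField.complexConj L) 3 H),
        (∀ g : finAdelic (↥(maximalRealSubfield L)) L (IsCMField.complexConj L) 3 H,
          ∀ γ ∈ arithmeticLevel (↥(maximalRealSubfield L)) L (IsCMField.complexConj L) 3 H
            (K₀.1.map (MulAut.conj g).toMonoidHom), IsOfFinOrder γ → γ = 1) →
        ∀ (Sc : ComplexRecordSystem L H τ T hT K₀) (Φ : CMType L), Aux.IsAdapted L Φ τ →
          ∀ (L₀ : C5.OpenCompactSubgroup ↥(Aux.torusFinAdelic L)) [Finite (Aux.classGroup L L₀)],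
            ∃ (M : C5.SmallLevel K₀ ⥤ SchemeOver ↥(Aux.reflexField L Φ τ))
              (e' : (M ⋙ Motives.baseChange ↥(Aux.reflexField L Φ τ) ℂ) ≅ Sc.Mc),
              IsCanonicalDescentOver Sc (algebraMap ↥(Aux.reflexField L Φ τ) ℂ) M e' :=
  galoisLegDescentOver_general_of_F1 hA hN kernelTwistInvariance_holds hF1

/-- **Galois-leg deliverable, `_g5` form**: F1 + g5 (both printed citations, hypotheses BY NAME) ⟹ for every hDel
datum (F1 side conditions), adapted `Φ` with small reflex field and EVERY open compact `L₀ ≤ T₀(𝔸_f)`, an `E♯`-form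
with (62) in A-plan1's shape. [cite: Deligne1971TravauxShimura, (5.11.1)] [cite: Milne2005ShimuraVarieties, Def. 12.8 (62) p. 114] -/
theorem galoisLegDescentOver_of_F1_g5 (hF1 : Aux.canonicalModel_exists_printed)
    (hg5 : Aux.finite_classGroup_printed) :
    ∀ (L : Type) [Field L] [NumberField L] [IsCMField L] (H : Matrix (Fin 3) (Fin 3) L) (τ : L →+* ℂ)
      (T : GL (Fin 3) ℂ) (hT : formCongr (starRingEnd ℂ) T (H.map τ) = BallModel.J),
      (∀ τ' : L →+* ℂ, InfinitePlace.mk τ' ≠ InfinitePlace.mk τ → (H.map τ').PosDef) →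
      (∀ v : Fin 3 → L, UnitaryGroup.hermForm (cmConjRingHom L) H v v = 0 → v = 0) →
      ∀ K₀ : C5.OpenCompactSubgroup ↥(finAdelic (↥(maximalRealSubfield L)) L (IsCMField.complexConj L) 3 H),
        (∀ g : finAdelic (↥(maximalRealSubfield L)) L (IsCMField.complexConj L) 3 H,
          ∀ γ ∈ arithmeticLevel (↥(maximalRealSubfield L)) L (IsCMField.complexConj L) 3 H
            (K₀.1.map (MulAut.conj g).toMonoidHom), IsOfFinOrder γ → γ = 1) →
        ∀ (Sc : ComplexRecordSystem L H τ T hT K₀) (Φ : CMType L), Aux.IsAdapted L Φ τ →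
          Aux.HasSmallReflex L Φ τ →
          ∀ (L₀ : C5.OpenCompactSubgroup ↥(Aux.torusFinAdelic L)),
            ∃ (M : C5.SmallLevel K₀ ⥤ SchemeOver ↥(Aux.reflexField L Φ τ))
              (e' : (M ⋙ Motives.baseChange ↥(Aux.reflexField L Φ τ) ℂ) ≅ Sc.Mc),
              IsCanonicalDescentOver Sc (algebraMap ↥(Aux.reflexField L Φ τ) ℂ) M e' := by
  intro L _ _ _ H τ T hfr hpos han K₀ hneat Sc Φ hΦ hsm L₀
  haveI := hg5 L L₀
  exact galoisLegDescentOver_of_F1 hF1 L H τ T hfr hpos han K₀ hneat Sc Φ hΦ hsm L₀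

/-- **T⁺ deliverable, `_g5` form**: F1 + g5 + (a′) + (b′) ⟹ the same for EVERY adapted `Φ` (no `HasSmallReflex`).
[cite: Deligne1971TravauxShimura, (5.11.1)] [cite: Milne2005ShimuraVarieties, Def. 12.8 (62) p. 114] -/
theorem galoisLegDescentOver_general_of_F1_g5 (hA : StubArtinSurjectiveReflex) (hN : StubArtinNormFunctorial)
    (hF1 : Aux.canonicalModel_exists_printed) (hg5 : Aux.finite_classGroup_printed) :
    ∀ (L : Type) [Field L] [NumberField L] [IsCMField L] (H : Matrix (Fin 3) (Fin 3) L) (τ : L →+* ℂ)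
      (T : GL (Fin 3) ℂ) (hT : formCongr (starRingEnd ℂ) T (H.map τ) = BallModel.J),
      (∀ τ' : L →+* ℂ, InfinitePlace.mk τ' ≠ InfinitePlace.mk τ → (H.map τ').PosDef) →
      (∀ v : Fin 3 → L, UnitaryGroup.hermForm (cmConjRingHom L) H v v = 0 → v = 0) →
      ∀ K₀ : C5.OpenCompactSubgroup ↥(finAdelic (↥(maximalRealSubfield L)) L (IsCMField.complexConj L) 3 H),
        (∀ g : finAdelic (↥(maximalRealSubfield L)) L (IsCMField.complexConj L) 3 H,
          ∀ γ ∈ arithmeticLevel (↥(maximalRealSubfield L)) L (IsCMField.complexConj L) 3 H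
            (K₀.1.map (MulAut.conj g).toMonoidHom), IsOfFinOrder γ → γ = 1) →
        ∀ (Sc : ComplexRecordSystem L H τ T hT K₀) (Φ : CMType L), Aux.IsAdapted L Φ τ →
          ∀ (L₀ : C5.OpenCompactSubgroup ↥(Aux.torusFinAdelic L)),
            ∃ (M : C5.SmallLevel K₀ ⥤ SchemeOver ↥(Aux.reflexField L Φ τ))
              (e' : (M ⋙ Motives.baseChange ↥(Aux.reflexField L Φ τ) ℂ) ≅ Sc.Mc),
              IsCanonicalDescentOver Sc (algebraMap ↥(Aux.reflexField L Φ τ) ℂ) M e' := by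
  intro L _ _ _ H τ T hfr hpos han K₀ hneat Sc Φ hΦ L₀
  haveI := hg5 L L₀
  exact galoisLegDescentOver_general_of_F1' hA hN hF1 L H τ T hfr hpos han K₀ hneat Sc Φ hΦ L₀


/-- **THE STRONGEST B-SIDE HEAD (v8; the shape of A-p05's `stub_reflexCompositumModel_of (hF1) (hg5) (hN)`)**:
F1 + g5 (printed citations, BY NAME) + the ONE open support stub (b′) `StubArtinNormFunctorial` (B-p16) ⟹ for every
hDel datum (F1 side conditions), EVERY adapted `Φ` and EVERY open compact `L₀ ≤ T₀(𝔸_f)`: an `E♯`-form of `Sc.Mc`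
with (62) for `Aut(ℂ/E♯)` and `L`-idèles.  ((a′) = `Aux.artinSurjectiveReflex` p594845, (d′) =
`UnitaryCanonicalModel.kernelTwistInvariance` p594589, Q/B/Torsor/R closed — all by name.)
[cite: Deligne1971TravauxShimura, (5.11.1)] [cite: Milne2005ShimuraVarieties, Def. 12.8 (62) p. 114] -/
theorem galoisLegDescentOver_of_F1_g5_normFunctorial (hN : StubArtinNormFunctorial)
    (hF1 : Aux.canonicalModel_exists_printed) (hg5 : Aux.finite_classGroup_printed) :
    ∀ (L : Type) [Field L] [NumberField L] [IsCMField L] (H : Matrix (Fin 3) (Fin 3) L) (τ : L →+* ℂ)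
      (T : GL (Fin 3) ℂ) (hT : formCongr (starRingEnd ℂ) T (H.map τ) = BallModel.J),
      (∀ τ' : L →+* ℂ, InfinitePlace.mk τ' ≠ InfinitePlace.mk τ → (H.map τ').PosDef) →
      (∀ v : Fin 3 → L, UnitaryGroup.hermForm (cmConjRingHom L) H v v = 0 → v = 0) →
      ∀ K₀ : C5.OpenCompactSubgroup ↥(finAdelic (↥(maximalRealSubfield L)) L (IsCMField.complexConj L) 3 H),
        (∀ g : finAdelic (↥(maximalRealSubfield L)) L (IsCMField.complexConj L) 3 H,
          ∀ γ ∈ arithmeticLevel (↥(maximalRealSubfield L)) L (IsCMField.complexConj L) 3 H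
            (K₀.1.map (MulAut.conj g).toMonoidHom), IsOfFinOrder γ → γ = 1) →
        ∀ (Sc : ComplexRecordSystem L H τ T hT K₀) (Φ : CMType L), Aux.IsAdapted L Φ τ →
          ∀ (L₀ : C5.OpenCompactSubgroup ↥(Aux.torusFinAdelic L)),
            ∃ (M : C5.SmallLevel K₀ ⥤ SchemeOver ↥(Aux.reflexField L Φ τ))
              (e' : (M ⋙ Motives.baseChange ↥(Aux.reflexField L Φ τ) ℂ) ≅ Sc.Mc),
              IsCanonicalDescentOver Sc (algebraMap ↥(Aux.reflexField L Φ τ) ℂ) M e' :=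
  galoisLegDescentOver_general_of_F1_g5 stub_artinSurjectiveReflex hN hF1 hg5


/-! ### §11. (v8) TREE CERTIFICATION of B-p07's landing `UnitaryAuxiliaryHeckeQuotientDescent.lean` (p594805).
Each head `def X : Prop` of this skeleton is re-proved BY NAME from the tree theorem B-p07 landed (ref2 01:52:11Z:
«not byte-compared by me») — so the kernel certifies that the landed statements ARE the skeleton's statements
(up to definitional unfolding). From v8 on, A-side seats should cite the TREE names (`UnitaryCanonicalModel.HeckeQuotient.*`);
this file remains the crux workfile (stubs + compositions) for the HypDel item. -/

/-- Tree certification: `QuotientReciprocityDescent` = tree `HeckeQuotient.quotientReciprocityDescent` (p594805).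
[cite: Deligne1971TravauxShimura, (5.11.1)] -/
theorem tree_quotientReciprocityDescent : QuotientReciprocityDescent :=
  Literature.AlgebraicGeometry.ShimuraVarieties.UnitaryCanonicalModel.HeckeQuotient.quotientReciprocityDescent

/-- Tree certification: `HeckeQuotientDescentOver` = tree `HeckeQuotient.heckeQuotientDescentOver` (p594805).
[cite: Deligne1971TravauxShimura, (5.11.1)] -/
theorem tree_heckeQuotientDescentOver : HeckeQuotientDescentOver :=
  Literature.AlgebraicGeometry.ShimuraVarieties.UnitaryCanonicalModel.HeckeQuotient.heckeQuotientDescentOver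

/-- Tree certification: `HeckeQuotientDescent` = tree `HeckeQuotient.heckeQuotientDescent` (p594805).
[cite: Deligne1971TravauxShimura, (5.11.1)] -/
theorem tree_heckeQuotientDescent : HeckeQuotientDescent :=
  Literature.AlgebraicGeometry.ShimuraVarieties.UnitaryCanonicalModel.HeckeQuotient.heckeQuotientDescent

/-- Tree certification: `AuxQuotientDescent` = tree `HeckeQuotient.auxQuotientDescent` (p594805).
[cite: Deligne1971TravauxShimura, (5.11.1)] -/
theorem tree_auxQuotientDescent : AuxQuotientDescent :=
  Literature.AlgebraicGeometry.ShimuraVarieties.UnitaryCanonicalModel.HeckeQuotient.auxQuotientDescent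

/-- Tree certification: `GaloisLegDescent` = tree `HeckeQuotient.galoisLegDescent` (p594805).
[cite: Deligne1971TravauxShimura, (5.11.1)] [cite: Milne2005ShimuraVarieties, Def. 12.8 (62) p. 114] -/
theorem tree_galoisLegDescent : GaloisLegDescent :=
  Literature.AlgebraicGeometry.ShimuraVarieties.UnitaryCanonicalModel.HeckeQuotient.galoisLegDescent

/-- Tree certification: the F1-junction `galoisLegDescentOver_of_F1` = tree `HeckeQuotient.galoisLegDescentOver_of_F1`
(p594805; ref2: IDENTICAL, 1092 chars normalised) — here re-derived from the tree term, so the kernel agrees too.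
[cite: Deligne1971TravauxShimura, (5.11.1)] [cite: Milne2005ShimuraVarieties, Def. 12.8 (62) p. 114] -/
theorem tree_galoisLegDescentOver_of_F1 (hF1 : Aux.canonicalModel_exists_printed) :
    ∀ (L : Type) [Field L] [NumberField L] [IsCMField L] (H : Matrix (Fin 3) (Fin 3) L) (τ : L →+* ℂ)
      (T : GL (Fin 3) ℂ) (hT : formCongr (starRingEnd ℂ) T (H.map τ) = BallModel.J),
      (∀ τ' : L →+* ℂ, InfinitePlace.mk τ' ≠ InfinitePlace.mk τ → (H.map τ').PosDef) →
      (∀ v : Fin 3 → L, UnitaryGroup.hermForm (cmConjRingHom L) H v v = 0 → v = 0) →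
      ∀ K₀ : C5.OpenCompactSubgroup ↥(finAdelic (↥(maximalRealSubfield L)) L (IsCMField.complexConj L) 3 H),
        (∀ g : finAdelic (↥(maximalRealSubfield L)) L (IsCMField.complexConj L) 3 H,
          ∀ γ ∈ arithmeticLevel (↥(maximalRealSubfield L)) L (IsCMField.complexConj L) 3 H
            (K₀.1.map (MulAut.conj g).toMonoidHom), IsOfFinOrder γ → γ = 1) →
        ∀ (Sc : ComplexRecordSystem L H τ T hT K₀) (Φ : CMType L), Aux.IsAdapted L Φ τ →
          Aux.HasSmallReflex L Φ τ →
          ∀ (L₀ : C5.OpenCompactSubgroup ↥(Aux.torusFinAdelic L)) [Finite (Aux.classGroup L L₀)],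
            ∃ (M : C5.SmallLevel K₀ ⥤ SchemeOver ↥(Aux.reflexField L Φ τ))
              (e' : (M ⋙ Motives.baseChange ↥(Aux.reflexField L Φ τ) ℂ) ≅ Sc.Mc),
              IsCanonicalDescentOver Sc (algebraMap ↥(Aux.reflexField L Φ τ) ℂ) M e' :=
  Literature.AlgebraicGeometry.ShimuraVarieties.UnitaryCanonicalModel.HeckeQuotient.galoisLegDescentOver_of_F1 hF1


/-! ### §12. (v8) ALL STUBS CLOSED — the final B-side heads modulo the two printed citations F1 and g5 only. -/

/-- **FINAL B-SIDE HEAD (sorry-free; hypotheses = the printed citations F1 and g5 BY NAME, nothing else)**: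
for every hDel datum (F1 side conditions), EVERY adapted CM type `Φ` and EVERY open compact `L₀ ≤ T₀(𝔸_f)`,
an `E♯ = E(L,Φ,τ)`-form of the complex record system with Milne (62) for `Aut(ℂ/E♯)` and `L`-idèles
(`IsCanonicalDescentOver`, A-plan1's shape).  Closed inputs by name: Q p592880, B p592797, Torsor p591996, R p593565,
(a′) p594845, (b′) p595207, (d′) p594589, g4 p592936.
[cite: Deligne1971TravauxShimura, (5.11.1)] [cite: Milne2005ShimuraVarieties, Def. 12.8 (62) p. 114] -/
theorem galoisLegDescentOver_final (hF1 : Aux.canonicalModel_exists_printed) (hg5 : Aux.finite_classGroup_printed) :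
    ∀ (L : Type) [Field L] [NumberField L] [IsCMField L] (H : Matrix (Fin 3) (Fin 3) L) (τ : L →+* ℂ)
      (T : GL (Fin 3) ℂ) (hT : formCongr (starRingEnd ℂ) T (H.map τ) = BallModel.J),
      (∀ τ' : L →+* ℂ, InfinitePlace.mk τ' ≠ InfinitePlace.mk τ → (H.map τ').PosDef) →
      (∀ v : Fin 3 → L, UnitaryGroup.hermForm (cmConjRingHom L) H v v = 0 → v = 0) →
      ∀ K₀ : C5.OpenCompactSubgroup ↥(finAdelic (↥(maximalRealSubfield L)) L (IsCMField.complexConj L) 3 H),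
        (∀ g : finAdelic (↥(maximalRealSubfield L)) L (IsCMField.complexConj L) 3 H,
          ∀ γ ∈ arithmeticLevel (↥(maximalRealSubfield L)) L (IsCMField.complexConj L) 3 H
            (K₀.1.map (MulAut.conj g).toMonoidHom), IsOfFinOrder γ → γ = 1) →
        ∀ (Sc : ComplexRecordSystem L H τ T hT K₀) (Φ : CMType L), Aux.IsAdapted L Φ τ →
          ∀ (L₀ : C5.OpenCompactSubgroup ↥(Aux.torusFinAdelic L)),
            ∃ (M : C5.SmallLevel K₀ ⥤ SchemeOver ↥(Aux.reflexField L Φ τ))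
              (e' : (M ⋙ Motives.baseChange ↥(Aux.reflexField L Φ τ) ℂ) ≅ Sc.Mc),
              IsCanonicalDescentOver Sc (algebraMap ↥(Aux.reflexField L Φ τ) ℂ) M e' :=
  galoisLegDescentOver_of_F1_g5_normFunctorial stub_artinNormFunctorial hF1 hg5

/-- The same with the `g5` finiteness as an INSTANCE binder instead of the named fact (for consumers that already
carry `[Finite (Aux.classGroup L L₀)]`, e.g. from B-p01's forthcoming `Aux.finite_classGroup_printed_holds`).
[cite: Deligne1971TravauxShimura, (5.11.1)] [cite: Milne2005ShimuraVarieties, Def. 12.8 (62) p. 114] -/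
theorem galoisLegDescentOver_final' (hF1 : Aux.canonicalModel_exists_printed) :
    ∀ (L : Type) [Field L] [NumberField L] [IsCMField L] (H : Matrix (Fin 3) (Fin 3) L) (τ : L →+* ℂ)
      (T : GL (Fin 3) ℂ) (hT : formCongr (starRingEnd ℂ) T (H.map τ) = BallModel.J),
      (∀ τ' : L →+* ℂ, InfinitePlace.mk τ' ≠ InfinitePlace.mk τ → (H.map τ').PosDef) →
      (∀ v : Fin 3 → L, UnitaryGroup.hermForm (cmConjRingHom L) H v v = 0 → v = 0) →
      ∀ K₀ : C5.OpenCompactSubgroup ↥(finAdelic (↥(maximalRealSubfield L)) L (IsCMField.complexConj L) 3 H),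
        (∀ g : finAdelic (↥(maximalRealSubfield L)) L (IsCMField.complexConj L) 3 H,
          ∀ γ ∈ arithmeticLevel (↥(maximalRealSubfield L)) L (IsCMField.complexConj L) 3 H
            (K₀.1.map (MulAut.conj g).toMonoidHom), IsOfFinOrder γ → γ = 1) →
        ∀ (Sc : ComplexRecordSystem L H τ T hT K₀) (Φ : CMType L), Aux.IsAdapted L Φ τ →
          ∀ (L₀ : C5.OpenCompactSubgroup ↥(Aux.torusFinAdelic L)) [Finite (Aux.classGroup L L₀)],
            ∃ (M : C5.SmallLevel K₀ ⥤ SchemeOver ↥(Aux.reflexField L Φ τ))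
              (e' : (M ⋙ Motives.baseChange ↥(Aux.reflexField L Φ τ) ℂ) ≅ Sc.Mc),
              IsCanonicalDescentOver Sc (algebraMap ↥(Aux.reflexField L Φ τ) ℂ) M e' :=
  galoisLegDescentOver_general_of_F1' stub_artinSurjectiveReflex stub_artinNormFunctorial hF1


/-! ### §13. (v8) g5 DISCHARGED (B-p01 p596070 `Aux.finite_classGroup_printed_holds`) and g6 LANDED (B-p15 p595606
`Aux.unitLevel`): the B-side Galois leg of HypDel is a THEOREM CONDITIONAL ON F1 ONLY, with no level parameter left. -/

/-- **B-SIDE DELIVERABLE OF RUNG B-I, GALOIS LEG — conditional on the ONE printed citation F1**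
(`Aux.canonicalModel_exists_printed`, Deligne (5.11)/(5.7) + RSZ/Liu C.3 canonical model of the auxiliary Hodge-type
datum): for every hDel datum `(L, H, τ, T, hT)` with the F1 side conditions, every neat `K₀`, every complex record
system `Sc` and EVERY `τ`-adapted CM type `Φ`, the system `Sc.Mc` has an `E♯ = E(L,Φ,τ)`-form `M` with Milne's
reciprocity (62) for all `σ ∈ Aut(ℂ/E♯)` and all Artin-correspondent `L`-idèles (`IsCanonicalDescentOver`).
Proof: `galoisLegDescentOver_final` at the unit level `L₀ := Aux.unitLevel L` (g6, p595606) with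
`hg5 := Aux.finite_classGroup_printed_holds` (g5 discharged, p596070).  Sorry-free; axioms = the Lean trio.
When `E♯ = τ(L)` (e.g. `L/ℚ` Galois) this is hDel's descent clause at `E = τL`; the base step `E♯ → τL` for
non-Galois `L` is the D-I2 residual (not in this file).
[cite: Deligne1971TravauxShimura, (5.11.1)] [cite: Milne2005ShimuraVarieties, Def. 12.8 (62) p. 114] -/
theorem galoisLegDescentOver_of_F1_only (hF1 : Aux.canonicalModel_exists_printed) :
    ∀ (L : Type) [Field L] [NumberField L] [IsCMField L] (H : Matrix (Fin 3) (Fin 3) L) (τ : L →+* ℂ)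
      (T : GL (Fin 3) ℂ) (hT : formCongr (starRingEnd ℂ) T (H.map τ) = BallModel.J),
      (∀ τ' : L →+* ℂ, InfinitePlace.mk τ' ≠ InfinitePlace.mk τ → (H.map τ').PosDef) →
      (∀ v : Fin 3 → L, UnitaryGroup.hermForm (cmConjRingHom L) H v v = 0 → v = 0) →
      ∀ K₀ : C5.OpenCompactSubgroup ↥(finAdelic (↥(maximalRealSubfield L)) L (IsCMField.complexConj L) 3 H),
        (∀ g : finAdelic (↥(maximalRealSubfield L)) L (IsCMField.complexConj L) 3 H,
          ∀ γ ∈ arithmeticLevel (↥(maximalRealSubfield L)) L (IsCMField.complexConj L) 3 H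
            (K₀.1.map (MulAut.conj g).toMonoidHom), IsOfFinOrder γ → γ = 1) →
        ∀ (Sc : ComplexRecordSystem L H τ T hT K₀) (Φ : CMType L), Aux.IsAdapted L Φ τ →
            ∃ (M : C5.SmallLevel K₀ ⥤ SchemeOver ↥(Aux.reflexField L Φ τ))
              (e' : (M ⋙ Motives.baseChange ↥(Aux.reflexField L Φ τ) ℂ) ≅ Sc.Mc),
              IsCanonicalDescentOver Sc (algebraMap ↥(Aux.reflexField L Φ τ) ℂ) M e' := by
  intro L _ _ _ H τ T hfr hpos han K₀ hneat Sc Φ hΦ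
  exact galoisLegDescentOver_final hF1 Aux.finite_classGroup_printed_holds L H τ T hfr hpos han K₀ hneat Sc Φ hΦ
    (Aux.unitLevel L)


/-! ### §14. (v9) TREE CERTIFICATION of A-p05's landing `UnitaryAuxiliaryHeckeQuotientDescentGeneral.lean` (p596683):
the general-`Φ` heads of §8/§12/§13 re-proved BY NAME from the tree — so EVERY head of this skeleton now has a tree twin the
kernel agrees with, and A-side seats cite `UnitaryCanonicalModel.HeckeQuotient.galoisLegDescentOver_of_F1_only` directly. -/

/-- Tree certification: `galoisLegDescentOver_final` = tree `HeckeQuotient.galoisLegDescentOver_final` (p596683).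
[cite: Deligne1971TravauxShimura, (5.11.1)] [cite: Milne2005ShimuraVarieties, Def. 12.8 (62) p. 114] -/
theorem tree_galoisLegDescentOver_final (hF1 : Aux.canonicalModel_exists_printed) (hg5 : Aux.finite_classGroup_printed) :
    ∀ (L : Type) [Field L] [NumberField L] [IsCMField L] (H : Matrix (Fin 3) (Fin 3) L) (τ : L →+* ℂ)
      (T : GL (Fin 3) ℂ) (hT : formCongr (starRingEnd ℂ) T (H.map τ) = BallModel.J),
      (∀ τ' : L →+* ℂ, InfinitePlace.mk τ' ≠ InfinitePlace.mk τ → (H.map τ').PosDef) →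
      (∀ v : Fin 3 → L, UnitaryGroup.hermForm (cmConjRingHom L) H v v = 0 → v = 0) →
      ∀ K₀ : C5.OpenCompactSubgroup ↥(finAdelic (↥(maximalRealSubfield L)) L (IsCMField.complexConj L) 3 H),
        (∀ g : finAdelic (↥(maximalRealSubfield L)) L (IsCMField.complexConj L) 3 H,
          ∀ γ ∈ arithmeticLevel (↥(maximalRealSubfield L)) L (IsCMField.complexConj L) 3 H
            (K₀.1.map (MulAut.conj g).toMonoidHom), IsOfFinOrder γ → γ = 1) →
        ∀ (Sc : ComplexRecordSystem L H τ T hT K₀) (Φ : CMType L), Aux.IsAdapted L Φ τ →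
          ∀ (L₀ : C5.OpenCompactSubgroup ↥(Aux.torusFinAdelic L)),
            ∃ (M : C5.SmallLevel K₀ ⥤ SchemeOver ↥(Aux.reflexField L Φ τ))
              (e' : (M ⋙ Motives.baseChange ↥(Aux.reflexField L Φ τ) ℂ) ≅ Sc.Mc),
              IsCanonicalDescentOver Sc (algebraMap ↥(Aux.reflexField L Φ τ) ℂ) M e' :=
  Literature.AlgebraicGeometry.ShimuraVarieties.UnitaryCanonicalModel.HeckeQuotient.galoisLegDescentOver_final hF1 hg5

/-- Tree certification: ★ `galoisLegDescentOver_of_F1_only` = tree `HeckeQuotient.galoisLegDescentOver_of_F1_only` (p596683)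
— the B-side Galois leg of HypDel conditional on F1 ONLY, now citable from the tree.
[cite: Deligne1971TravauxShimura, (5.11.1)] [cite: Milne2005ShimuraVarieties, Def. 12.8 (62) p. 114] -/
theorem tree_galoisLegDescentOver_of_F1_only (hF1 : Aux.canonicalModel_exists_printed) :
    ∀ (L : Type) [Field L] [NumberField L] [IsCMField L] (H : Matrix (Fin 3) (Fin 3) L) (τ : L →+* ℂ)
      (T : GL (Fin 3) ℂ) (hT : formCongr (starRingEnd ℂ) T (H.map τ) = BallModel.J),
      (∀ τ' : L →+* ℂ, InfinitePlace.mk τ' ≠ InfinitePlace.mk τ → (H.map τ').PosDef) →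
      (∀ v : Fin 3 → L, UnitaryGroup.hermForm (cmConjRingHom L) H v v = 0 → v = 0) →
      ∀ K₀ : C5.OpenCompactSubgroup ↥(finAdelic (↥(maximalRealSubfield L)) L (IsCMField.complexConj L) 3 H),
        (∀ g : finAdelic (↥(maximalRealSubfield L)) L (IsCMField.complexConj L) 3 H,
          ∀ γ ∈ arithmeticLevel (↥(maximalRealSubfield L)) L (IsCMField.complexConj L) 3 H
            (K₀.1.map (MulAut.conj g).toMonoidHom), IsOfFinOrder γ → γ = 1) →
        ∀ (Sc : ComplexRecordSystem L H τ T hT K₀) (Φ : CMType L), Aux.IsAdapted L Φ τ →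
            ∃ (M : C5.SmallLevel K₀ ⥤ SchemeOver ↥(Aux.reflexField L Φ τ))
              (e' : (M ⋙ Motives.baseChange ↥(Aux.reflexField L Φ τ) ℂ) ≅ Sc.Mc),
              IsCanonicalDescentOver Sc (algebraMap ↥(Aux.reflexField L Φ τ) ℂ) M e' :=
  Literature.AlgebraicGeometry.ShimuraVarieties.UnitaryCanonicalModel.HeckeQuotient.galoisLegDescentOver_of_F1_only hF1


/-! ### §15. (v9) THE REGISTERED COMPOSITION INTO THE CRUX `HDel` (stmt-HodgeConjecture-24835; STMT-IDS 02:33:00Z)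
`HDel` (= `PrintedCitationHypotheses.HypDel` = `UnitaryCanonicalModel.canonicalModel_exists_printed`, kernel-equivalent to
`canonicalModel_exists_form` by `canonicalModel_exists_printed_iff_form`) follows from EXACTLY TWO registered stubs — the two
residuals every B-plan2 report names — and everything else in this file is proved:
* `stub_F1` — the rung-0 printed citation `Aux.canonicalModel_exists_printed` (canonical model of the auxiliary Hodge-type datum
  `Sh(G̃, X̃)` over `E♯`; [Deligne 1979, 2.3.1] + [Kottwitz 1992, §5/§8]); «cite, do not attack» tonight;
* `stub_nonGaloisBaseDescent` — the D-I2 / TIER-G base step IN B-CURRENCY: for a NON-Galois CM field `L`, models over the reflex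
  composita `E♯(Φ) = E(Φ)·τ(L)` for EVERY `τ`-adapted CM type `Φ` (each with reciprocity `IsCanonicalDescentOver` — exactly the output
  of `galoisLegDescentOver_of_F1_only`) descend to ONE model over `L` along `τ` with reciprocity (62) (`IsCanonicalDescentAt`).
  The Galois case needs no stub: it is A-p06's tree theorem `HypDel.galoisCase_of_F1` (p596634), itself built on this chain
  (`HeckeQuotient.galoisLegDescentOver_of_F1`) + `reflexDescent_of_isGalois`.
Why this cut (vs A-plan1's `a1_reflex_compositum` line on the same crux, whose residual `stub_reflexDescent` starts from «∃ Φ and models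
over every E ⊇ τ(L) ∪ traceField Φ»): the B-currency hypothesis is the ∀-Φ family over the SPECIFIC composita `E♯(Φ)` with the Hecke
action and reciprocity already in place — the shape a descent-by-intersection / uniqueness argument consumes ([Deligne 1971, Prop. 5.10
uniqueness of canonical models] + Galois descent of the base along `E♯(Φ) ⊇ ⋂_Φ E♯(Φ) ⊇ τ(L)`; the gap `⋂_Φ E♯(Φ) ⊋ τ(L)` of
[Liu 2021, Rem. C.15] is where it can stall — census it first; the banked `Lines/b1-uniqueness.lean` is the typed uniqueness input). -/

/- v12/v12b (K-TWIST cut of record): the v3–v11 registered stub `stub_F1 : Aux.canonicalModel_exists_printed` (printed citation I-1,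
[Deligne 1979] 2.3.1 for the auxiliary Hodge-type datum with `M = L`) LEFT THE LEAF SET in v12 — under the K-twist it is the instance
`(M, j, E) = (L, id, E♯(Φ))` of I-1′ `Aux.canonicalModel_exists_ext_printed`; since v12b the NAME is a THEOREM of §18
(`stub_F1 := Aux.canonicalModel_exists_printed_of_ext stub_F1ext`, B-typ03 ★ p609239), so every v3–v11 reference resolves again.
Every theorem of §§13–17 that consumed it keeps it as the HYPOTHESIS `(hF1 : Aux.canonicalModel_exists_printed)`; nothing below is
weakened.  [cite: Deligne1979ShimuraVarieties, 2.3.1 and 2.3.10] -/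

/-- **`NonGaloisBaseDescent` (the v9 residual, kept as a DEFINITION only — superseded as a stub by the strictly weaker
`NoSmallReflexBaseDescent` below, see `noSmallReflexBaseDescent_of_nonGaloisBaseDescent`)**: for a non-Galois CM field `L` and
every datum of `canonicalModel_exists_form` and complex record system `Sc`, IF for every `τ`-adapted CM type `Φ` the system `Sc.Mc`
has a model over the reflex compositum `E♯(Φ) = Aux.reflexField L Φ τ` with reciprocity at the diagonal special pairs
(`IsCanonicalDescentOver` along `algebraMap E♯ ℂ`), THEN it has a model over `L` along `τ` with reciprocity (62) (`IsCanonicalDescentAt`).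
[cite: Deligne1979ShimuraVarieties, Cor. 2.7.21 (PDF pp. 51–52 of Milne's translation)] [cite: Deligne1971TravauxShimura, Prop. 5.10 p. 157]
[cite: Milne2005ShimuraVarieties, Thm. 14.15–Rem. 14.17 pp. 127–128] [cite: Liu2021, Rem. C.15] -/
def NonGaloisBaseDescent : Prop :=
  ∀ (L : Type) [Field L] [NumberField L] [IsCMField L], ¬ IsGalois ℚ L →
    ∀ (H : Matrix (Fin 3) (Fin 3) L) (τ : L →+* ℂ)
      (T : GL (Fin 3) ℂ) (hT : formCongr (starRingEnd ℂ) T (H.map τ) = BallModel.J),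
      (∀ τ' : L →+* ℂ, InfinitePlace.mk τ' ≠ InfinitePlace.mk τ → (H.map τ').PosDef) →
      (∀ v : Fin 3 → L, UnitaryGroup.hermForm (cmConjRingHom L) H v v = 0 → v = 0) →
      ∀ K₀ : C5.OpenCompactSubgroup ↥(finAdelic (↥(maximalRealSubfield L)) L (IsCMField.complexConj L) 3 H),
        (∀ g : finAdelic (↥(maximalRealSubfield L)) L (IsCMField.complexConj L) 3 H,
          ∀ γ ∈ arithmeticLevel (↥(maximalRealSubfield L)) L (IsCMField.complexConj L) 3 H
            (K₀.1.map (MulAut.conj g).toMonoidHom), IsOfFinOrder γ → γ = 1) →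
        ∀ Sc : ComplexRecordSystem L H τ T hT K₀,
          (∀ Φ : CMType L, Aux.IsAdapted L Φ τ →
            ∃ (M : C5.SmallLevel K₀ ⥤ SchemeOver ↥(Aux.reflexField L Φ τ))
              (e' : (M ⋙ Motives.baseChange ↥(Aux.reflexField L Φ τ) ℂ) ≅ Sc.Mc),
              IsCanonicalDescentOver Sc (algebraMap ↥(Aux.reflexField L Φ τ) ℂ) M e') →
          ∃ (M : C5.SmallLevel K₀ ⥤ SchemeOver L) (e : (M ⋙ Motives.baseChangeHom τ) ≅ Sc.Mc),
            IsCanonicalDescentAt Sc M e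

/-! ## 16. v10 — THE SMALL-REFLEX CASES ARE PROVED; the residual is re-cut to `NoSmallReflexBaseDescent`

The Galois hypothesis enters chain B at exactly ONE point: `Aux.HasSmallReflex L Φ τ` (`traceField Φ ≤ τ(L)`, i.e. `E♯(Φ) = τ(L)`,
`Aux.reflexField_eq_of_hasSmallReflex`).  It holds WITHOUT `IsGalois ℚ L` whenever `L` contains an imaginary quadratic field `K₀`
(`j : K₀ →+* L`): the CM type INDUCED from `{τ ∘ j}` is `τ`-adapted and its reflex-trace field is `(τ ∘ j)(K₀) ⊆ τ(L)`
([MilneCM2006] Prop. 1.18 (c), tree `traceField_inducedCMType_ringHom`; [Shimura1998] §8.4 Ex. (1), tree `CMTypeCount.traceField_single`).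
Hence `hDel♭ ⇐ F1` for EVERY CM field `L = L⁺·K₀` (Galois or not), and the honest D-I2 residual is the class of `(L, τ)` admitting NO
adapted CM type with small reflex. -/

section SmallReflex

open Literature.NumberTheory.ComplexMultiplication (traceField inducedCMType traceField_inducedCMType_ringHom)

/-- **The induced CM type `Ind_{K₀}^{L} {τ ∘ j}` is `τ`-adapted** (`τ ∘ j ∈ {τ ∘ j}`). [cite: Streng2010, Ch. I Def. 3.2]
[cite: Deligne1979ShimuraVarieties, 2.3.1] -/
theorem isAdapted_inducedCMType_single {K₀ : Type} [Field K₀] [NumberField K₀] [IsTotallyComplex K₀]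
    (h2 : Module.finrank ℚ K₀ = 2) {L : Type} [Field L] [NumberField L] [IsCMField L] (j : K₀ →+* L) (τ : L →+* ℂ) :
    Aux.IsAdapted L (inducedCMType j (Literature.NumberTheory.ComplexMultiplication.CMTypeCount.single h2 (τ.comp j))) τ := by
  unfold Aux.IsAdapted
  rw [Literature.NumberTheory.ComplexMultiplication.mem_inducedCMType_iff]
  exact Set.mem_singleton (τ.comp j)

/-- **The induced CM type `Ind_{K₀}^{L} {τ ∘ j}` has SMALL REFLEX: `E*(Φ) = ℚ(tr_Φ) = (τ ∘ j)(K₀) ⊆ τ(L)`** — Milne Prop. 1.18 (c)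
(`ℚ(tr_{Ψ^L}) = ℚ(tr_Ψ)`) and Shimura §8.4 Ex. (1) (the reflex of `(K₀; φ)` is `φ(K₀)`).
[cite: MilneCM2006, Ch. I §1 Prop. 1.18 (c)] [cite: Shimura1998, §8.4 Example (1)] [cite: Liu2021, App. C Rem. C.15 (p. 113)] -/
theorem hasSmallReflex_inducedCMType_single {K₀ : Type} [Field K₀] [NumberField K₀] [IsTotallyComplex K₀]
    (h2 : Module.finrank ℚ K₀ = 2) {L : Type} [Field L] [NumberField L] [IsCMField L] (j : K₀ →+* L) (τ : L →+* ℂ) :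
    Aux.HasSmallReflex L (inducedCMType j (Literature.NumberTheory.ComplexMultiplication.CMTypeCount.single h2 (τ.comp j))) τ := by
  unfold Aux.HasSmallReflex
  rw [traceField_inducedCMType_ringHom, Literature.NumberTheory.ComplexMultiplication.CMTypeCount.traceField_single]
  intro z hz
  obtain ⟨x, hx⟩ := AlgHom.mem_fieldRange.1 hz
  exact AlgHom.mem_fieldRange.2 ⟨j x, by simpa using hx⟩

/-- **A CM field containing an imaginary quadratic field has a `τ`-adapted CM type with small reflex**, for every `τ`.
[cite: MilneCM2006, Ch. I §1 Prop. 1.18 (c)] [cite: Shimura1998, §8.4 Example (1)] -/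
theorem exists_isAdapted_and_hasSmallReflex_of_quadraticSubfield {K₀ : Type} [Field K₀] [NumberField K₀] [IsTotallyComplex K₀]
    (h2 : Module.finrank ℚ K₀ = 2) {L : Type} [Field L] [NumberField L] [IsCMField L] (j : K₀ →+* L) (τ : L →+* ℂ) :
    ∃ Φ : CMType L, Aux.IsAdapted L Φ τ ∧ Aux.HasSmallReflex L Φ τ :=
  ⟨_, isAdapted_inducedCMType_single h2 j τ, hasSmallReflex_inducedCMType_single h2 j τ⟩

/-- **A Galois CM field has a `τ`-adapted CM type with small reflex** (every CM type has small reflex: `Aux.hasSmallReflex_of_isGalois`),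
so `NoSmallReflexBaseDescent` below is WEAKER than v9's `NonGaloisBaseDescent`. [cite: Shimura1998, §8.3 Prop. 28] -/
theorem exists_isAdapted_and_hasSmallReflex_of_isGalois (L : Type) [Field L] [NumberField L] [IsCMField L] [IsGalois ℚ L]
    (τ : L →+* ℂ) : ∃ Φ : CMType L, Aux.IsAdapted L Φ τ ∧ Aux.HasSmallReflex L Φ τ := by
  obtain ⟨Φ, hΦ⟩ := Aux.exists_isAdapted (L := L) τ
  exact ⟨Φ, hΦ, Aux.hasSmallReflex_of_isGalois L Φ τ⟩

/-- **`hDel♭ ⇐ F1` in the SMALL-REFLEX CASE** (supersedes the Galois case `HypDel.galoisCase_of_F1` p596634, same 6-line proof with the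
instance `IsGalois ℚ L` replaced by the hypothesis it was used for): if some `τ`-adapted CM type `Φ` has `E*(Φ) ⊆ τ(L)`, then every
datum of `canonicalModel_exists_form` has an `L`-form along `τ` with Shimura reciprocity (62) (`IsCanonicalDescentAt`).  Proof: chain B
(`galoisLegDescentOver_of_F1_only hF1`, §13) gives an `E♯(Φ)`-form with `IsCanonicalDescentOver`; the tower lemma
`forall_exists_form_of_reflexField` spreads it to every `E ⊇ τ(L)·E*(Φ)`; small reflex lets `E := L`, `ιE := τ`, where the `E`-formula
IS `IsCanonicalDescentAt` definitionally. [cite: Deligne1979ShimuraVarieties, 2.2.5 and 2.3.1]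
[cite: Deligne1971TravauxShimura, Prop. 5.11, Cor. 5.7] [cite: Liu2021, App. C Lem. C.14, Rem. C.15] -/
theorem smallReflexCase_of_F1 (hF1 : Aux.canonicalModel_exists_printed) :
    ∀ (L : Type) [Field L] [NumberField L] [IsCMField L] (H : Matrix (Fin 3) (Fin 3) L) (τ : L →+* ℂ)
      (T : GL (Fin 3) ℂ) (hT : formCongr (starRingEnd ℂ) T (H.map τ) = BallModel.J),
      (∀ τ' : L →+* ℂ, InfinitePlace.mk τ' ≠ InfinitePlace.mk τ → (H.map τ').PosDef) →
      (∀ v : Fin 3 → L, UnitaryGroup.hermForm (cmConjRingHom L) H v v = 0 → v = 0) →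
      ∀ K₀ : C5.OpenCompactSubgroup ↥(finAdelic (↥(maximalRealSubfield L)) L (IsCMField.complexConj L) 3 H),
        (∀ g : finAdelic (↥(maximalRealSubfield L)) L (IsCMField.complexConj L) 3 H,
          ∀ γ ∈ arithmeticLevel (↥(maximalRealSubfield L)) L (IsCMField.complexConj L) 3 H
            (K₀.1.map (MulAut.conj g).toMonoidHom), IsOfFinOrder γ → γ = 1) →
        ∀ Sc : ComplexRecordSystem L H τ T hT K₀,
          (∃ Φ : CMType L, Aux.IsAdapted L Φ τ ∧ Aux.HasSmallReflex L Φ τ) →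
          ∃ (M : C5.SmallLevel K₀ ⥤ SchemeOver L) (e : (M ⋙ Motives.baseChangeHom τ) ≅ Sc.Mc),
            IsCanonicalDescentAt Sc M e := by
  intro L _ _ _ H τ T hT hpos hanis K₀ htf Sc hsm
  obtain ⟨Φ, hΦ, hsmall⟩ := hsm
  obtain ⟨M₁, e₁, h₁⟩ := galoisLegDescentOver_of_F1_only hF1 L H τ T hT hpos hanis K₀ htf Sc Φ hΦ
  have hE : (traceField Φ : Set ℂ) ⊆ Set.range τ := by
    intro x hx
    obtain ⟨y, hy⟩ := AlgHom.mem_fieldRange.1 (hsmall hx)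
    exact ⟨y, by simpa using hy⟩
  obtain ⟨M, e, hrec⟩ := forall_exists_form_of_reflexField Φ Sc M₁ e₁ h₁ L τ subset_rfl hE
  exact ⟨M, e, hrec⟩

/-- **`hDel♭ ⇐ F1` for every CM field containing an imaginary quadratic field `K₀`** (`L = L⁺·K₀`, Galois over `ℚ` or not — the
whole «unitary group relative to `L/L⁺` coming from `K₀`» family). [cite: Deligne1979ShimuraVarieties, 2.3.1]
[cite: MilneCM2006, Ch. I §1 Prop. 1.18 (c)] [cite: Liu2021, App. C Rem. C.15] -/
theorem quadraticSubfieldCase_of_F1 (hF1 : Aux.canonicalModel_exists_printed) {K₀ : Type} [Field K₀] [NumberField K₀]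
    [IsTotallyComplex K₀] (h2 : Module.finrank ℚ K₀ = 2) :
    ∀ (L : Type) [Field L] [NumberField L] [IsCMField L] (j : K₀ →+* L) (H : Matrix (Fin 3) (Fin 3) L) (τ : L →+* ℂ)
      (T : GL (Fin 3) ℂ) (hT : formCongr (starRingEnd ℂ) T (H.map τ) = BallModel.J),
      (∀ τ' : L →+* ℂ, InfinitePlace.mk τ' ≠ InfinitePlace.mk τ → (H.map τ').PosDef) →
      (∀ v : Fin 3 → L, UnitaryGroup.hermForm (cmConjRingHom L) H v v = 0 → v = 0) →
      ∀ K₀ : C5.OpenCompactSubgroup ↥(finAdelic (↥(maximalRealSubfield L)) L (IsCMField.complexConj L) 3 H),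
        (∀ g : finAdelic (↥(maximalRealSubfield L)) L (IsCMField.complexConj L) 3 H,
          ∀ γ ∈ arithmeticLevel (↥(maximalRealSubfield L)) L (IsCMField.complexConj L) 3 H
            (K₀.1.map (MulAut.conj g).toMonoidHom), IsOfFinOrder γ → γ = 1) →
        ∀ Sc : ComplexRecordSystem L H τ T hT K₀,
          ∃ (M : C5.SmallLevel K₀ ⥤ SchemeOver L) (e : (M ⋙ Motives.baseChangeHom τ) ≅ Sc.Mc),
            IsCanonicalDescentAt Sc M e :=
  fun L _ _ _ j H τ T hT hpos hanis K₀ htf Sc =>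
    smallReflexCase_of_F1 hF1 L H τ T hT hpos hanis K₀ htf Sc (exists_isAdapted_and_hasSmallReflex_of_quadraticSubfield h2 j τ)

end SmallReflex

/-- **`NoSmallReflexBaseDescent` (the re-cut D-I2 / TIER-G residual, v10)**: for a CM field `L` and frame embedding `τ` such that NO
`τ`-adapted CM type has small reflex (`E*(Φ) ⊄ τ(L)` for all adapted `Φ`; this forces `L` non-Galois AND without imaginary quadratic
subfield), and every datum of `canonicalModel_exists_form` / complex record system `Sc`: IF for every adapted `Φ` the system `Sc.Mc` has a
model over `E♯(Φ)` with reciprocity (`IsCanonicalDescentOver`), THEN it has a model over `L` along `τ` with reciprocity (62).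
[cite: Deligne1979ShimuraVarieties, Cor. 2.7.21 (PDF pp. 51–52 of Milne's translation)] [cite: Deligne1971TravauxShimura, Prop. 5.10 p. 157]
[cite: Milne2005ShimuraVarieties, Thm. 14.15–Rem. 14.17 pp. 127–128] [cite: Liu2021, Rem. C.15] -/
def NoSmallReflexBaseDescent : Prop :=
  ∀ (L : Type) [Field L] [NumberField L] [IsCMField L] (H : Matrix (Fin 3) (Fin 3) L) (τ : L →+* ℂ)
      (T : GL (Fin 3) ℂ) (hT : formCongr (starRingEnd ℂ) T (H.map τ) = BallModel.J),
      (∀ τ' : L →+* ℂ, InfinitePlace.mk τ' ≠ InfinitePlace.mk τ → (H.map τ').PosDef) →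
      (∀ v : Fin 3 → L, UnitaryGroup.hermForm (cmConjRingHom L) H v v = 0 → v = 0) →
      ∀ K₀ : C5.OpenCompactSubgroup ↥(finAdelic (↥(maximalRealSubfield L)) L (IsCMField.complexConj L) 3 H),
        (∀ g : finAdelic (↥(maximalRealSubfield L)) L (IsCMField.complexConj L) 3 H,
          ∀ γ ∈ arithmeticLevel (↥(maximalRealSubfield L)) L (IsCMField.complexConj L) 3 H
            (K₀.1.map (MulAut.conj g).toMonoidHom), IsOfFinOrder γ → γ = 1) →
        ∀ Sc : ComplexRecordSystem L H τ T hT K₀,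
          (∀ Φ : CMType L, Aux.IsAdapted L Φ τ → ¬ Aux.HasSmallReflex L Φ τ) →
          (∀ Φ : CMType L, Aux.IsAdapted L Φ τ →
            ∃ (M : C5.SmallLevel K₀ ⥤ SchemeOver ↥(Aux.reflexField L Φ τ))
              (e' : (M ⋙ Motives.baseChange ↥(Aux.reflexField L Φ τ) ℂ) ≅ Sc.Mc),
              IsCanonicalDescentOver Sc (algebraMap ↥(Aux.reflexField L Φ τ) ℂ) M e') →
          ∃ (M : C5.SmallLevel K₀ ⥤ SchemeOver L) (e : (M ⋙ Motives.baseChangeHom τ) ≅ Sc.Mc),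
            IsCanonicalDescentAt Sc M e

/-- **Monotonicity: the v9 residual implies the v10 residual** (no adapted small-reflex type ⇒ `L` is not Galois, by
`exists_isAdapted_and_hasSmallReflex_of_isGalois`), so re-cutting the stub loses nothing. [cite: Shimura1998, §8.3 Prop. 28] -/
theorem noSmallReflexBaseDescent_of_nonGaloisBaseDescent (hN : NonGaloisBaseDescent) : NoSmallReflexBaseDescent := by
  intro L _ _ _ H τ T hT hpos hanis K₀ htf Sc hno hover
  have hL : ¬ IsGalois ℚ L := by
    intro hG
    obtain ⟨Φ, hΦ, hs⟩ := exists_isAdapted_and_hasSmallReflex_of_isGalois L τ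
    exact hno Φ hΦ hs
  exact hN L hL H τ T hT hpos hanis K₀ htf Sc hover

/-! ## 17. v11 — THE CENSUS RE-CUT (director g2 ruling 2026-08-28T05:14:58Z «hDel stays AT τ(L); GO by census»; B-typ04 SPEC-I7 (i);
## B-plan1 05:08:55Z; binder owner B-plan2): `stub_noSmallReflexBaseDescent` is CLOSED IN KERNEL from row I-6 + `NonCensusBaseDescent`

Two tree inputs landed after v10b decide the shape of the residual.  ROW I-6 (`UnitaryCanonicalModel.descentToIntersection_printed`,
B-typ04 p604396 = [Deligne1971TravauxShimura] Prop. 5.10 «descente à l'intersection» READ AT the unitary tower; a D-0014 named fact, rung 0)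
descends the models-with-reciprocity over the reflex composita `E♯(Φ)`, `Φ ∋ τ`, to their INTERSECTION `E∩ := ⨅_{Φ ∋ τ} E♯(Φ)`, and
B-typ04's theorem `Summit.HodgeConjecture.CorCM.HypDel.isCanonicalDescentAt_of_descentToIntersection_of_census` (p605793) transports that
model to `τ(L)` exactly when the CENSUS INCLUSION `(E∩ : Set ℂ) ⊆ range τ` holds.  The census inclusion is NOT a consequence of «no
adapted `Φ` has small reflex»: for ODD `d = [L⁺:ℚ]` it even FAILS for every such `(L, τ)` (B-typ04 p606043
`not_iInf_reflexField_le_range_of_odd_of_forall_not_hasSmallReflex`: `u_Φ(x)² = (-1)^d N(x)/τ(x)²`), while for EVEN `d` both happen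
(every non-Galois quartic CM field has `hno ∧ ¬census`; octic examples with census exist).  So the exhaustive split is BY CENSUS, not
by parity and not by «small reflex»:

* census holds  ⇒ PROVED: I-6 (`stub_I6`, a printed citation) + p605793;
* census fails  ⇒ the new registered residual `stub_nonCensusBaseDescent : NonCensusBaseDescent` (R_nc of SPEC-I7: the v10 body with
  the binder `hno` REPLACED by `¬ census`; `¬ census ⇒ hno` by `iInf_reflexField_le_of_hasSmallReflex`, so nothing is lost:
  `nonCensusBaseDescent_of_noSmallReflexBaseDescent`).

In print R_nc is INSIDE Deligne's abelian-type existence theorem and is NOT a descent from the `E♯(Φ)` ([Deligne1979ShimuraVarieties]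
Prop. 2.3.10: vary the auxiliary CM extension `K/L⁺`, reflex `E(G₁, X₁) = τ(L)·E(K, h_T)`; 2.7.13, Cor. 2.7.18–2.7.19 (ii): descent to
`E` from models over finite `F′` linearly disjoint from any prescribed `F`; Thm. 2.7.20 (a), Cor. 2.7.21) — size L/XL, residual by design
(TIER-G; rows I-7a/b/c of SPEC-I7 NOT opened tonight).  Registered stubs after v11: `stub_F1`, `stub_I6` (printed citations, rung 0) and
`stub_nonCensusBaseDescent` (the one mathematical residual); head `HDel_proof` unchanged in type.  The v10 name
`stub_noSmallReflexBaseDescent` is kept as a THEOREM (proved from the v11 stubs) so every v10 reference still resolves.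
HC_CM is proved only modulo the 7 printed citations until rung 0 closes. -/

/-- **v13: I-6 CLOSED BY NAME — `stub_I6` is a THEOREM** (:= `descentToIntersection_printed_holds`, the I-6 `_holds` crew under A-p08: A-p03 D4 ★ p616273 `UnitaryCanonicalModelDescentToIntersectionHolds.lean` over A-p08 D0–D2, A-p16/A-p05 D3b, B-typ01 D3a, A-p07 Λ/Tw, A-p02 P0/P5, A-p11; [Deligne 1971] Prop. 5.10 by its printed proof: Cor. 5.5 uniqueness + Lemme 5.10.1 Galois descent of the compositum form).  From v13 on the ONLY registered stub of this workfile is `stub_F1ext` (printed citation I-1′).  The v11 docstring follows.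

**stub `stub_I6` (rung 0 — PRINTED CITATION, row I-6; not a target tonight)**: Deligne's descent of weakly canonical models to the
INTERSECTION of their base fields, read at the unitary tower of `hDel` (`UnitaryCanonicalModel.descentToIntersection_printed`, B-typ04
p604396; deviations W1/W2/S1 declared in its docstring).  Strategy hint: none — cite; a `_holds` proof re-runs [Deligne 1971] 5.5 uniqueness
(tree row I-4 `canonicalModel_unique_printed`, A-p07's `_holds` in flight) + Lemme 5.10.1 (Galois descent of the BASE of a quasi-projective
scheme along a finite Galois extension — EFFECTIVE descent, absent from Mathlib).  Why it might fail: a printed theorem; only the read-at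
caveat S1 (reciprocity at the diagonal special pairs instead of «faiblement canonique») could make the typed `Prop` stronger than print —
then repaired by re-typing, never false mathematics.
[cite: Deligne1971TravauxShimura, Prop. 5.10 with Lemme 5.10.1 pp. 157–158; Cor. 5.5 p. 156] [cite: Milne2005ShimuraVarieties, Thm. 13.7] -/
theorem stub_I6 : descentToIntersection_printed :=
  Literature.AlgebraicGeometry.ShimuraVarieties.UnitaryCanonicalModel.descentToIntersection_printed_holds

/-- **`NonCensusBaseDescent` (the v11 residual R_nc, census edition; SPEC-I7 (i) verbatim).**  For an `hDel` datum `(L, H, τ, T, hT)`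
(signature `(2,1)` at `τ`, definite elsewhere, anisotropic), neat small levels under `K₀`, and a complex record system `Sc` with
models-with-reciprocity over EVERY adapted reflex compositum `E♯(Φ)` (`IsCanonicalDescentOver`, the output of §13
`galoisLegDescentOver_of_F1_only`), IF the census inclusion FAILS (`E∩ := ⨅_{Φ ∋ τ} E♯(Φ) ⊄ τ(L)`; this forces «no adapted `Φ` has small
reflex», holds for every odd `[L⁺:ℚ]` in that class by
`Summit.HodgeConjecture.CorCM.HypDel.not_iInf_reflexField_le_range_of_odd_of_forall_not_hasSmallReflex`, and e.g. for all non-Galois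
quartic CM `L`), THEN `Sc` has an `L`-form along `τ` with reciprocity (62) (`IsCanonicalDescentAt`).  In print this is INSIDE Deligne's
abelian-type existence theorem, NOT a descent from the `E♯(Φ)`: [Deligne 1979] Prop. 2.3.10 (vary the auxiliary CM extension `K/L⁺`,
reflex `E(G₁,X₁) = τ(L)·E(K,h_T)`) + 2.3.1 + 2.7.13 / Cor. 2.7.18 + Cor. 2.7.19 (ii) (descent to `E` from models over finite `F′`
linearly disjoint from any prescribed `F`; cf. [Deligne 1971] 5.5, 5.10, 5.10.2) ⇒ Thm. 2.7.20 (a) / Cor. 2.7.21.  Residual by design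
(TIER-G); source note `typers/SPEC-I7.md`.
[cite: Deligne1979ShimuraVarieties, Prop. 2.3.10 (PDF p. 32), 2.7.13 and Cor. 2.7.18–2.7.19 (ii) (pp. 49–51), Thm. 2.7.20 (a) and Cor. 2.7.21 (pp. 51–52) of Milne's translation]
[cite: Deligne1971TravauxShimura, Cor. 5.5 p. 156, Prop. 5.10 with 5.10.1–5.10.2 pp. 157–158] [cite: Liu2021, App. C Rem. C.15 (p. 113)] -/
def NonCensusBaseDescent : Prop :=
  ∀ (L : Type) [Field L] [NumberField L] [IsCMField L] (H : Matrix (Fin 3) (Fin 3) L) (τ : L →+* ℂ)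
      (T : GL (Fin 3) ℂ) (hT : formCongr (starRingEnd ℂ) T (H.map τ) = BallModel.J),
      (∀ τ' : L →+* ℂ, InfinitePlace.mk τ' ≠ InfinitePlace.mk τ → (H.map τ').PosDef) →
      (∀ v : Fin 3 → L, UnitaryGroup.hermForm (cmConjRingHom L) H v v = 0 → v = 0) →
      ∀ K₀ : C5.OpenCompactSubgroup ↥(finAdelic (↥(maximalRealSubfield L)) L (IsCMField.complexConj L) 3 H),
        (∀ g : finAdelic (↥(maximalRealSubfield L)) L (IsCMField.complexConj L) 3 H,
          ∀ γ ∈ arithmeticLevel (↥(maximalRealSubfield L)) L (IsCMField.complexConj L) 3 H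
            (K₀.1.map (MulAut.conj g).toMonoidHom), IsOfFinOrder γ → γ = 1) →
        ∀ Sc : ComplexRecordSystem L H τ T hT K₀,
          ¬ (((⨅ Φ : {Φ : CMType L // Aux.IsAdapted L Φ τ}, Aux.reflexField L Φ.1 τ : IntermediateField ℚ ℂ) : Set ℂ) ⊆
              Set.range τ) →
          (∀ Φ : CMType L, Aux.IsAdapted L Φ τ →
            ∃ (M : C5.SmallLevel K₀ ⥤ SchemeOver ↥(Aux.reflexField L Φ τ))
              (e' : (M ⋙ Motives.baseChange ↥(Aux.reflexField L Φ τ) ℂ) ≅ Sc.Mc),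
              IsCanonicalDescentOver Sc (algebraMap ↥(Aux.reflexField L Φ τ) ℂ) M e') →
          ∃ (M : C5.SmallLevel K₀ ⥤ SchemeOver L) (e : (M ⋙ Motives.baseChangeHom τ) ≅ Sc.Mc),
            IsCanonicalDescentAt Sc M e

/-- **Monotonicity: the v10 residual implies the v11 residual** — if the census inclusion fails then NO adapted `Φ` has small reflex
(contrapositive of `Summit.HodgeConjecture.CorCM.HypDel.iInf_reflexField_le_of_hasSmallReflex`: a small-reflex `Φ₀` gives
`E∩ ≤ E♯(Φ₀) = τ(L)`), so the re-cut replaces the stub by a WEAKER statement and loses nothing. [cite: Liu2021, App. C Rem. C.15 (p. 113)] -/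
theorem nonCensusBaseDescent_of_noSmallReflexBaseDescent (hN : NoSmallReflexBaseDescent) : NonCensusBaseDescent := by
  intro L _ _ _ H τ T hT hpos hanis K₀ htf Sc hnc hover
  exact hN L H τ T hT hpos hanis K₀ htf Sc
    (fun Φ hΦ hs => hnc (Summit.HodgeConjecture.CorCM.HypDel.iInf_reflexField_le_of_hasSmallReflex τ hΦ hs)) hover

/-- **THE CENSUS SPLIT (kernel-checked, v11): `I-6 → NonCensusBaseDescent → NoSmallReflexBaseDescent`.**  Per datum, `by_cases` on the
census inclusion `(⨅_{Φ ∋ τ} E♯(Φ) : Set ℂ) ⊆ range τ`: YES ⇒ B-typ04's `isCanonicalDescentAt_of_descentToIntersection_of_census h510`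
(p605793: I-6 gives a model over `E∩`, the tower lemma moves it along `E∩ ⊆ τ(L)`, and at base `(L, τ)` `IsCanonicalDescentOver` IS
`IsCanonicalDescentAt`); NO ⇒ the residual.  The v10 hypothesis «no adapted small reflex» is not even used (SPEC-I7 (i)).
[cite: Deligne1971TravauxShimura, Prop. 5.10 p. 157] [cite: Liu2021, App. C Rem. C.15 (p. 113)] -/
theorem noSmallReflexBaseDescent_of (h510 : descentToIntersection_printed) (hR : NonCensusBaseDescent) : NoSmallReflexBaseDescent := by
  intro L _ _ _ H τ T hT hpos hanis K₀ htf Sc _hno hover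
  by_cases hc : ((⨅ Φ : {Φ : CMType L // Aux.IsAdapted L Φ τ}, Aux.reflexField L Φ.1 τ : IntermediateField ℚ ℂ) : Set ℂ) ⊆
      Set.range τ
  · exact Summit.HodgeConjecture.CorCM.HypDel.isCanonicalDescentAt_of_descentToIntersection_of_census h510 L H τ T hT hpos hanis K₀
      htf Sc hc hover
  · exact hR L H τ T hT hpos hanis K₀ htf Sc hc hover

/-- **`OddNoSmallReflexBaseDescent` (R_odd of SPEC-I7 — the director's literal 04:47:38Z ask, recorded as a DEFINITION + corollary, not a
stub)**: the v10 residual restricted to ODD `[L⁺:ℚ]` — for such `L` with no adapted small-reflex type, models-with-reciprocity over every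
`E♯(Φ)` give an `L`-form along `τ` with reciprocity (62).  It is implied by R_nc (`oddNoSmallReflexBaseDescent_of`) because odd `d` and
«no small reflex» force `E∩ ⊄ τ(L)` (p606043), and it is NOT sufficient for `HDel` together with I-6 (even-`d` fields with `hno ∧ ¬census`
exist, e.g. every non-Galois quartic CM field) — which is why the registered residual is R_nc and not R_odd.
[cite: Liu2021, App. C Rem. C.15 (p. 113)] [cite: Shimura1998, §8.3 Prop. 28 and §8.4 Example (1)] [cite: Deligne1979ShimuraVarieties, Cor. 2.7.21] -/
def OddNoSmallReflexBaseDescent : Prop :=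
  ∀ (L : Type) [Field L] [NumberField L] [IsCMField L] (H : Matrix (Fin 3) (Fin 3) L) (τ : L →+* ℂ)
      (T : GL (Fin 3) ℂ) (hT : formCongr (starRingEnd ℂ) T (H.map τ) = BallModel.J),
      (∀ τ' : L →+* ℂ, InfinitePlace.mk τ' ≠ InfinitePlace.mk τ → (H.map τ').PosDef) →
      (∀ v : Fin 3 → L, UnitaryGroup.hermForm (cmConjRingHom L) H v v = 0 → v = 0) →
      ∀ K₀ : C5.OpenCompactSubgroup ↥(finAdelic (↥(maximalRealSubfield L)) L (IsCMField.complexConj L) 3 H),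
        (∀ g : finAdelic (↥(maximalRealSubfield L)) L (IsCMField.complexConj L) 3 H,
          ∀ γ ∈ arithmeticLevel (↥(maximalRealSubfield L)) L (IsCMField.complexConj L) 3 H
            (K₀.1.map (MulAut.conj g).toMonoidHom), IsOfFinOrder γ → γ = 1) →
        ∀ Sc : ComplexRecordSystem L H τ T hT K₀,
          Odd (Module.finrank ℚ ↥(maximalRealSubfield L)) →
          (∀ Φ : CMType L, Aux.IsAdapted L Φ τ → ¬ Aux.HasSmallReflex L Φ τ) →
          (∀ Φ : CMType L, Aux.IsAdapted L Φ τ →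
            ∃ (M : C5.SmallLevel K₀ ⥤ SchemeOver ↥(Aux.reflexField L Φ τ))
              (e' : (M ⋙ Motives.baseChange ↥(Aux.reflexField L Φ τ) ℂ) ≅ Sc.Mc),
              IsCanonicalDescentOver Sc (algebraMap ↥(Aux.reflexField L Φ τ) ℂ) M e') →
          ∃ (M : C5.SmallLevel K₀ ⥤ SchemeOver L) (e : (M ⋙ Motives.baseChangeHom τ) ≅ Sc.Mc),
            IsCanonicalDescentAt Sc M e

/-- **R_nc ⟹ R_odd** (p606043 `not_iInf_reflexField_le_range_of_odd_of_forall_not_hasSmallReflex`: for odd `[L⁺:ℚ]` and no adapted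
small-reflex type the census inclusion fails, so the residual applies).  Kernel record that the v11 residual still CONTAINS the whole
odd-degree part of the v10 residual (for sextic `L` nothing got easier; the gain of v11 is exactly the even-`d` census fields).
[cite: Liu2021, App. C Rem. C.15 (p. 113)] [cite: MilneCM2006, Ch. I §1 Prop. 1.18 (c)] -/
theorem oddNoSmallReflexBaseDescent_of (hR : NonCensusBaseDescent) : OddNoSmallReflexBaseDescent := by
  intro L _ _ _ H τ T hT hpos hanis K₀ htf Sc hodd hno hover
  exact hR L H τ T hT hpos hanis K₀ htf Sc
    (Summit.HodgeConjecture.CorCM.HypDel.not_iInf_reflexField_le_range_of_odd_of_forall_not_hasSmallReflex τ hodd hno) hover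


/-- **COMPOSITION (kernel-checked, v10; conclusion re-spelled in v11): `F1 → NoSmallReflexBaseDescent → HDel`** — concluding the
UNFOLDED statement `UnitaryCanonicalModel.canonicalModel_exists_printed` (`HCCMUnconditional.HDel` := `PrintedCitationHypotheses.HypDel`
:= this constant, definitionally), so that `HDel_proof` is the ONLY theorem of the file concluding the crux decl BY NAME (skeleton lint:
a crux-concluding theorem may take only registered stubs as hypotheses, and `NoSmallReflexBaseDescent` is no longer one in v11).
Proof: pass to the form by `canonicalModel_exists_printed_iff_form`, split on «∃ adapted Φ with small reflex»: YES ⇒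
`smallReflexCase_of_F1 hF1` (§16, PROVED; contains the Galois case and every `L ⊇ K₀` imaginary quadratic); NO ⇒ `hN` fed with
`galoisLegDescentOver_of_F1_only hF1` (§13) at every adapted `Φ`.
[cite: Deligne1979ShimuraVarieties, 2.2.5 and Cor. 2.7.21] [cite: Deligne1971TravauxShimura, (5.11.1)] -/
theorem HDel_of (hF1 : Aux.canonicalModel_exists_printed) (hN : NoSmallReflexBaseDescent) :
    UnitaryCanonicalModel.canonicalModel_exists_printed := by
  refine canonicalModel_exists_printed_iff_form.2 fun L _ _ _ H τ T hT hpos hanis K₀ htf Sc => ?_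
  by_cases h : ∃ Φ : CMType L, Aux.IsAdapted L Φ τ ∧ Aux.HasSmallReflex L Φ τ
  · exact smallReflexCase_of_F1 hF1 L H τ T hT hpos hanis K₀ htf Sc h
  · exact hN L H τ T hT hpos hanis K₀ htf Sc (fun Φ hΦ hs => h ⟨Φ, hΦ, hs⟩)
      (fun Φ hΦ => galoisLegDescentOver_of_F1_only hF1 L H τ T hT hpos hanis K₀ htf Sc Φ hΦ)

/-- **COMPOSITION (kernel-checked, v11): `F1 → I-6 → NonCensusBaseDescent → HDel`** — the v10 composition `HDel_of` fed with the
census split `noSmallReflexBaseDescent_of` (conclusion = `HDel` unfolded, as for `HDel_of`).  Case tree per datum `(L, τ)`: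
∃ adapted small-reflex `Φ` ⇒ §16 (`smallReflexCase_of_F1`, from F1 alone); else census holds ⇒ F1 (§13, models over every `E♯(Φ)`)
+ I-6 (descent to `E∩`) + p605793 (`E∩ ⊆ τ(L)`); else the residual R_nc.
[cite: Deligne1979ShimuraVarieties, 2.2.5 and Cor. 2.7.21] [cite: Deligne1971TravauxShimura, Prop. 5.10 and (5.11.1)] -/
theorem HDel_of_census (hF1 : Aux.canonicalModel_exists_printed) (h510 : descentToIntersection_printed) (hR : NonCensusBaseDescent) :
    UnitaryCanonicalModel.canonicalModel_exists_printed :=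
  HDel_of hF1 (noSmallReflexBaseDescent_of h510 hR)

/-! ### §18. v12 — THE K-TWIST CUT OF RECORD (A-p05 proposal 2026-08-28T05:27:30Z; B-typ04 verdict 05:33:54Z; director g2 RULING
05:35:20Z, batches 17/21): `HDel` for EVERY CM field `L` ⇐ {I-1′ F1-Ext, I-6} — Deligne's own device ([Deligne 1979] 2.3.9–2.3.10, type A)

THE MOVE.  The census line (§17) varies the CM TYPE `Φ` of `L` and is stopped, for `E∩ ⊄ τ(L)`, by the reflex-intersection obstruction
(p606043: an automorphism fixing `τ(L)` may swap the two embeddings of `L` above a compact place, and a CM type OF `L` must choose one of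
them).  The K-twist varies the AUXILIARY CM FIELD instead: for a prime (any `p > 0`) put `M = L(√-p)` (realised as the subfield
`E_p = τ(L)(i√p) ⊆ ℂ`, `j = τ` corestricted) with the «quadratic-twist» CM type `Φ_M = {ρ | ρ∘j = τ} ∪ {ρ | place(ρ∘j) ≠ place(τ), ρ(√-p) = i√p}`
(`Literature.NumberTheory.ComplexMultiplication.quadraticTwistCMType`, P1 ★ p607653): it contains BOTH lifts of each embedding above a
compact place, so the swap no longer matters and `E*(Φ_M) ≤ τ(L)(i√p)` (`traceField_quadraticTwistCMType_le`, Shimura Prop. 28).  The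
twisted auxiliary datum `(Res U(H) × T₀(M), X × {h_{Φ_M}})` is of Hodge type (adaptedness along `j`, `Aux.IsExtAdapted`), so the printed
citation I-1′ `Aux.canonicalModel_exists_ext_printed` ([Deligne 1979] 2.3.1 + 2.2.5, B-typ04 ★ p608274 — F1's J1 shape verbatim with
`(Φ, E♯(Φ)) ↦ (M, j, Φ_M, E)`) gives a weakly canonical model of the twisted tower over EVERY number field `E ⊇ τ(L)·E*(Φ_M)`, in
particular over `E_p`; the Hecke-quotient glue of §§0–15 run over the Ext carriers (P3, A-p05: `HeckeQuotientExt.exists_isCanonicalDescentOver_of_ext_printed`)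
turns it into an `E_p`-form of `Sc.Mc` with reciprocity (62); two integers `p, q` with `E_p ⊓ E_q ⊆ τ(L)` exist (P2, A-p06: all but finitely
many pairs, `[E_p : τ(L)] ≤ 2`); and row I-6 at the PAIR (`Summit.HodgeConjecture.CorCM.HypDel.isCanonicalDescentAt_of_descentToIntersection_of_pair`,
B-typ04 ★ p607258) descends to `τ(L)`.  No census, no parity, no Galois hypothesis, no infinite supply: the v11 residual R_nc
(`NonCensusBaseDescent`) is DISCHARGED below (`nonCensusBaseDescent_of_kTwist`), and `stub_nonCensusBaseDescent` /
`stub_noSmallReflexBaseDescent` are THEOREMS of this file from v12 on (names kept).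

REGISTERED STUBS after v13: `stub_F1ext` (printed citation I-1′) — the ONE rung-0 leaf of record, NOTHING ELSE (INVENTORY: «hDel ⇐ I-1′»);
`stub_I6` (printed citation I-6, §17) is a THEOREM by name since v13 (`descentToIntersection_printed_holds`, p616273).  Closed BY NAME in this §: P3 `extHeckeQuotientDescentOver_holds` := A-p05's
`HeckeQuotientExt.exists_isCanonicalDescentOver_of_ext_printed` (★ p608612); P2 `stub_twistFieldSupply` (the v12 temporary stub, now a
theorem) from A-p06's `QuadraticTwistCompositum` (★ p608990); I-1 `stub_F1` := `Aux.canonicalModel_exists_printed_of_ext stub_F1ext`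
(F1 retired in tree, B-typ03 ★ p609239).  `stub_F1` (I-1, `Aux.canonicalModel_exists_printed`) LEAVES the leaf set: under the K-twist it is the instance `M = L`, `j = id`,
`E = E♯(Φ)` of I-1′ (A-p06 `UnitaryAuxiliaryCanonicalModelOfExt.lean`, `Aux.canonicalModel_exists_printed_of_ext`), and every §13–§17
theorem that used it keeps it as the hypothesis `(hF1 : Aux.canonicalModel_exists_printed)` (the census line = the FALLBACK of record if the
Ext fact's Hodge-type bookkeeping were to fail ref2's print check — director kill switch 05:35:20Z).  State v13: sorries 1 = {`stub_F1ext`} — «hDel ⇐ I-1′».  HC_CM is proved only modulo the 7 printed citations until rung 0 closes. -/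

open Literature.NumberTheory.ComplexMultiplication (traceField quadraticTwistCMType mem_quadraticTwistCMType_of_comp_eq
  traceField_quadraticTwistCMType_le)

/-- **stub `stub_F1ext` (rung 0 — PRINTED CITATION I-1′, the existence leaf of record for `HDel` from v12 on)**: the weakly canonical
model, over every number field `E ⊇ τ(L)·E*(Φ)`, of the TWISTED auxiliary Hodge-type datum `(Res U(H) × T₀(M), X × {h_Φ})` for a CM field
`M ⊇ L` (along `j`) and an `L/τ`-adapted CM type `Φ` of `M`, with the torus-factor Hecke action and Shimura reciprocity (62) at the diagonal
special pairs — `Aux.canonicalModel_exists_ext_printed` (B-typ04 ★ p608274; F1's J1 shape verbatim with `(Φ, E♯(Φ)) ↦ (M, j, Φ, E)`;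
weaker than print W1–W3, see its docstring).  Strategy hint: none — cite; its kernel proof is [Deligne 1979] §2.3 for Hodge type (rung 0).
Why it might fail: a printed theorem; only a typing slip in the Hodge-type bookkeeping (adaptedness along `j` ⇒ type `{(-1,0),(0,-1)}` on
`V ⊗_{L,j} M`; B-plan2 hand check 05:53:03Z (a)–(c), ref2 print audit pending) could make the typed `Prop` differ from the print — then
re-typed, never false mathematics; kill switch = the §17 census line with R_nc.
[cite: Deligne1979ShimuraVarieties, Criterion 2.3.1 and 2.2.4–2.2.5 (PDF p. 29), 2.3.9–Prop. 2.3.10 (PDF p. 32) of Milne's translation]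
[cite: Milne2005ShimuraVarieties, Def. 12.8 (62) p. 114 and §14 pp. 126–127] [cite: Liu2021, App. C §C.3 pp. 113–114] -/
theorem stub_F1ext : Aux.canonicalModel_exists_ext_printed := by
  sorry

/-- **`stub_F1` — the v3–v11 registered printed citation I-1, a THEOREM since v12b** (F1 RETIRED IN TREE, B-typ03 ★ p609239
`Aux.canonicalModel_exists_printed_of_ext`: I-1 is the instance `(M, j, Φ, E) = (L, id, Φ, E♯(Φ))` of I-1′; `IsExtAdapted τ id Φ ↔ IsAdapted L Φ τ`,
`complexSystemExt_self`, `isCanonicalDescentAtExt_self_iff`).  Name kept so that the census compositions `HDel_of` / `HDel_of_census` /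
`smallReflexCase_of_F1` … can be fed from the v12 stub set. [cite: Deligne1979ShimuraVarieties, Criterion 2.3.1 and Prop. 2.3.10 (PDF pp. 29, 32 of Milne's translation)] -/
theorem stub_F1 : Aux.canonicalModel_exists_printed :=
  Aux.canonicalModel_exists_printed_of_ext stub_F1ext

/-- **`ExtHeckeQuotientDescentOver` (P3 of the K-twist, fan A — A-p05's LANDED head `HeckeQuotientExt.exists_isCanonicalDescentOver_of_ext_printed`
(★ p608612) VERBATIM as a `Prop`, with the printed fact I-1′ as antecedent; proved below by name)**: from the Ext fact, for every hDel datum, every complex record system `Sc`, every CM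
field `M ⊇ L` along `j` with an adapted CM type `Φ`, and every number field `E ⊆ ℂ` with `τ(L) ⊆ E` and `E*(Φ) ≤ E`: an `E`-form of the
`G`-tower `Sc.Mc` with Shimura reciprocity (62) at the line points (`IsCanonicalDescentOver Sc (algebraMap E ℂ)`) — the Hecke-quotient glue of
§§0–15 (Artin surjectivity over `E`, `kernelTwistInvariance`, the finite-quotient functor by the free `classGroup M L₀`-action, `L₀ := Aux.unitLevel M`,
class-group finiteness `Aux.finite_classGroup_printed_holds`) run over the Ext carriers.
[cite: Deligne1979ShimuraVarieties, 2.3.1, 2.2.5, 2.3.10 (PDF pp. 29, 32 of Milne's translation)] [cite: Deligne1971TravauxShimura, (5.11.1) p. 158]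
[cite: Milne2005ShimuraVarieties, Def. 12.8 (62) p. 114 and Thm. 13.6 p. 120] -/
def ExtHeckeQuotientDescentOver : Prop :=
  Aux.canonicalModel_exists_ext_printed →
    ∀ (L : Type) [Field L] [NumberField L] [IsCMField L] (H : Matrix (Fin 3) (Fin 3) L) (τ : L →+* ℂ)
      (T : GL (Fin 3) ℂ) (hT : formCongr (starRingEnd ℂ) T (H.map τ) = BallModel.J),
      (∀ τ' : L →+* ℂ, InfinitePlace.mk τ' ≠ InfinitePlace.mk τ → (H.map τ').PosDef) →
      (∀ v : Fin 3 → L, UnitaryGroup.hermForm (cmConjRingHom L) H v v = 0 → v = 0) →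
      ∀ K₀ : C5.OpenCompactSubgroup ↥(finAdelic (↥(maximalRealSubfield L)) L (IsCMField.complexConj L) 3 H),
        (∀ g : finAdelic (↥(maximalRealSubfield L)) L (IsCMField.complexConj L) 3 H,
          ∀ γ ∈ arithmeticLevel (↥(maximalRealSubfield L)) L (IsCMField.complexConj L) 3 H
            (K₀.1.map (MulAut.conj g).toMonoidHom), IsOfFinOrder γ → γ = 1) →
        ∀ (Sc : ComplexRecordSystem L H τ T hT K₀) (M : Type) [Field M] [NumberField M] [IsCMField M] (j : L →+* M)
          (Φ : CMType M), Aux.IsExtAdapted τ j Φ →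
          ∀ (E : IntermediateField ℚ ℂ) [FiniteDimensional ℚ ↥E], (∀ x : L, τ x ∈ E) → traceField Φ ≤ E →
            ∃ (M' : C5.SmallLevel K₀ ⥤ SchemeOver ↥E) (e' : (M' ⋙ Motives.baseChange ↥E ℂ) ≅ Sc.Mc),
              IsCanonicalDescentOver Sc (algebraMap ↥E ℂ) M' e'

/-- **P3 CLOSED BY NAME (v12)**: `ExtHeckeQuotientDescentOver` IS fan A's landed theorem
`HeckeQuotientExt.exists_isCanonicalDescentOver_of_ext_printed` (A-p05 ★ p608612, `Literature/AlgebraicGeometry/ShimuraVarieties/UnitaryAuxiliaryHeckeQuotientDescentExt.lean`,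
commit b9d2768c9d60: §§0–15 of this file re-run over the Ext carriers, `L₀ := Aux.unitLevel M`, class-group finiteness by
`Aux.finite_classGroup_printed_holds`) — binder-for-binder. [cite: Deligne1979ShimuraVarieties, 2.2.5 and 2.3.10 (PDF pp. 29, 32 of Milne's translation)]
[cite: Milne2005ShimuraVarieties, Thm. 13.6 p. 120 and (64) p. 119] -/
theorem extHeckeQuotientDescentOver_holds : ExtHeckeQuotientDescentOver :=
  fun h _L _ _ _ H τ T hT hpos hanis K₀ htf Sc M _ _ _ j Φ hΦ E _ hE hΦE =>
    HeckeQuotientExt.exists_isCanonicalDescentOver_of_ext_printed h H τ T hT hpos hanis K₀ htf Sc M j Φ hΦ E hE hΦE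

/-- **`TwistFieldSupply` (P2 of the K-twist, fan A — A-p05's `TwistFieldSupply` of P4scratch 0e32a4194d9800d4 VERBATIM = A-p06's P2 target
(a)–(d))**: every frame `τ : L → ℂ` of a CM field admits two CM number fields `E₁, E₂ ⊆ ℂ` containing `τ(L)` and square roots of `-p`, `-q`
(`p, q > 0`) with `E₁ ∩ E₂ ⊆ τ(L)` — e.g. `E_p = τ(L)(i√p)`, `E_q = τ(L)(i√q)` with `i√q ∉ E_p` (degrees `≤ 2` over `τ(L)`, so `E_p ⊓ E_q = τ(L)`;
all but finitely many `p, q` qualify since `E_p` has finitely many subfields; composita of CM fields are CM).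
[cite: Deligne1979ShimuraVarieties, Prop. 2.3.10 (i) (PDF p. 32 of Milne's translation)] [cite: Shimura1998, §8.3 Prop. 28] -/
def TwistFieldSupply : Prop :=
  ∀ (L : Type) [Field L] [NumberField L] [IsCMField L] (τ : L →+* ℂ),
    ∃ (E₁ E₂ : IntermediateField ℚ ℂ) (_ : FiniteDimensional ℚ ↥E₁) (_ : FiniteDimensional ℚ ↥E₂)
      (_ : IsCMField ↥E₁) (_ : IsCMField ↥E₂) (_ : ∀ x : L, τ x ∈ E₁) (_ : ∀ x : L, τ x ∈ E₂)
      (p q : ℕ) (_ : 0 < p) (_ : 0 < q) (w₁ : ↥E₁) (_ : w₁ * w₁ = -(p : ↥E₁)) (w₂ : ↥E₂) (_ : w₂ * w₂ = -(q : ↥E₂)),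
      ((E₁ ⊓ E₂ : IntermediateField ℚ ℂ) : Set ℂ) ⊆ Set.range τ

/-- **`stub_twistFieldSupply` — P2 CLOSED BY NAME (v12b; the v12 temporary stub is a THEOREM, name kept)**: the two twist fields
`E_p = τ(L)(r)`, `E_q = τ(L)(r′)` (`r² = -p`, `r′² = -q`, `p, q` prime, `r′ ∉ E_p`) of A-p06's landed
`Literature/NumberTheory/NumberFields/QuadraticTwistCompositum.lean` (★ p608990: `exists_prime_sq_roots_inf_subset_range`,
`exists_sq_root_mem_fieldRange_sup_adjoin`, `finiteDimensional_fieldRange_sup_adjoin`, `isCMField_fieldRange_sup_adjoin`,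
`apply_mem_fieldRange_sup_adjoin`), assembled into the ∃-tuple exactly as A-p06 posted 06:20:55Z.
[cite: Deligne1979ShimuraVarieties, 2.3.9–Prop. 2.3.10 (i) (PDF p. 32 of Milne's translation)] [cite: Shimura1998, §18.2 Lemma (i) p. 127] -/
theorem stub_twistFieldSupply : TwistFieldSupply := by
  intro L _ _ _ τ
  obtain ⟨p, q, r, r', hp, hq, hr, hr', -, hcap⟩ :=
    Literature.NumberTheory.NumberFields.exists_prime_sq_roots_inf_subset_range τ
  obtain ⟨w₁, -, hw₁⟩ := Literature.NumberTheory.NumberFields.exists_sq_root_mem_fieldRange_sup_adjoin τ hr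
  obtain ⟨w₂, -, hw₂⟩ := Literature.NumberTheory.NumberFields.exists_sq_root_mem_fieldRange_sup_adjoin τ hr'
  exact ⟨_, _, Literature.NumberTheory.NumberFields.finiteDimensional_fieldRange_sup_adjoin τ hr,
    Literature.NumberTheory.NumberFields.finiteDimensional_fieldRange_sup_adjoin τ hr',
    Literature.NumberTheory.NumberFields.isCMField_fieldRange_sup_adjoin τ hp.pos hr,
    Literature.NumberTheory.NumberFields.isCMField_fieldRange_sup_adjoin τ hq.pos hr',
    Literature.NumberTheory.NumberFields.apply_mem_fieldRange_sup_adjoin τ r,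
    Literature.NumberTheory.NumberFields.apply_mem_fieldRange_sup_adjoin τ r', p, q, hp.pos, hq.pos, w₁, hw₁, w₂, hw₂, hcap⟩

/-- **K-TWIST closing step, parametric in the two twist fields (A-p05's P4 composition, re-run here over the P3 stub).**  For an hDel
datum and `Sc`, CM number fields `E₁, E₂ ⊆ ℂ` containing `τ(L)` with square roots `w₁, w₂` of `-p, -q` and `E₁ ⊓ E₂ ⊆ τ(L)`: I-1′ at
`(M, j, Φ) := (↥Eᵢ, Aux.toFieldOfMem τ Eᵢ hᵢ, quadraticTwistCMType …)` (adapted by `mem_quadraticTwistCMType_of_comp_eq`, reflex bound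
`traceField_quadraticTwistCMType_le` + `τ(L) ⊔ ℚ(wᵢ) ≤ Eᵢ`), the Hecke-quotient glue over each `Eᵢ`, then I-6 at the pair.
[cite: Deligne1979ShimuraVarieties, 2.3.1, 2.2.5, 2.3.9–2.3.10] [cite: Deligne1971TravauxShimura, Prop. 5.10 p. 157 and (5.11.1)]
[cite: Shimura1998, §8.3 Prop. 28] -/
theorem isCanonicalDescentAt_of_kTwist (hF1e : Aux.canonicalModel_exists_ext_printed) (h510 : descentToIntersection_printed)
    (hHQ : ExtHeckeQuotientDescentOver)
    {L : Type} [Field L] [NumberField L] [IsCMField L] (H : Matrix (Fin 3) (Fin 3) L) (τ : L →+* ℂ)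
    (T : GL (Fin 3) ℂ) (hT : formCongr (starRingEnd ℂ) T (H.map τ) = BallModel.J)
    (hpos : ∀ τ' : L →+* ℂ, InfinitePlace.mk τ' ≠ InfinitePlace.mk τ → (H.map τ').PosDef)
    (hanis : ∀ v : Fin 3 → L, UnitaryGroup.hermForm (cmConjRingHom L) H v v = 0 → v = 0)
    (K₀ : C5.OpenCompactSubgroup ↥(finAdelic (↥(maximalRealSubfield L)) L (IsCMField.complexConj L) 3 H))
    (htf : ∀ g : finAdelic (↥(maximalRealSubfield L)) L (IsCMField.complexConj L) 3 H,
      ∀ γ ∈ arithmeticLevel (↥(maximalRealSubfield L)) L (IsCMField.complexConj L) 3 H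
        (K₀.1.map (MulAut.conj g).toMonoidHom), IsOfFinOrder γ → γ = 1)
    (Sc : ComplexRecordSystem L H τ T hT K₀)
    (E₁ E₂ : IntermediateField ℚ ℂ) [FiniteDimensional ℚ ↥E₁] [FiniteDimensional ℚ ↥E₂] [IsCMField ↥E₁] [IsCMField ↥E₂]
    (h₁ : ∀ x : L, τ x ∈ E₁) (h₂ : ∀ x : L, τ x ∈ E₂) {p q : ℕ} (hp : 0 < p) (hq : 0 < q)
    (w₁ : ↥E₁) (hw₁ : w₁ * w₁ = -(p : ↥E₁)) (w₂ : ↥E₂) (hw₂ : w₂ * w₂ = -(q : ↥E₂))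
    (hcap : ((E₁ ⊓ E₂ : IntermediateField ℚ ℂ) : Set ℂ) ⊆ Set.range τ) :
    ∃ (M : C5.SmallLevel K₀ ⥤ SchemeOver L) (e : (M ⋙ Motives.baseChangeHom τ) ≅ Sc.Mc), IsCanonicalDescentAt Sc M e := by
  haveI : NumberField ↥E₁ := NumberField.mk
  haveI : NumberField ↥E₂ := NumberField.mk
  -- the complex square roots of `-p`, `-q`
  have hr₁ : ((w₁ : ↥E₁) : ℂ) * ((w₁ : ↥E₁) : ℂ) = -(p : ℂ) := by
    have := congrArg (fun z : ↥E₁ => (z : ℂ)) hw₁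
    simpa using this
  have hr₂ : ((w₂ : ↥E₂) : ℂ) * ((w₂ : ↥E₂) : ℂ) = -(q : ℂ) := by
    have := congrArg (fun z : ↥E₂ => (z : ℂ)) hw₂
    simpa using this
  -- reflex bounds `τ(L) ⊔ ℚ(wᵢ) ≤ Eᵢ`
  have hle : ∀ (E : IntermediateField ℚ ℂ) (hE : ∀ x : L, τ x ∈ E) (w : ↥E),
      τ.toRatAlgHom.fieldRange ⊔ IntermediateField.adjoin ℚ {(w : ℂ)} ≤ E := by
    intro E hE w
    refine sup_le ?_ ?_
    · rintro _ ⟨x, rfl⟩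
      exact hE x
    · exact IntermediateField.adjoin_simple_le_iff.2 w.2
  -- the two `Eᵢ`-forms with (62): I-1′ at the quadratic-twist types, through the Hecke quotient (P3)
  have hM₁ := hHQ hF1e L H τ T hT hpos hanis K₀ htf Sc ↥E₁ (Aux.toFieldOfMem τ E₁ h₁)
    (quadraticTwistCMType (Aux.toFieldOfMem τ E₁ h₁) τ hp hw₁ hr₁)
    (fun ρ hρ => mem_quadraticTwistCMType_of_comp_eq (Aux.toFieldOfMem τ E₁ h₁) τ hp hw₁ hr₁ hρ) E₁ h₁
    ((traceField_quadraticTwistCMType_le (Aux.toFieldOfMem τ E₁ h₁) τ hp hw₁ hr₁).trans (hle E₁ h₁ w₁))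
  have hM₂ := hHQ hF1e L H τ T hT hpos hanis K₀ htf Sc ↥E₂ (Aux.toFieldOfMem τ E₂ h₂)
    (quadraticTwistCMType (Aux.toFieldOfMem τ E₂ h₂) τ hq hw₂ hr₂)
    (fun ρ hρ => mem_quadraticTwistCMType_of_comp_eq (Aux.toFieldOfMem τ E₂ h₂) τ hq hw₂ hr₂ hρ) E₂ h₂
    ((traceField_quadraticTwistCMType_le (Aux.toFieldOfMem τ E₂ h₂) τ hq hw₂ hr₂).trans (hle E₂ h₂ w₂))
  exact Summit.HodgeConjecture.CorCM.HypDel.isCanonicalDescentAt_of_descentToIntersection_of_pair h510 hpos hanis htf Sc E₁ E₂ h₁ h₂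
    hM₁ hM₂ hcap

/-- **The v11 residual R_nc is DISCHARGED by the K-twist** (modulo I-1′, I-6, P3, P2): `NonCensusBaseDescent` — indeed its conclusion holds
for EVERY datum, the census hypothesis and the `E♯(Φ)`-models being unused.  (So is the v10 residual `NoSmallReflexBaseDescent`, by
`noSmallReflexBaseDescent_of`.) [cite: Deligne1979ShimuraVarieties, 2.3.10 and Cor. 2.7.21] [cite: Deligne1971TravauxShimura, Prop. 5.10 p. 157] -/
theorem nonCensusBaseDescent_of_kTwist (hF1e : Aux.canonicalModel_exists_ext_printed) (h510 : descentToIntersection_printed)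
    (hHQ : ExtHeckeQuotientDescentOver) (hsup : TwistFieldSupply) : NonCensusBaseDescent := by
  intro L _ _ _ H τ T hT hpos hanis K₀ htf Sc _hnc _hover
  obtain ⟨E₁, E₂, _, _, _, _, h₁, h₂, p, q, hp, hq, w₁, hw₁, w₂, hw₂, hcap⟩ := hsup L τ
  exact isCanonicalDescentAt_of_kTwist hF1e h510 hHQ H τ T hT hpos hanis K₀ htf Sc E₁ E₂ h₁ h₂ hp hq w₁ hw₁ w₂ hw₂ hcap

/-- **`stub_nonCensusBaseDescent` — the v11 registered residual, a THEOREM from v12 on** (name kept so that v11 references resolve):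
R_nc from the v12 stubs by `nonCensusBaseDescent_of_kTwist`. [cite: Deligne1979ShimuraVarieties, 2.3.10 and Cor. 2.7.21] -/
theorem stub_nonCensusBaseDescent : NonCensusBaseDescent :=
  nonCensusBaseDescent_of_kTwist stub_F1ext stub_I6 extHeckeQuotientDescentOver_holds stub_twistFieldSupply

/-- **`stub_noSmallReflexBaseDescent` — the v10 registered residual, a THEOREM since v11** (name kept): the census split
`noSmallReflexBaseDescent_of` fed with `stub_I6` and the (now proved) `stub_nonCensusBaseDescent`.
[cite: Deligne1971TravauxShimura, Prop. 5.10 p. 157] [cite: Deligne1979ShimuraVarieties, Cor. 2.7.21] -/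
theorem stub_noSmallReflexBaseDescent : NoSmallReflexBaseDescent :=
  noSmallReflexBaseDescent_of stub_I6 stub_nonCensusBaseDescent

/-- **K-TWIST KERNEL: `HDel ⟸ I-1′ + I-6 + P3 + P2`** — `canonicalModel_exists_printed` (= the binder `hDel` = crux `HDel`, unfolded) for
EVERY CM field `L`: pass to the form by `canonicalModel_exists_printed_iff_form`, take the two twist fields from the supply, and apply
`isCanonicalDescentAt_of_kTwist`.  No census, no parity, no Galois hypothesis.
[cite: Deligne1979ShimuraVarieties, 2.2.5, 2.3.1, 2.3.10, Cor. 2.7.21] [cite: Deligne1971TravauxShimura, Prop. 5.10 p. 157] -/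
theorem HDel_of_kTwist (hF1e : Aux.canonicalModel_exists_ext_printed) (h510 : descentToIntersection_printed)
    (hHQ : ExtHeckeQuotientDescentOver) (hsup : TwistFieldSupply) : UnitaryCanonicalModel.canonicalModel_exists_printed := by
  refine canonicalModel_exists_printed_iff_form.2 fun L _ _ _ H τ T hT hpos hanis K₀ htf Sc => ?_
  obtain ⟨E₁, E₂, _, _, _, _, h₁, h₂, p, q, hp, hq, w₁, hw₁, w₂, hw₂, hcap⟩ := hsup L τ
  exact isCanonicalDescentAt_of_kTwist hF1e h510 hHQ H τ T hT hpos hanis K₀ htf Sc E₁ E₂ h₁ h₂ hp hq w₁ hw₁ w₂ hw₂ hcap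

/-- **The census line survives as the FALLBACK (kill switch of the 05:35:20Z ruling), hypothesis-parametrised and sorry-free**:
`HDel ⟸ I-1 (F1) + I-6 + R_nc` is `HDel_of_census` (§17); under the v12b stub set R_nc AND F1 are theorems (`stub_nonCensusBaseDescent`,
`stub_F1`), so the census composition is fed from the same two printed citations + P2 — kernel record that both roads agree. [cite: Deligne1979ShimuraVarieties, 2.2.5 and Cor. 2.7.21] [cite: Deligne1971TravauxShimura, Prop. 5.10 p. 157] -/
theorem HDel_of_census_of_kTwist : UnitaryCanonicalModel.canonicalModel_exists_printed :=
  HDel_of_census stub_F1 stub_I6 stub_nonCensusBaseDescent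

/-- **`HDel_proof` — the registered skeleton head for crux `HDel` (stmt-HodgeConjecture-24835), v13 (K-TWIST cut of record, one leaf)**: `HDel` from
the registered stubs `stub_F1ext` (printed citation I-1′, [Deligne 1979] 2.3.1/2.2.5 for the twisted auxiliary Hodge-type datum of 2.3.10),
`stub_I6` (I-6, [Deligne 1971] Prop. 5.10 — a THEOREM by name since v13, p616273) — so from EXACTLY ONE open leaf, I-1′ — through fan A's landed
P2 `stub_twistFieldSupply` (★ p608990, a theorem) and P3 `extHeckeQuotientDescentOver_holds` (★ p608612); the term of type `canonicalModel_exists_printed` is accepted at type `HDel` by unfolding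
(`HDel` := `HypDel` := `canonicalModel_exists_printed`).  HC_CM is proved only modulo the 7 printed citations until rung 0 closes.
[cite: Deligne1979ShimuraVarieties, 2.3.1, 2.2.5, 2.3.10 and Cor. 2.7.21] [cite: Deligne1971TravauxShimura, Prop. 5.10 p. 157] -/
theorem HDel_proof : Summit.HodgeConjecture.HodgeConjecture.Theses.HCCMUnconditional.HDel :=
  HDel_of_kTwist stub_F1ext stub_I6 extHeckeQuotientDescentOver_holds stub_twistFieldSupply

/- **AUDIT (v12c) — the two roads agree, by name, in kernel.**  Fan A's landed closing theorem
`Summit.HodgeConjecture.CorCM.HypDel.HDel_of_ext` (A-p05 ★ p610565, `Theorems/HDelOfHodgeTypeExt.lean`; hypotheses = the two named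
facts ONLY) fed with this file's two registered stubs elaborates at type `HDel`; so does its unfolded form.  `example`s add no constant, so
`HDel_proof` above stays the unique theorem of this file concluding the crux by name (skeleton lint).
[cite: Deligne1979ShimuraVarieties, 2.3.1, 2.2.5, 2.3.10] [cite: Deligne1971TravauxShimura, Prop. 5.10 p. 157] -/
example : Summit.HodgeConjecture.HodgeConjecture.Theses.HCCMUnconditional.HDel :=
  Summit.HodgeConjecture.CorCM.HypDel.HDel_of_ext stub_F1ext stub_I6

example : UnitaryCanonicalModel.canonicalModel_exists_printed :=
  Summit.HodgeConjecture.CorCM.HypDel.canonicalModel_exists_printed_of_ext stub_F1ext stub_I6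


end Summit.HodgeConjecture.CorCM.Cruxes.HypDel.HeckeQuotient
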